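import Summits.HodgeConjecture.HodgeConjecture.Theorems.F0P3cDbTEnvelopeTrichotomy   -- (= tree FILE A :1) ★ `constituent_trichotomy_of_memXiFamily`; brings `MemXiFamily`, `CMCharIdentityPackageTestSigned`, (H₇), `xiLocalChar`
import Summits.HodgeConjecture.HodgeConjecture.Theorems.F0P3cStCharTSNe              -- (= tree FILE A :2) ★ `ne_comap_keysLabels_of_isSupercuspidal`
import Literature.NumberTheory.Rogawski1990.CharIdentityOnTestFunctionsSignedLemmas  -- (= tree FILE A :3) ★ `CMNonsplitCharIdentityAtTestSigned.πs` ∕ `.charIdentityAtTestSigned_πs`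
import Literature.NumberTheory.Rogawski1990.FinExplicitTransferFactorConjLeft        -- (= tree FILE A :4) ★ `finExplicitCollection`, `finExplicitDelta_conj_left_all`
import Literature.NumberTheory.Rogawski1990.FinExplicitTransferFactorConjRight       -- (= tree FILE A :5) ★ `finExplicitDelta_conj_right_all`
import Literature.NumberTheory.Automorphic.OrbitalMeasureCanonical                   -- (= tree FILE A :6) ★ `OrbitalMeasureFamily.IsCanonical`, `IsLocalGRegular`, `IsRegularElt`
import Summits.HodgeConjecture.HodgeConjecture.Theorems.F0P3aArchDefinitePlace       -- ★ Landherr «anisotropic ⇒ definite at some `τ`» (`QuadraticForms.hermitianMatrix_exists_posDef_embedding_of_anisotropic`) + ★ bridge `F0P3aArchDefinitePlace.cmConjRingHom_eq_coe_complexConj`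
import Literature.NumberTheory.Automorphic.LocalHermitianFormsRankThree              -- ★ `UnitaryGroup.exists_formCongr_eq_smul_antidiag_of_hyperbolicPair` (Witt completion of a hyperbolic pair, rank 3)
import Literature.NumberTheory.Automorphic.UnitaryGroupIsotropicLineElements         -- ★ `UnitaryGroup.exists_hyperbolic_partner_hermForm` (an isotropic vector has a hyperbolic partner)
import Summits.HodgeConjecture.HodgeConjecture.Cruxes.H413.Lines.R90_S5_QuasiSplitRigidityD   -- (ED. 2, JUNCTION S9-J3) S5 socket file D (★-only-importing; tree cfa3a4b19487aba5, BUILT BW148): `R90.S5.SocketQsXiRigidity`, `R90.S5.stub_R90_1335_qsXiRigidity` — payment flows UP S5 → B → A → leaf (L9 (β)), no cycle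
import Summits.HodgeConjecture.HodgeConjecture.Theorems.R90S9DefiniteXiMembershipCut   -- (ED. 3) ★ p861479 `definiteXiMembership_of_ch14 : (AE-ⅰ) → (AE-ⅱ) → (B4)` (R90-IF-p04; imports ★ only, never a Lines file)
import Summits.HodgeConjecture.HodgeConjecture.Theorems.R90S9CongrOrbitalMeasureTransport   -- (ED. 3) ★ p861761 (B3d-(d2)): `formCongr_toLocalGL_inv_smul`, `isUnit_algebraMap_localRing` — the (B3) frame `e_v` of the B3 CUT's `hPkg` (`SocketSignedPackageTransport`)
import Summits.HodgeConjecture.HodgeConjecture.Theorems.R90S9SignedPackageCongrTransport   -- (ED. 3) ★ p861849 (B3d-(d3-pkg), R90-IF-p03): `cmCharIdentityPackageTestSigned_transport_of_simil` = the PAYER of `SocketSignedPackageTransport`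
import Summits.HodgeConjecture.HodgeConjecture.Theorems.R90S9AeXiTriggerOfAnisotropic      -- (ED. 3) ★ p861905 (B4a, R90-IF-p05): `definiteAeXiTrigger_holds` = the PAYER of `SocketAeXiTrigger` ((AE-ⅰ) «ENVELOPE ⟹ E.V.P.» for the definite inner form, via ★ `flath_of_anisotropic` p861871)
import Summits.HodgeConjecture.HodgeConjecture.Theorems.R90S9SimilitudeTransportCut        -- (ED. 3) ★ p862077 (the B3 CUT, R90-IF-p02): `similitudeTransport_of_parts (hPkg) : ‹(B3) body›` = the PAYER of `SocketSimilitudeTransport` modulo `SocketSignedPackageTransport`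
import Summits.HodgeConjecture.HodgeConjecture.Cruxes.H413.Lines.F0_T1InnerFormTraceIdentityKit
import Summits.HodgeConjecture.HodgeConjecture.Theorems.F0P3ClassificationKitV6
import Summits.HodgeConjecture.HodgeConjecture.Theorems.R90S9InnerFormSec146Scope
import Literature.NumberTheory.Rogawski1990.ArchCanonicalTransferFactor
import Literature.NumberTheory.Automorphic.UnitaryGroupBorelInduction
import Summits.HodgeConjecture.HodgeConjecture.Theorems.R90S9DefiniteAeRigidityStableRouteA2
import Summits.HodgeConjecture.HodgeConjecture.Theorems.R90S9DefiniteAeRigidityStableRouteArchA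
import Summits.HodgeConjecture.HodgeConjecture.Theorems.R90S9DatumOfRecordCM
import Summits.HodgeConjecture.HodgeConjecture.Cruxes.H413.Lines.R90_S5_GOfRecordC2
import Summits.HodgeConjecture.HodgeConjecture.Theorems.R90S9ArchProductHaarExists
import Summits.HodgeConjecture.HodgeConjecture.Theorems.R90S9LanglandsLemmaAtLevel
import Summits.HodgeConjecture.HodgeConjecture.Theorems.R90S9TransferPairExistsOfKitLaws
import Summits.HodgeConjecture.HodgeConjecture.Theorems.R90S9CoverROfDetector
import Summits.HodgeConjecture.HodgeConjecture.Theorems.R90S9PosDetectorOfArch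
import Summits.HodgeConjecture.HodgeConjecture.Theorems.F0P3GlobalPacketNValues
import Summits.HodgeConjecture.HodgeConjecture.Theorems.R90S9InnerFormSec146Data
import Summits.HodgeConjecture.HodgeConjecture.Cruxes.H413.Lines.F0_T1InnerFormTraceIdentityNonreg
import Summits.HodgeConjecture.HodgeConjecture.Theorems.R90S9ChiExpansionPayer
import Summits.HodgeConjecture.HodgeConjecture.Theorems.R90S9APacketsDisjointOfRecordSplit
import Literature.NumberTheory.Automorphic.LocalUnitaryIntegralLevelCongrSplit
import Summits.HodgeConjecture.HodgeConjecture.Theorems.R90S9Sec146AdaptersAtSmooth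
import Summits.HodgeConjecture.HodgeConjecture.Theorems.R90S9CoverOfPartnerAtLevelDatum
import Summits.HodgeConjecture.HodgeConjecture.Theorems.R90S9LiftGradeOfFunctional
import Summits.HodgeConjecture.HodgeConjecture.Theorems.R90S9HtPOfPacketRigidity
import Summits.HodgeConjecture.HodgeConjecture.Theorems.F0P3XiPacketFamilyOfRecordGlue
import Summits.HodgeConjecture.HodgeConjecture.Theorems.F0P3KeysCaseTwoOfStubs
import Summits.HodgeConjecture.HodgeConjecture.Theorems.F0P2oLocalLettersHold
import Summits.HodgeConjecture.HodgeConjecture.Theorems.F0P3U3SquareIntegrableExponentsHolds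
import Summits.HodgeConjecture.HodgeConjecture.Theorems.F0P3cPinCompactChi
import HarnessLib

/-!
# R90-TF · S9 «InnerForm-13.3.6 (c)» — FILE B (ED. 3): the PAY-DOWN LAYER for FILE A's one socket `stub_globalXiMembership`, by REAL SIGNATURES
# «`H` definite at some complex place `τ` (`G′_τ ≅ U₃(ℝ)` compact: the §14.6 inner form) ∕ `H` indefinite at every `τ` (⟹ `H` similar to `Φ₃`: the quasi-split `U(3)`)»

Cell `hodgecm-mathlib`, crux H413 (`stmt-HodgeConjecture-24833`), route of record `HCCMUnconditional` (no route verbs; count-neutral).  Programme R90-TF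
(HUMAN RULING «R90-TF SLAB — MAX PUSH», ladder-directors/REQUESTS.md l.72925; brief `director/R90-BRIEF.v2.md` 1f40d54518340a35), section S9 = InnerForm-13.3.6 (c)
(base `R90-IF`).  Seat R90-IF-typ2 (g0) = S9-typ2; content = R90-IF-plan (g0) «S9 DEAL #1 (2)» (R90 bus 2026-09-04T15:01:42Z) AS AMENDED by «S9 SOCKET PLAN v1» §2
(`R90/R90-IF-plan/g0/S9-SOCKET-PLAN.v1.md` e5c11d386813f2da, 15:06:20Z: dichotomy by real signatures, names B0–B4) and «S9 SOCKET PLAN v1.1» (15:10:19Z: LAW L9 (β) of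
R90-TF LEAD #8 — imports flow ★ → FILE B → FILE A → LH10 leaf; THIS FILE IS A-FREE: it imports tree FILE A's six ★ modules + three ★ algebra modules + (ED. 2) S5's
★-only-importing socket file D, never FILE A).
ED. 2 (tree commit 02e78840a13e, sha16 e58eb06eba1851d4, BUILT BW169, «AUDIT S9-B ED. 2: CLEAN» 15:31:43Z; ED. 1 = tree commit 5ea9eefa966e, sha16 01d1e16fb257490e, BUILT BW151, «AUDIT S9-B (OF RECORD): B0–B4 + HEAD CLEAN, NO VACUOUS STUB» R90-IF-audit1 (g0)
15:23:08Z, fix-list = docstring page digits only) = JUNCTION CALL S9-J3 (R90-IF-plan (g0) 15:23:38Z): (B1) `SocketQsXiMembership` IS S5#4 `R90.S5.SocketQsXiRigidity` (tree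
`R90_S5_QuasiSplitRigidityD.lean` :88 — the same (S-G) body at `H := Φ₃`, the two Prop-proof arguments proof-irrelevant; `Iff.rfl`, read-back
`socketQsXiMembership_iff_qsXiRigidity`) ⇒ ONE LEAF, HOMED IN S5: `sock_S9_qsXiMembership := fun L _ _ _ => R90.S5.stub_R90_1335_qsXiRigidity L` (name and statement
bytes FROZEN, `sorry` gone).  Every `def` and the HEAD ∕ `xiMembershipAt_paidB` bytes are ED. 1's; sorries 3 → 2 (`sock_S9_similitudeTransport`, `sock_S9_definiteXiMembership`).
ED. 3 (this edition) = RULING R90-IF-plan (g0) 16:12:10Z ∕ «B ED. 3 PLAN» 15:44:55Z — the p04 PATTERN on BOTH open organs (a ★ CUT theorem whose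
conclusion is the socket body TOKEN FOR TOKEN and whose binders become typed SUB-SOCKETS VERBATIM, paid BY NAME as their ★ payers land): (B3) `sock_S9_similitudeTransport :=
similitudeTransport_of_parts sock_S9_signedPackageTransport` over the ★ B3 CUT `R90S9SimilitudeTransportCut` (R90-IF-p02, p862077; B3a ★ p861490∕p861645, B3b ★
p861492∕p861741, (d2) ★ p861761, (d3) ★ p861691∕p861743∕p861795, (d4) ★, read-back ★ p861411 inside) with the ONE sub-socket `SocketSignedPackageTransport` (= the cut's
binder `hPkg` VERBATIM) itself PAID by ★ p861849 `cmCharIdentityPackageTestSigned_transport_of_simil` (R90-IF-p03) ⇒ (B3) carries NO kernel leaf; (B4)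
`sock_S9_definiteXiMembership := definiteXiMembership_of_ch14 sock_S9_aeXiTrigger sock_S9_definiteAeRigidity` over ★ p861479 `R90S9DefiniteXiMembershipCut` (R90-IF-p04)
with sub-sockets `SocketAeXiTrigger` (= binder `hAE` VERBATIM; PAID by ★ p861905 `definiteAeXiTrigger_holds`, R90-IF-p05, via ★ p861871 «AFA at anisotropic `H`»
UNCONDITIONAL — Godement compactness) and `SocketDefiniteAeRigidity` (= binder `hRig` VERBATIM; STUB `sock_S9_definiteAeRigidity` = (AE-ⅱ) «E.V.P. AT THE S-G STRING ⟹
(S-G)», the §14.5∕14.6 comparison for the definite inner form — S9's ONE internal kernel leaf after this edition, already CUT by R90-IF-p06 for ED. 4).  Every ED. 1∕ED. 2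
`def`, the HEAD, `xiMembershipAt_paidB` and every statement line are byte-frozen (guard 17∕17); sorries 2 → 1 (`sock_S9_definiteAeRigidity`).
Namespace `Summit.HodgeConjecture.HodgeConjecture.R90.S9` (shared with FILE A `R90_S9_InnerFormXiRigiditySockets.lean`, tree ED. 1 4ec8b02abbbf79d1, commit 36b3d133aee9).
HONEST LABEL: HC_CM is proved only modulo the 7 printed citations (2 remaining named inputs: hLiu418 = stmt-HodgeConjecture-24832, h413 = stmt-HodgeConjecture-24833)
— DISTANCE TO ZERO: citations 3 ∕ leaves 7+ (closable 3 · S-layer 5+) ∕ axioms 0 — until rung 0 closes.  This file proves NOTHING printed about automorphic forms: it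
SPLITS FILE A's (S-G) `SocketGlobalXiMembership` («13.3.6 (c) ∕ §14.6 at print's pinned data», for EVERY hermitian `H ∈ M₃(L)` with `det H` a unit) along the line print
draws [§1.9 p. 8 «if `D = Mₙ(E)` then `G = U_Φ` … if `n` is odd there is a unique isomorphism class» (of quasi-split `U_Φ`); Ch. 14 p. 231 «let `G′` be an inner form of
`G` … We assume that `G′` is NOT isomorphic to `G` over `F`»; §14.2 p. 232 «`S₀` = the infinite places `v` with `G′_v ≅ U₃(ℝ)`»; §14.5 p. 237 «Since `G′` is anisotropic
…»; §14.6 p. 243 «assume `D = M₃(E)`»], read through Landherr's theorem [La36] (odd rank: the isomorphism class of `U(H)` is decided by the signatures of `H`):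
* `H` DEFINITE at some `τ` (`τ(H)` or `-τ(H)` positive definite) ⟹ `U(H)(L⁺_τ) ≅ U₃(ℝ)` is compact, `H` is anisotropic over `L`, and `G′ = U(H)` is the honest inner form
  of Ch. 14 with `D = M₃(E)`, `S₀ ∋ τ`: (S-G) there is THE §14.6 PRINT LEAF (B4) [Thm. 14.6.1 (14.6.1)∕(14.6.2) pp. 241–242 + Thm. 14.6.4 p. 243];
* `H` INDEFINITE at every `τ` ⟹ `H = ᵗB̄ · (a • Φ₃) · B` is SIMILAR to the split form (B2 — PAID in this file over ★: «anisotropic ⇒ definite somewhere» (Landherr ∕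
  Hasse–Minkowski, tree) makes `H` isotropic, Witt splits off a hyperbolic plane) ⟹ `U(H) ≃ U(a • Φ₃) = U(Φ₃) = U(3)` over `L⁺` — print's QUASI-SPLIT group, where
  13.3.6 (c) is Rogawski's own theorem [§13.3 p. 202] = section S5's spine (B1) — and what remains is TRANSPORT of the pinned data along `Ad(B)` (B3).
Kernel leaves (ED. 3): FILE A's 1 stub `stub_globalXiMembership` ↦ this file's ONE stub `sock_S9_definiteAeRigidity` ((AE-ⅱ), beneath the PAID (B4); (B3) PAID outright via
the ★ cut + ★ p861849) + S5#4's `R90.S5.stub_R90_1335_qsXiRigidity` BY IMPORT (pays `sock_S9_qsXiMembership`, JUNCTION S9-J3); (B2) `sock_S9_indefiniteSimilitude` is PAID (`:= indefiniteSimilitude_holds`, no sorry; LEAD C4 «never socket a ★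
item» — dealt as a stub «closable today», found ★-closable while typing).  HEAD `xiMembershipAt_of_cases` PROVED.  Distance by name UNCHANGED; the split names who pays what.

## CONTENTS (statements over ★ currency; (B1), (B3), (B4) are IMPLIED BY `∀ L H hH hHd, XiMembershipAt L H hH hHd` = FILE A's (S-G) — certificates `*_of_forall_at`, C2′)
* (B0) `XiMembershipAt L H hH hHd` — the (S-G) body with `L, H, hH, hHd` made parameters: tree FILE A 4ec8b02abbbf79d1 :240–:307 BYTE-VERBATIM (= S9-typ1's certified block
  `R90/S9/LH10-typ1-g0/CERT-B0-XiMembershipAt.lean` 3edf0ec5e434797a :29–:101), nothing weakened or reordered.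
* (B1) `SocketQsXiMembership := ∀ L, XiMembershipAt L Φ₃ _ _` (witnesses ★ `antidiagOne_isHermitian L 3`, ★ `isUnit_antidiagOne_det L 3`; `Φ₃ = qsForm L`) — 13.3.6 (c) on the
  QUASI-SPLIT `U(3)` at print's pinned data = the S5 → S9 IMPORT EDGE = S5#4 `R90.S5.SocketQsXiRigidity` ON THE NOSE (`Iff.rfl`; JUNCTION CALL S9-J3): PAID
  `sock_S9_qsXiMembership := fun L _ _ _ => R90.S5.stub_R90_1335_qsXiRigidity L` (ED. 2) — ONE LEAF, HOMED IN S5 (first GREEN BW148, LEAD #6 (1)).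
* (B2) `SocketIndefiniteSimilitude` — «hermitian `H`, `det H` a unit, indefinite at every `τ` ⟹ `∃ B ∈ GL₃(L), ∃ a = ā ≠ 0, ᵗB̄ · (a • Φ₃) · B = H`»; PAID (§2).
* (B3) `SocketSimilitudeTransport` — «`ā = a ≠ 0`, `ᵗB̄ · (a • Φ₃) · B = H` ⟹ (`XiMembershipAt L Φ₃ → XiMembershipAt L H`)»; stub `sock_S9_similitudeTransport` = ONE honest stub at
  ED. 1 (the representation-level transport does not exist in the tree yet); its ED. 2 sockets are named in the decl docstring from R90-IF-plan's Q3 CURRENCY CENSUS.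
  ED. 3: PAID — `:= similitudeTransport_of_parts sock_S9_signedPackageTransport` (★ cut, R90-IF-p02) with `sock_S9_signedPackageTransport` PAID (★ p861849); sub-socket
  `SocketSignedPackageTransport` (§1b) = the cut's `hPkg` binder VERBATIM.
* (B4) `SocketDefiniteXiMembership := ∀ L H hH hHd, (H anisotropic over L) → (∃ τ, τ(H) ∨ -τ(H) pos. def.) → XiMembershipAt L H hH hHd` — THE §14.6 PRINT LEAF at print's
  pinned data with print's two guards «`G′` anisotropic» [§14.5] ∧ «`S₀ ≠ ∅`, `D = M₃(E)`» [§14.6] as hypotheses (RULING S9-R2; the HEAD derives the first from the second); stub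
  `sock_S9_definiteXiMembership` (ED. 2: a C5 datum from ★ currency + `stub_thm1461_cm` ∕ `stub_thm1464a_cm` beneath it — NOT the ∀-over-posited-carrier shells of
  `Rogawski1990/Ch14Sec6.lean`, LEAD #3 F-π «POSITED-CARRIER WALL»).
  ED. 3: PAID modulo ONE sub-socket — `:= definiteXiMembership_of_ch14 sock_S9_aeXiTrigger sock_S9_definiteAeRigidity` (★ p861479, R90-IF-p04); §1b sub-sockets
  `SocketAeXiTrigger` (= `hAE` VERBATIM, PAID ★ p861905) ∕ `SocketDefiniteAeRigidity` (= `hRig` VERBATIM, STUB — the (AE-ⅱ) leaf).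
* HEAD (PROVED, `by_cases` on «∃ τ definite»; `hanis` from `hS₀` by ★ `anisotropic_of_posDef_map`): `xiMembershipAt_of_cases : SocketQsXiMembership → SocketIndefiniteSimilitude → SocketSimilitudeTransport →
  SocketDefiniteXiMembership → ∀ L H hH hHd, XiMembershipAt L H hH hHd`; PAID `xiMembershipAt_paidB : ∀ L H hH hHd, XiMembershipAt L H hH hHd`.

## PAY LINES (by name; nothing restated by the consumer; LAW L9 (β))
* FILE A ED. 2 (S9-typ1's pen, after this file is BUILT + «AUDIT S9-B: CLEAN»): `import …Cruxes.H413.Lines.R90_S9_InnerFormTransportB` +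
  `theorem globalXiMembership_iff_forall_at : SocketGlobalXiMembership ↔ ∀ L _ _ _ H hH hHd, XiMembershipAt L H hH hHd := Iff.rfl` +
  `theorem stub_globalXiMembership : SocketGlobalXiMembership := fun L _ _ _ H hH hHd => xiMembershipAt_paidB L H hH hHd` (name kept, sorry gone; statement bytes frozen);
  the LH10 leaf's certified pay line `:= R90.S9.xiPacketRigidCoreSc_paid` stays byte-stable.
* WHO PAYS: `sock_S9_qsXiMembership` ← S5#4 `R90.S5.stub_R90_1335_qsXiRigidity` BY NAME (ED. 2, J3; behind it S5's spine: 13.3.5 ∕ 13.3.6 (c) on `U(3)` [§13.3 p. 202] +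
  residual (i) of LH10-p01 (g22) («unramified JH constituent of `i_G(χ_ξ)` = `πⁿ`» [§12.2 (2) p. 174]) + (iii) the `πˢ`-identification SIGNED at `Δ‴` [13.1.4, §4.9]); `sock_S9_similitudeTransport` ← PAID (ED. 3:
  ★ cut R90-IF-p02 + ★ p861849 R90-IF-p03 + ★ p861761 R90-IF-p01); `sock_S9_definiteXiMembership` ← PAID modulo `sock_S9_definiteAeRigidity` (ED. 3: ★ p861479 +
  ★ p861905); `sock_S9_definiteAeRigidity` ← S6∕S7∕S5∕S8 junction pins + S9-local pins via R90-IF-p06's (AE-ⅱ) cut over R90-IF-p01's concrete `Ch14Sec6` datum (ED. 4).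

[cite: Rogawski1990, §1.9 p. 8; Ch. 14 p. 231; §14.2 p. 232; §14.5 p. 237; §14.6 Thm. 14.6.1 p. 241, (14.6.2) p. 242, Thm. 14.6.4 p. 243; §13.3 Thm. 13.3.6 (c) p. 202; §13.1 Prop. 13.1.3 (d), Prop. 13.1.4 p. 199; §12.2 (2) p. 174]
[cite: Landherr1936HermitianForms] [cite: Jacobowitz1962, §3 Thm. 3.1] [cite: Dieudonne1971GroupesClassiques, Chap. II §5]
-/

set_option autoImplicit false
set_option linter.dupNamespace false

noncomputable section

open NumberField IsDedekindDomain MeasureTheory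
open scoped Matrix ComplexOrder

open Literature.NumberTheory Literature.NumberTheory.Automorphic Literature.NumberTheory.Automorphic.UnitaryGroup
open Literature.NumberTheory.Automorphic.IdeleClassGroup
open Literature.NumberTheory.GaloisRepresentations
open Literature.NumberTheory.Rogawski1990
open Summit.HodgeConjecture.HodgeConjecture.Cruxes.H413

namespace Summit.HodgeConjecture.HodgeConjecture.R90.S9

/-! ## §0 (B0) The (S-G) body at a FIXED `(L, H)` — tree FILE A :240–:307 verbatim, A-free (the `Iff.rfl` bridge to `SocketGlobalXiMembership` lives in FILE A ED. 2, LAW L9 (β)) -/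

/-- **(B0) `XiMembershipAt L H hH hHd`** — «13.3.6 (c) ∕ §14.6 AT PRINT'S PINNED DATA» for ONE CM field `L` and ONE hermitian `H ∈ M₃(L)` (`ᵗH̄ = H`, `det H` a unit):
the binders and conclusion of FILE A's (S-G) `SocketGlobalXiMembership` after `(hHd : IsUnit H.det)` BYTE-VERBATIM (tree 4ec8b02abbbf79d1 :240–:307; nothing weakened,
nothing reordered) — every `v`-constituent `c` of a discrete `P` of `U(H)` with `MemXiFamily P … ξ`, at a non-split `v` with Keys labels `(π², πⁿ)`, `πⁿ` not `L²`, is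
`πⁿ ∘ e` OR `π² ∘ e` OR `((hQS ξ).1 v …).πs`.  FILE A's `SocketGlobalXiMembership` is `∀ L H hH hHd, XiMembershipAt L H hH hHd` on the nose (`Iff.rfl`; certified A-side by S9-typ1's
`CERT-B0-XiMembershipAt.lean` 3edf0ec5e434797a and restated in FILE A ED. 2 as `globalXiMembership_iff_forall_at` — LAW L9 (β): this file does NOT import FILE A).
[cite: Rogawski1990, §13.3 Thm. 13.3.6 (c) p. 202; §14.6 Thm. 14.6.1 p. 241, Thm. 14.6.4 p. 243; §12.2 (2) p. 174; §13.1 Prop. 13.1.3 (d), Prop. 13.1.4 p. 199; §14.2 p. 232] -/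
def XiMembershipAt (L : Type) [Field L] [NumberField L] [IsCMField L] (H : Matrix (Fin 3) (Fin 3) L)
    (hH : (H.map (cmConjRingHom L))ᵀ = H) (hHd : IsUnit H.det) : Prop :=
  ∀ [∀ v : HeightOneSpectrum (𝓞 ↥(maximalRealSubfield L)), MeasurableSpace ((cmDatum L 3 H).Local v)]
    [∀ v : HeightOneSpectrum (𝓞 ↥(maximalRealSubfield L)),
      MeasurableSpace ((cmDatum L 2 (Matrix.of fun i j : Fin 2 => if i.val + j.val + 1 = 2 then (1 : L) else 0)).Local v ×
        (cmDatum L 1 (Matrix.of fun i j : Fin 1 => if i.val + j.val + 1 = 1 then (1 : L) else 0)).Local v)]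
    [∀ (v : HeightOneSpectrum (𝓞 ↥(maximalRealSubfield L)))
        (a : ((cmDatum L 2 (Matrix.of fun i j : Fin 2 => if i.val + j.val + 1 = 2 then (1 : L) else 0)).Local v ×
          (cmDatum L 1 (Matrix.of fun i j : Fin 1 => if i.val + j.val + 1 = 1 then (1 : L) else 0)).Local v)),
      MeasurableSpace (((cmDatum L 2 (Matrix.of fun i j : Fin 2 => if i.val + j.val + 1 = 2 then (1 : L) else 0)).Local v ×
          (cmDatum L 1 (Matrix.of fun i j : Fin 1 => if i.val + j.val + 1 = 1 then (1 : L) else 0)).Local v) ⧸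
        Subgroup.centralizer ({a} : Set ((cmDatum L 2 (Matrix.of fun i j : Fin 2 => if i.val + j.val + 1 = 2 then (1 : L) else 0)).Local v ×
          (cmDatum L 1 (Matrix.of fun i j : Fin 1 => if i.val + j.val + 1 = 1 then (1 : L) else 0)).Local v)))]
    [∀ (v : HeightOneSpectrum (𝓞 ↥(maximalRealSubfield L))) (γ : (cmDatum L 3 H).Local v),
      MeasurableSpace ((cmDatum L 3 H).Local v ⧸ Subgroup.centralizer ({γ} : Set ((cmDatum L 3 H).Local v)))]
    (Δ : ∀ v : HeightOneSpectrum (𝓞 ↥(maximalRealSubfield L)), LocalTransferFactor L H v)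
    (mH : ∀ v : HeightOneSpectrum (𝓞 ↥(maximalRealSubfield L)),
      OrbitalMeasureFamily ((cmDatum L 2 (Matrix.of fun i j : Fin 2 => if i.val + j.val + 1 = 2 then (1 : L) else 0)).Local v ×
        (cmDatum L 1 (Matrix.of fun i j : Fin 1 => if i.val + j.val + 1 = 1 then (1 : L) else 0)).Local v))
    (mG : ∀ v : HeightOneSpectrum (𝓞 ↥(maximalRealSubfield L)), OrbitalMeasureFamily ((cmDatum L 3 H).Local v))
    (νG : ∀ v : HeightOneSpectrum (𝓞 ↥(maximalRealSubfield L)), Measure ((cmDatum L 3 H).Local v))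
    (νH : ∀ v : HeightOneSpectrum (𝓞 ↥(maximalRealSubfield L)),
      Measure ((cmDatum L 2 (Matrix.of fun i j : Fin 2 => if i.val + j.val + 1 = 2 then (1 : L) else 0)).Local v ×
        (cmDatum L 1 (Matrix.of fun i j : Fin 1 => if i.val + j.val + 1 = 1 then (1 : L) else 0)).Local v))
    [∀ v : HeightOneSpectrum (𝓞 ↥(maximalRealSubfield L)), BorelSpace ((cmDatum L 3 H).Local v)]
    [∀ v : HeightOneSpectrum (𝓞 ↥(maximalRealSubfield L)),
      BorelSpace ((cmDatum L 2 (Matrix.of fun i j : Fin 2 => if i.val + j.val + 1 = 2 then (1 : L) else 0)).Local v ×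
        (cmDatum L 1 (Matrix.of fun i j : Fin 1 => if i.val + j.val + 1 = 1 then (1 : L) else 0)).Local v)]
    [∀ (v : HeightOneSpectrum (𝓞 ↥(maximalRealSubfield L)))
        (a : ((cmDatum L 2 (Matrix.of fun i j : Fin 2 => if i.val + j.val + 1 = 2 then (1 : L) else 0)).Local v ×
          (cmDatum L 1 (Matrix.of fun i j : Fin 1 => if i.val + j.val + 1 = 1 then (1 : L) else 0)).Local v)),
      BorelSpace (((cmDatum L 2 (Matrix.of fun i j : Fin 2 => if i.val + j.val + 1 = 2 then (1 : L) else 0)).Local v ×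
          (cmDatum L 1 (Matrix.of fun i j : Fin 1 => if i.val + j.val + 1 = 1 then (1 : L) else 0)).Local v) ⧸
        Subgroup.centralizer ({a} : Set ((cmDatum L 2 (Matrix.of fun i j : Fin 2 => if i.val + j.val + 1 = 2 then (1 : L) else 0)).Local v ×
          (cmDatum L 1 (Matrix.of fun i j : Fin 1 => if i.val + j.val + 1 = 1 then (1 : L) else 0)).Local v)))]
    [∀ (v : HeightOneSpectrum (𝓞 ↥(maximalRealSubfield L))) (γ : (cmDatum L 3 H).Local v),
      BorelSpace ((cmDatum L 3 H).Local v ⧸ Subgroup.centralizer ({γ} : Set ((cmDatum L 3 H).Local v)))]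
    [∀ v, (νG v).IsHaarMeasure] [∀ v, (νG v).IsMulRightInvariant] [∀ v, (νH v).IsHaarMeasure] [∀ v, (νH v).IsMulRightInvariant],
    ∀ (μω : HeckeCharacter L) (hμu : μω.IsUnitary),
    (∀ x : Literature.NumberTheory.GaloisRepresentations.ideleGroup ↥(maximalRealSubfield L),
      μω (AdeleRing.ideleBaseChange (↥(maximalRealSubfield L)) L x) = quadraticHeckeCharCM L x) →
    Δ = finExplicitCollection L H μω (finExplicitDelta_conj_left_all L H μω) (finExplicitDelta_conj_right_all L H μω) →
    (∀ v : HeightOneSpectrum (𝓞 ↥(maximalRealSubfield L)), (mH v).IsCanonical (IsLocalGRegular L v) (νH v) ∧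
      (mG v).IsCanonical (fun γ => IsRegularElt (γ.val : GL (Fin 3) (UnitaryGroup.LocalRing L v))) (νG v)) →
    ∀ (hQS : CMCharIdentityPackageTestSigned L H hH hHd νH νG μω hμu Δ mH mG),
    (∀ v : HeightOneSpectrum (𝓞 ↥(maximalRealSubfield L)), (∀ w : PlacesOver L v, IsCMField.complexConj L • w.1 = w.1) →
      IsLocalDeltaTransferExists L H v (Δ v) (mH v) (mG v) Literature.NumberTheory.Rogawski1990.IsLocSmooth
        Literature.NumberTheory.Rogawski1990.IsLocSmooth) →
    ∀ (ξ : OneDimAutRepH L)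
      (μA : Measure (adelicGroupData (↥(maximalRealSubfield L)) L (IsCMField.complexConj L) 3 H).automorphicQuotient)
      [(adelicGroupData (↥(maximalRealSubfield L)) L (IsCMField.complexConj L) 3 H).IsAutomorphicMeasure μA]
      (P : DiscreteAutomorphicRep (adelicGroupData (↥(maximalRealSubfield L)) L (IsCMField.complexConj L) 3 H) μA),
      MemXiFamily P hH hHd μω hμu ξ →
      ∀ (v : HeightOneSpectrum (𝓞 ↥(maximalRealSubfield L))) (hns : ∀ w : PlacesOver L v, IsCMField.complexConj L • w.1 = w.1),
      ∀ (T : GL (Fin 3) (LocalRing L v)) (a : LocalRing L v) (ha : IsUnit a)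
        (h : formCongr (conjLocal L (IsCMField.complexConj L) v) T (H.map (algebraMap L (LocalRing L v))) =
          a • (Matrix.of fun i j : Fin 3 => if i.val + j.val + 1 = 3 then (1 : L) else 0).map (algebraMap L (LocalRing L v))),
      ∀ [MeasurableSpace (Gqs L v ⧸ Subgroup.center (Gqs L v))] [BorelSpace (Gqs L v ⧸ Subgroup.center (Gqs L v))]
        (μZ : Measure (Gqs L v ⧸ Subgroup.center (Gqs L v))) [μZ.IsHaarMeasure],
      ∀ (π2 πn : IrrClass (Gqs L v)),
      ∀ (hK : KeysCaseTwoLabels L v (μω.semilocalComponent L v) (torusLocalComponent L (IsCMField.complexConj L) v ξ.η)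
          (torusLocalComponent L (IsCMField.complexConj L) v ξ.ψ) π2 πn)
        (hn : ¬ πn.IsSquareIntegrable μZ),
        -- (S-G) «13.3.6 (c) ∕ §14.6 AT PRINT'S PINNED DATA»: every v-constituent of P is πⁿ ∘ e, π² ∘ e, or the πˢ(ξ_v) ∘ e of `hQS`
        ∀ c : IrrClass ((cmDatum L 3 H).Local v),
          (IrrClass.comap (localPiEquiv L (IsCMField.complexConj L) 3 H v) c).IsConstituentOf
              (P.finRep.smoothPart.toRepresentation.comp (inclPlace (↥(maximalRealSubfield L)) L (IsCMField.complexConj L) 3 H v)) →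
          c = IrrClass.comap (cmDatumLocalCongr L v T ha h).symm πn ∨
            c = IrrClass.comap (cmDatumLocalCongr L v T ha h).symm π2 ∨
            c = ((hQS ξ).1 v hns T a ha h μZ π2 πn hK hn).πs

/-! ## §1 The sockets (B1)–(B4): dichotomy by REAL SIGNATURES (S9 SOCKET PLAN v1 §2 ∕ v1.1) — `H` definite at some `τ` (a compact place `τ ∈ S₀`, §14.2) or indefinite at every `τ` -/

/-- **(B1) `SocketQsXiMembership`** — «13.3.6 (c) ∕ §14.6 at print's pinned data» for the QUASI-SPLIT form `Φ₃ = antidiag(1,1,1) = qsForm L` (`U(Φ₃) = U(3)`),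
i.e. `XiMembershipAt L Φ₃` with the ★ witnesses `antidiagOne_isHermitian L 3` (`ᵗΦ̄₃ = Φ₃`) and `isUnit_antidiagOne_det L 3`: at a non-split `v`, every
`v`-constituent of a discrete `P` of `U(3)` inside the `ξ`-family with Keys labels `(π², πⁿ)` is `πⁿ ∘ e`, `π² ∘ e` or the signed-identified `πˢ` — Rogawski's
Theorem 13.3.6 (c) on `U(3)` in `MemXiFamily` currency.  The S5 → S9 IMPORT EDGE: `δ`-EQUAL to S5#4 `R90.S5.SocketQsXiRigidity` (JUNCTION S9-J3, read-back
`socketQsXiMembership_iff_qsXiRigidity := Iff.rfl`); PAID by `sock_S9_qsXiMembership` from `R90.S5.stub_R90_1335_qsXiRigidity` (ED. 2).  Statement bytes = ED. 1.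
[cite: Rogawski1990, §13.3 Thm. 13.3.6 (c) p. 202; §12.2 (2) p. 174; §13.1 Prop. 13.1.4 p. 199] -/
def SocketQsXiMembership : Prop :=
  ∀ (L : Type) [Field L] [NumberField L] [IsCMField L],
    XiMembershipAt L (qsForm L) (antidiagOne_isHermitian L 3) (isUnit_antidiagOne_det L 3)

/-- **(B2) `SocketIndefiniteSimilitude`** — «a hermitian `H ∈ M₃(L)` (`ᵗH̄ = H`, `det H` a unit) that is INDEFINITE at every complex embedding `τ` (neither `τ(H)`
nor `-τ(H)` positive definite) is SIMILAR to the split form: `ᵗB̄ · (a • Φ₃) · B = H` for some `B ∈ GL₃(L)` and some `a ∈ L⁺` (`ā = a`), `a ≠ 0`» — pure algebra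
[Landherr 1936: in odd rank the signatures decide similarity; Rogawski §1.9 p. 8].  PAID in §2 (`indefiniteSimilitude_holds`): ★ «anisotropic ⇒ definite at some `τ`»
(`QuadraticForms.hermitianMatrix_exists_posDef_embedding_of_anisotropic`, Landherr∕Hasse–Minkowski in the tree) makes such an `H` ISOTROPIC, and Witt (★
`exists_hyperbolic_partner_hermForm`, ★ `exists_formCongr_eq_smul_antidiag_of_hyperbolicPair`) frames it as `b • Φ₃`.  Hypothesis satisfiable (`H := Φ₃`, signature
`(2,1)` at every `τ`); no `∃` smuggled (the conclusion is proved, not posited).  [cite: Landherr1936HermitianForms] [cite: Rogawski1990, §1.9 p. 8; §14.2 p. 232] -/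
def SocketIndefiniteSimilitude : Prop :=
  ∀ (L : Type) [Field L] [NumberField L] [IsCMField L] (H : Matrix (Fin 3) (Fin 3) L),
    (H.map (cmConjRingHom L))ᵀ = H → IsUnit H.det →
      (∀ τ : L →+* ℂ, ¬(H.map τ).PosDef ∧ ¬(-(H.map τ)).PosDef) →
        ∃ (B : GL (Fin 3) L) (a : L), cmConjRingHom L a = a ∧ a ≠ 0 ∧ formCongr (cmConjRingHom L) B (a • qsForm L) = H

/-- **(B3) `SocketSimilitudeTransport`** — «for `H = ᵗB̄ · (a • Φ₃) · B` (`ā = a ≠ 0`; a SIMILITUDE `Ad(B) : U(H) ≃ U(a • Φ₃) = U(Φ₃)` over `L⁺`):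
`XiMembershipAt L Φ₃ → XiMembershipAt L H`» = TRANSPORT of the pinned (S-G) data (discrete `P`, `MemXiFamily`, local constituents, Keys labels, the `hQS`-witness
`πˢ`) along `Ad(B)`.  ONE HONEST STUB at ED. 1, `sock_S9_similitudeTransport`: the representation-level transport is not in the tree yet.  ED. 2 SOCKETS beneath it
(R90-IF-plan «Q3 CURRENCY CENSUS», R90 bus 2026-09-04T15:09:34Z) — EXISTS ★: `AdelicUnitaryGroup.adelicUnitaryGroupCongr` (`U(H′)(𝔸) ≃ₜ* U(H₀)(𝔸)`, `x ↦ Q_𝔸 x Q_𝔸⁻¹`),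
`AdelicSimilitudeCongr.exists_adelicSimilCongr` ∕ `formCongr_inv_smul_of_simil` ∕ `similCongr_mem_quotientSubgroup_iff` (the scalar: `U(c • H) = U(H)`),
`AdelicCongruenceArchFinCompat.archPart_adelicUnitaryGroupCongr` ∕ `finPart_adelicUnitaryGroupCongr`, `ArchCongruenceTransport.posDef_map_formCongr_cm` (definiteness at
`τ` is a congruence invariant, so (B2)'s∕(B4)'s hypothesis classes are stable under this move), `AdelicCongruenceLocalCompat.toLocal_adelicUnitaryGroupCongr` +
`localPiEquiv_evalPlace_finPart_adelicUnitaryGroupCongr` («`(Q_𝔸 g Q_𝔸⁻¹)_v = cmDatumLocalCongr L v (toLocalGL L v Q) _ _ g_v`» — (B0)'s own local currency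
`cmDatumLocalCongr` ∕ `IrrClass.comap`); MISSING (C5 posit-and-construct, each strictly below (B3)): (B3a) `sock_S9_congrDiscreteRep` — `DiscreteAutomorphicRep` ∕
automorphic-measure ∕ `L²` transport for `adelicGroupData L⁺ L c 3 H` along `adelicUnitaryGroupCongr` (template ★ `AutomorphicGaloisConj`: `galQuot`,
`isAutomorphicMeasure_map_gal_smul`, generic `ContRepresentation.ClosedSubrep.mapConj ∕ mapConjEquiv ∕ isTopIrreducible_mapConj_iff ∕ mapConjEquiv_mem_fixedVectors_iff`,
`galL2Equiv`); (B3b) `sock_S9_congrMemXiFamily` — `MemXiFamily P … ξ ↔ MemXiFamily P^Q … ξ`; (B3c) `LocalConstituentsIn` ∕ Keys-label compatibility under `Ad(Q)_v`.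
[cite: Rogawski1990, §1.9 p. 8; Ch. 14 p. 231; §14.2 p. 232] [cite: PlatonovRapinchuk1994, §2.3] -/
def SocketSimilitudeTransport : Prop :=
  ∀ (L : Type) [Field L] [NumberField L] [IsCMField L] (H : Matrix (Fin 3) (Fin 3) L)
    (hH : (H.map (cmConjRingHom L))ᵀ = H) (hHd : IsUnit H.det) (B : GL (Fin 3) L) (a : L),
    cmConjRingHom L a = a → a ≠ 0 → formCongr (cmConjRingHom L) B (a • qsForm L) = H →
      XiMembershipAt L (qsForm L) (antidiagOne_isHermitian L 3) (isUnit_antidiagOne_det L 3) →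
        XiMembershipAt L H hH hHd

/-- **(B4) `SocketDefiniteXiMembership` — THE §14.6 PRINT LEAF at print's pinned data.**  Print's TWO guards BOTH as hypotheses (RULING S9-R2, R90 bus
2026-09-04T15:17:15Z): `hanis` = «`G′ = U(H)` is ANISOTROPIC» [§14.5 p. 237 «Since `G′` is anisotropic»] in the tree's inner-form currency
(★ `Godement.det_ne_zero_of_anisotropic`, ★ `F0P3bNonsplitIdentification.…_of_anisotropic`: `hermForm (cmConjRingHom L) H x x = 0 → x = 0`), and `hS₀` = «`∃ τ`, `τ(H)` or
`-τ(H)` positive definite» = «`G′_τ ≅ U₃(ℝ)` compact, `τ ∈ S₀ ≠ ∅`, `D = M₃(E)`» [§14.2 p. 232; §14.6 p. 243] (the HEAD derives `hanis` from `hS₀` — the trivial direction,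
★ `UnitaryGroup.anisotropic_of_posDef_map` — so the leaf's prover gets both guards for nothing); `G′` is then the honest inner form of Ch. 14 [p. 231 «`G′` not isomorphic
to `G` over `F`»];
conclusion = (B0) at `(L, H)`: Thm. 14.6.1 ((14.6.1)∕(14.6.2): `Π′_v = ψ_v(Π_v)` off `S ∪ S₀`, the packets `Π(ξ_v) = {πⁿ, πˢ}` at non-split `v`) + Thm. 14.6.4 (every discrete
`π′` of `G′` lies in some `Π′(ξ)` or in a tempered∕stable packet) in `MemXiFamily` currency.  Stub `sock_S9_definiteXiMembership`; PRINT, GLOBAL (comparison of the trace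
formulas of `G′` and `G`, Ch. 14).  [cite: Rogawski1990, §14.6 Thm. 14.6.1 p. 241, (14.6.2) p. 242, Thm. 14.6.4 p. 243; §14.2 p. 232; §14.5 p. 237; Ch. 14 p. 231] -/
def SocketDefiniteXiMembership : Prop :=
  ∀ (L : Type) [Field L] [NumberField L] [IsCMField L] (H : Matrix (Fin 3) (Fin 3) L)
    (hH : (H.map (cmConjRingHom L))ᵀ = H) (hHd : IsUnit H.det),
    (∀ x : Fin 3 → L, Literature.AlgebraicGeometry.ShimuraVarieties.hermForm (cmConjRingHom L) H x x = 0 → x = 0) →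
      (∃ τ : L →+* ℂ, (H.map τ).PosDef ∨ (-(H.map τ)).PosDef) → XiMembershipAt L H hH hHd

/-! ## §1b (ED. 3) THE SUB-SOCKETS BENEATH (B4) — R90-IF-plan «B ED. 3 PLAN» (R90 bus 2026-09-04T15:44:55Z): (B4) := `definiteXiMembership_of_ch14` (B4a) (B4b) over ★ p861479
(R90-IF-p04 (g0), `Theorems/R90S9DefiniteXiMembershipCut.lean`); the two socket bodies are that ★ theorem's two binder types `hAE` ∕ `hRig` VERBATIM (token for token; nothing
weakened, reordered or renamed).  Honest flag (planner «=»): (B4b) ⊋ (B4) — it is print's Thm. 14.6.4 rigidity with the a.e.-trigger at ALL places incl. split ones and no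
`π²`-trigger; (B4a) is the «envelope ⟹ a.e. unramified∕spherical» organ (JUNCTION PENDING S1 + ★ E1).  C2′ does not apply to (B4b) (not implied by (S-G)); accepted by the plan. -/

/-- **(B3-pkg) sub-socket `SocketSignedPackageTransport` — «THE SIGNED Q-PACKAGE RIDES THE GLOBAL SIMILITUDE `ᵗB̄ (a • Φ₃) B = H`»**
(B ED. 3; bytes = the binder `hPkg` of the ★ B3 CUT `R90.S9.similitudeTransport_of_parts`
(`Theorems/R90S9SimilitudeTransportCut.lean`, R90-IF-p02) VERBATIM, re-indented only; RULING R90-IF-plan 16:12:10Z (1)∕(3), p04 PATTERN).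
For a global similitude `hB : formCongr (cmConjRingHom L) B (a • qsForm L) = H` (`a = ā ≠ 0`) and H-side measure data
`(mH, mG, νG, νH)` with (B0)'s canonicity `hcan`, the signed character-identity PACKAGE of print (Prop. 13.1.3 (c)∕(d) +
Thm 13.1.1, TEST-FUNCTION, SIGNED form) for `H` at the transfer factor OF RECORD `Δ‴_H = finExplicitCollection L H μω …`
together with (H₇) `IsLocalDeltaTransferExists` at the non-split places yields the same PACKAGE for `Φ₃ = qsForm L` at
`Δ‴_Φ₃ = finExplicitCollection L (qsForm L) μω …` OF RECORD ((d1): pinned on both sides, not transported) and at the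
TRANSPORTED `G`-side data `νG₀ v := (νG v).map (e v).symm`, `mG₀ v := (mG v).transport (e v).symm …` along the place-`v`
frame of the similitude `e v := cmDatumLocalCongr L v (toLocalGL L v B)⁻¹ (isUnit_algebraMap_localRing L ha0 v)
(formCongr_toLocalGL_inv_smul L H B hB v) : U(Φ₃)_v ≃ₜ* U(H)_v` (★ p861761 names; `(e v).symm = (g ↦ B_v g B_v⁻¹)`),
the endoscopic-side data `(mH, νH)` unchanged (the endoscopic group `U(Φ₂) × U(Φ₁)` does not see the inner form).
PAYER (JUNCTION S9-B3-pkg, ED. 4): R90-IF-p03's (d3-pkg) assembly = ⟨(d3-pkg-ns) non-split letters along the frame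
(★ p861691 `cmNonsplitCharIdentityAtTestSigned_transport_formCongr` + sign constancy), (d3-split) split letters
(R90-IF-p01, `Theorems/R90S9SplitLetterCongrTransport.lean`)⟩.  Instance binders: (B0)'s four H-side `MeasurableSpace`
families + TWO Φ₃-side families (and the matching `BorelSpace` ones) — exactly the cut's. -/
def SocketSignedPackageTransport : Prop :=
  ∀ (L : Type) [Field L] [NumberField L] [IsCMField L] (H : Matrix (Fin 3) (Fin 3) L)
    (hH : (H.map (cmConjRingHom L))ᵀ = H) (hHd : IsUnit H.det) (B : GL (Fin 3) L) (a : L)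
    (haσ : cmConjRingHom L a = a) (ha0 : a ≠ 0) (hB : formCongr (cmConjRingHom L) B (a • qsForm L) = H),
  ∀ [∀ v : HeightOneSpectrum (𝓞 ↥(maximalRealSubfield L)), MeasurableSpace ((cmDatum L 3 H).Local v)]
    [∀ v : HeightOneSpectrum (𝓞 ↥(maximalRealSubfield L)),
      MeasurableSpace ((cmDatum L 2 (Matrix.of fun i j : Fin 2 => if i.val + j.val + 1 = 2 then (1 : L) else 0)).Local v ×
        (cmDatum L 1 (Matrix.of fun i j : Fin 1 => if i.val + j.val + 1 = 1 then (1 : L) else 0)).Local v)]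
    [∀ (v : HeightOneSpectrum (𝓞 ↥(maximalRealSubfield L)))
        (a : ((cmDatum L 2 (Matrix.of fun i j : Fin 2 => if i.val + j.val + 1 = 2 then (1 : L) else 0)).Local v ×
          (cmDatum L 1 (Matrix.of fun i j : Fin 1 => if i.val + j.val + 1 = 1 then (1 : L) else 0)).Local v)),
      MeasurableSpace (((cmDatum L 2 (Matrix.of fun i j : Fin 2 => if i.val + j.val + 1 = 2 then (1 : L) else 0)).Local v ×
          (cmDatum L 1 (Matrix.of fun i j : Fin 1 => if i.val + j.val + 1 = 1 then (1 : L) else 0)).Local v) ⧸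
        Subgroup.centralizer ({a} : Set ((cmDatum L 2 (Matrix.of fun i j : Fin 2 => if i.val + j.val + 1 = 2 then (1 : L) else 0)).Local v ×
          (cmDatum L 1 (Matrix.of fun i j : Fin 1 => if i.val + j.val + 1 = 1 then (1 : L) else 0)).Local v)))]
    [∀ (v : HeightOneSpectrum (𝓞 ↥(maximalRealSubfield L))) (γ : (cmDatum L 3 H).Local v),
      MeasurableSpace ((cmDatum L 3 H).Local v ⧸ Subgroup.centralizer ({γ} : Set ((cmDatum L 3 H).Local v)))]
    [∀ v : HeightOneSpectrum (𝓞 ↥(maximalRealSubfield L)), MeasurableSpace ((cmDatum L 3 (qsForm L)).Local v)]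
    [∀ (v : HeightOneSpectrum (𝓞 ↥(maximalRealSubfield L))) (γ : (cmDatum L 3 (qsForm L)).Local v),
      MeasurableSpace ((cmDatum L 3 (qsForm L)).Local v ⧸ Subgroup.centralizer ({γ} : Set ((cmDatum L 3 (qsForm L)).Local v)))]
    (mH : ∀ v : HeightOneSpectrum (𝓞 ↥(maximalRealSubfield L)),
      OrbitalMeasureFamily ((cmDatum L 2 (Matrix.of fun i j : Fin 2 => if i.val + j.val + 1 = 2 then (1 : L) else 0)).Local v ×
        (cmDatum L 1 (Matrix.of fun i j : Fin 1 => if i.val + j.val + 1 = 1 then (1 : L) else 0)).Local v))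
    (mG : ∀ v : HeightOneSpectrum (𝓞 ↥(maximalRealSubfield L)), OrbitalMeasureFamily ((cmDatum L 3 H).Local v))
    (νG : ∀ v : HeightOneSpectrum (𝓞 ↥(maximalRealSubfield L)), Measure ((cmDatum L 3 H).Local v))
    (νH : ∀ v : HeightOneSpectrum (𝓞 ↥(maximalRealSubfield L)),
      Measure ((cmDatum L 2 (Matrix.of fun i j : Fin 2 => if i.val + j.val + 1 = 2 then (1 : L) else 0)).Local v ×
        (cmDatum L 1 (Matrix.of fun i j : Fin 1 => if i.val + j.val + 1 = 1 then (1 : L) else 0)).Local v))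
    [∀ v : HeightOneSpectrum (𝓞 ↥(maximalRealSubfield L)), BorelSpace ((cmDatum L 3 H).Local v)]
    [∀ v : HeightOneSpectrum (𝓞 ↥(maximalRealSubfield L)),
      BorelSpace ((cmDatum L 2 (Matrix.of fun i j : Fin 2 => if i.val + j.val + 1 = 2 then (1 : L) else 0)).Local v ×
        (cmDatum L 1 (Matrix.of fun i j : Fin 1 => if i.val + j.val + 1 = 1 then (1 : L) else 0)).Local v)]
    [∀ (v : HeightOneSpectrum (𝓞 ↥(maximalRealSubfield L)))
        (a : ((cmDatum L 2 (Matrix.of fun i j : Fin 2 => if i.val + j.val + 1 = 2 then (1 : L) else 0)).Local v ×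
          (cmDatum L 1 (Matrix.of fun i j : Fin 1 => if i.val + j.val + 1 = 1 then (1 : L) else 0)).Local v)),
      BorelSpace (((cmDatum L 2 (Matrix.of fun i j : Fin 2 => if i.val + j.val + 1 = 2 then (1 : L) else 0)).Local v ×
          (cmDatum L 1 (Matrix.of fun i j : Fin 1 => if i.val + j.val + 1 = 1 then (1 : L) else 0)).Local v) ⧸
        Subgroup.centralizer ({a} : Set ((cmDatum L 2 (Matrix.of fun i j : Fin 2 => if i.val + j.val + 1 = 2 then (1 : L) else 0)).Local v ×
          (cmDatum L 1 (Matrix.of fun i j : Fin 1 => if i.val + j.val + 1 = 1 then (1 : L) else 0)).Local v)))]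
    [∀ (v : HeightOneSpectrum (𝓞 ↥(maximalRealSubfield L))) (γ : (cmDatum L 3 H).Local v),
      BorelSpace ((cmDatum L 3 H).Local v ⧸ Subgroup.centralizer ({γ} : Set ((cmDatum L 3 H).Local v)))]
    [∀ v : HeightOneSpectrum (𝓞 ↥(maximalRealSubfield L)), BorelSpace ((cmDatum L 3 (qsForm L)).Local v)]
    [∀ (v : HeightOneSpectrum (𝓞 ↥(maximalRealSubfield L))) (γ : (cmDatum L 3 (qsForm L)).Local v),
      BorelSpace ((cmDatum L 3 (qsForm L)).Local v ⧸ Subgroup.centralizer ({γ} : Set ((cmDatum L 3 (qsForm L)).Local v)))]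
    [∀ v, (νG v).IsHaarMeasure] [∀ v, (νG v).IsMulRightInvariant] [∀ v, (νH v).IsHaarMeasure] [∀ v, (νH v).IsMulRightInvariant],
  ∀ (μω : HeckeCharacter L) (hμu : μω.IsUnitary),
  (∀ x : Literature.NumberTheory.GaloisRepresentations.ideleGroup ↥(maximalRealSubfield L),
    μω (AdeleRing.ideleBaseChange (↥(maximalRealSubfield L)) L x) = quadraticHeckeCharCM L x) →
  (∀ v : HeightOneSpectrum (𝓞 ↥(maximalRealSubfield L)), (mH v).IsCanonical (IsLocalGRegular L v) (νH v) ∧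
    (mG v).IsCanonical (fun γ => IsRegularElt (γ.val : GL (Fin 3) (UnitaryGroup.LocalRing L v))) (νG v)) →
  CMCharIdentityPackageTestSigned L H hH hHd νH νG μω hμu
      (finExplicitCollection L H μω (finExplicitDelta_conj_left_all L H μω) (finExplicitDelta_conj_right_all L H μω)) mH mG →
  (∀ v : HeightOneSpectrum (𝓞 ↥(maximalRealSubfield L)), (∀ w : PlacesOver L v, IsCMField.complexConj L • w.1 = w.1) →
    IsLocalDeltaTransferExists L H v
      ((finExplicitCollection L H μω (finExplicitDelta_conj_left_all L H μω) (finExplicitDelta_conj_right_all L H μω)) v) (mH v) (mG v)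
      Literature.NumberTheory.Rogawski1990.IsLocSmooth Literature.NumberTheory.Rogawski1990.IsLocSmooth) →
  CMCharIdentityPackageTestSigned L (qsForm L) (antidiagOne_isHermitian L 3) (isUnit_antidiagOne_det L 3) νH
    (fun v => (νG v).map
      (cmDatumLocalCongr L v (toLocalGL L v B)⁻¹ (isUnit_algebraMap_localRing L ha0 v) (formCongr_toLocalGL_inv_smul L H B hB v)).symm)
    μω hμu
    (finExplicitCollection L (qsForm L) μω (finExplicitDelta_conj_left_all L (qsForm L) μω) (finExplicitDelta_conj_right_all L (qsForm L) μω)) mH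
    (fun v => (mG v).transport
      (cmDatumLocalCongr L v (toLocalGL L v B)⁻¹ (isUnit_algebraMap_localRing L ha0 v) (formCongr_toLocalGL_inv_smul L H B hB v)).symm.toMulEquiv
      (cmDatumLocalCongr L v (toLocalGL L v B)⁻¹ (isUnit_algebraMap_localRing L ha0 v) (formCongr_toLocalGL_inv_smul L H B hB v)).symm.continuous
      (cmDatumLocalCongr L v (toLocalGL L v B)⁻¹ (isUnit_algebraMap_localRing L ha0 v) (formCongr_toLocalGL_inv_smul L H B hB v)).continuous)

/-- **(B4a) `SocketAeXiTrigger`** = binder `hAE` of ★ `definiteXiMembership_of_ch14` VERBATIM — «ENVELOPE ⟹ E.V.P.» (JUNCTION PENDING S1 + ★ E1 a.e.-spherical): under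
(B4)'s binders through `MemXiFamily P hH hHd μω hμu ξ`: off a finite set of finite places, every `v`-constituent of `P` is `πⁿ(ξ_v) ∘ e` (non-split `v`, any frame
`(T, a)`, any Keys labels with `πⁿ` not `L²`) resp. the split member of ★ `cmSplitPacket` at `splitWitness v hs` (split `v`).  Stub `sock_S9_aeXiTrigger` (size M).
[cite: Rogawski1990, §14.6 p. 242; §12.2 (2) p. 174] -/
def SocketAeXiTrigger : Prop :=
  ∀ (L : Type) [Field L] [NumberField L] [IsCMField L] (H : Matrix (Fin 3) (Fin 3) L)
    (hH : (H.map (cmConjRingHom L))ᵀ = H) (hHd : IsUnit H.det),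
    (∀ x : Fin 3 → L, Literature.AlgebraicGeometry.ShimuraVarieties.hermForm (cmConjRingHom L) H x x = 0 → x = 0) →
      (∃ τ : L →+* ℂ, (H.map τ).PosDef ∨ (-(H.map τ)).PosDef) →
  ∀ [∀ v : HeightOneSpectrum (𝓞 ↥(maximalRealSubfield L)), MeasurableSpace ((cmDatum L 3 H).Local v)]
    [∀ v : HeightOneSpectrum (𝓞 ↥(maximalRealSubfield L)),
      MeasurableSpace ((cmDatum L 2 (Matrix.of fun i j : Fin 2 => if i.val + j.val + 1 = 2 then (1 : L) else 0)).Local v ×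
        (cmDatum L 1 (Matrix.of fun i j : Fin 1 => if i.val + j.val + 1 = 1 then (1 : L) else 0)).Local v)]
    [∀ (v : HeightOneSpectrum (𝓞 ↥(maximalRealSubfield L)))
        (a : ((cmDatum L 2 (Matrix.of fun i j : Fin 2 => if i.val + j.val + 1 = 2 then (1 : L) else 0)).Local v ×
          (cmDatum L 1 (Matrix.of fun i j : Fin 1 => if i.val + j.val + 1 = 1 then (1 : L) else 0)).Local v)),
      MeasurableSpace (((cmDatum L 2 (Matrix.of fun i j : Fin 2 => if i.val + j.val + 1 = 2 then (1 : L) else 0)).Local v ×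
          (cmDatum L 1 (Matrix.of fun i j : Fin 1 => if i.val + j.val + 1 = 1 then (1 : L) else 0)).Local v) ⧸
        Subgroup.centralizer ({a} : Set ((cmDatum L 2 (Matrix.of fun i j : Fin 2 => if i.val + j.val + 1 = 2 then (1 : L) else 0)).Local v ×
          (cmDatum L 1 (Matrix.of fun i j : Fin 1 => if i.val + j.val + 1 = 1 then (1 : L) else 0)).Local v)))]
    [∀ (v : HeightOneSpectrum (𝓞 ↥(maximalRealSubfield L))) (γ : (cmDatum L 3 H).Local v),
      MeasurableSpace ((cmDatum L 3 H).Local v ⧸ Subgroup.centralizer ({γ} : Set ((cmDatum L 3 H).Local v)))]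
    (Δ : ∀ v : HeightOneSpectrum (𝓞 ↥(maximalRealSubfield L)), LocalTransferFactor L H v)
    (mH : ∀ v : HeightOneSpectrum (𝓞 ↥(maximalRealSubfield L)),
      OrbitalMeasureFamily ((cmDatum L 2 (Matrix.of fun i j : Fin 2 => if i.val + j.val + 1 = 2 then (1 : L) else 0)).Local v ×
        (cmDatum L 1 (Matrix.of fun i j : Fin 1 => if i.val + j.val + 1 = 1 then (1 : L) else 0)).Local v))
    (mG : ∀ v : HeightOneSpectrum (𝓞 ↥(maximalRealSubfield L)), OrbitalMeasureFamily ((cmDatum L 3 H).Local v))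
    (νG : ∀ v : HeightOneSpectrum (𝓞 ↥(maximalRealSubfield L)), Measure ((cmDatum L 3 H).Local v))
    (νH : ∀ v : HeightOneSpectrum (𝓞 ↥(maximalRealSubfield L)),
      Measure ((cmDatum L 2 (Matrix.of fun i j : Fin 2 => if i.val + j.val + 1 = 2 then (1 : L) else 0)).Local v ×
        (cmDatum L 1 (Matrix.of fun i j : Fin 1 => if i.val + j.val + 1 = 1 then (1 : L) else 0)).Local v))
    [∀ v : HeightOneSpectrum (𝓞 ↥(maximalRealSubfield L)), BorelSpace ((cmDatum L 3 H).Local v)]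
    [∀ v : HeightOneSpectrum (𝓞 ↥(maximalRealSubfield L)),
      BorelSpace ((cmDatum L 2 (Matrix.of fun i j : Fin 2 => if i.val + j.val + 1 = 2 then (1 : L) else 0)).Local v ×
        (cmDatum L 1 (Matrix.of fun i j : Fin 1 => if i.val + j.val + 1 = 1 then (1 : L) else 0)).Local v)]
    [∀ (v : HeightOneSpectrum (𝓞 ↥(maximalRealSubfield L)))
        (a : ((cmDatum L 2 (Matrix.of fun i j : Fin 2 => if i.val + j.val + 1 = 2 then (1 : L) else 0)).Local v ×
          (cmDatum L 1 (Matrix.of fun i j : Fin 1 => if i.val + j.val + 1 = 1 then (1 : L) else 0)).Local v)),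
      BorelSpace (((cmDatum L 2 (Matrix.of fun i j : Fin 2 => if i.val + j.val + 1 = 2 then (1 : L) else 0)).Local v ×
          (cmDatum L 1 (Matrix.of fun i j : Fin 1 => if i.val + j.val + 1 = 1 then (1 : L) else 0)).Local v) ⧸
        Subgroup.centralizer ({a} : Set ((cmDatum L 2 (Matrix.of fun i j : Fin 2 => if i.val + j.val + 1 = 2 then (1 : L) else 0)).Local v ×
          (cmDatum L 1 (Matrix.of fun i j : Fin 1 => if i.val + j.val + 1 = 1 then (1 : L) else 0)).Local v)))]
    [∀ (v : HeightOneSpectrum (𝓞 ↥(maximalRealSubfield L))) (γ : (cmDatum L 3 H).Local v),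
      BorelSpace ((cmDatum L 3 H).Local v ⧸ Subgroup.centralizer ({γ} : Set ((cmDatum L 3 H).Local v)))]
    [∀ v, (νG v).IsHaarMeasure] [∀ v, (νG v).IsMulRightInvariant] [∀ v, (νH v).IsHaarMeasure] [∀ v, (νH v).IsMulRightInvariant],
    ∀ (μω : HeckeCharacter L) (hμu : μω.IsUnitary),
    (∀ x : Literature.NumberTheory.GaloisRepresentations.ideleGroup ↥(maximalRealSubfield L),
      μω (AdeleRing.ideleBaseChange (↥(maximalRealSubfield L)) L x) = quadraticHeckeCharCM L x) →
    Δ = finExplicitCollection L H μω (finExplicitDelta_conj_left_all L H μω) (finExplicitDelta_conj_right_all L H μω) →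
    (∀ v : HeightOneSpectrum (𝓞 ↥(maximalRealSubfield L)), (mH v).IsCanonical (IsLocalGRegular L v) (νH v) ∧
      (mG v).IsCanonical (fun γ => IsRegularElt (γ.val : GL (Fin 3) (UnitaryGroup.LocalRing L v))) (νG v)) →
    ∀ (hQS : CMCharIdentityPackageTestSigned L H hH hHd νH νG μω hμu Δ mH mG),
    (∀ v : HeightOneSpectrum (𝓞 ↥(maximalRealSubfield L)), (∀ w : PlacesOver L v, IsCMField.complexConj L • w.1 = w.1) →
      IsLocalDeltaTransferExists L H v (Δ v) (mH v) (mG v) Literature.NumberTheory.Rogawski1990.IsLocSmooth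
        Literature.NumberTheory.Rogawski1990.IsLocSmooth) →
    ∀ (ξ : OneDimAutRepH L)
      (μA : Measure (adelicGroupData (↥(maximalRealSubfield L)) L (IsCMField.complexConj L) 3 H).automorphicQuotient)
      [(adelicGroupData (↥(maximalRealSubfield L)) L (IsCMField.complexConj L) 3 H).IsAutomorphicMeasure μA]
      (P : DiscreteAutomorphicRep (adelicGroupData (↥(maximalRealSubfield L)) L (IsCMField.complexConj L) 3 H) μA),
      MemXiFamily P hH hHd μω hμu ξ →
      -- (AE) «t(P) = t(Π(ξ))»: off a finite set of finite places, P_v IS πⁿ(ξ_v) ∘ e (non-split v) ∕ the split member i_G(ξ_v ⊗ μ_w ∘ det₀) (split v)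
      (∃ S : Finset (HeightOneSpectrum (𝓞 ↥(maximalRealSubfield L))),
        (∀ v : HeightOneSpectrum (𝓞 ↥(maximalRealSubfield L)), v ∉ S →
          ∀ (hns : ∀ w : PlacesOver L v, IsCMField.complexConj L • w.1 = w.1)
            (T : GL (Fin 3) (LocalRing L v)) (a : LocalRing L v) (ha : IsUnit a)
            (h : formCongr (conjLocal L (IsCMField.complexConj L) v) T (H.map (algebraMap L (LocalRing L v))) =
              a • (Matrix.of fun i j : Fin 3 => if i.val + j.val + 1 = 3 then (1 : L) else 0).map (algebraMap L (LocalRing L v))),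
          ∀ [MeasurableSpace (Gqs L v ⧸ Subgroup.center (Gqs L v))] [BorelSpace (Gqs L v ⧸ Subgroup.center (Gqs L v))]
            (μZ : Measure (Gqs L v ⧸ Subgroup.center (Gqs L v))) [μZ.IsHaarMeasure],
          ∀ (π2 πn : IrrClass (Gqs L v)),
            KeysCaseTwoLabels L v (μω.semilocalComponent L v) (torusLocalComponent L (IsCMField.complexConj L) v ξ.η)
              (torusLocalComponent L (IsCMField.complexConj L) v ξ.ψ) π2 πn →
            ¬ πn.IsSquareIntegrable μZ →
            ∀ c : IrrClass ((cmDatum L 3 H).Local v),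
              (IrrClass.comap (localPiEquiv L (IsCMField.complexConj L) 3 H v) c).IsConstituentOf
                  (P.finRep.smoothPart.toRepresentation.comp (inclPlace (↥(maximalRealSubfield L)) L (IsCMField.complexConj L) 3 H v)) →
              c = IrrClass.comap (cmDatumLocalCongr L v T ha h).symm πn) ∧
        (∀ v : HeightOneSpectrum (𝓞 ↥(maximalRealSubfield L)), v ∉ S →
          ∀ (hs : ∃ w : PlacesOver L v, IsCMField.complexConj L • w.1 ≠ w.1),
            ∀ c : IrrClass ((cmDatum L 3 H).Local v),
              (IrrClass.comap (localPiEquiv L (IsCMField.complexConj L) 3 H v) c).IsConstituentOf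
                  (P.finRep.smoothPart.toRepresentation.comp (inclPlace (↥(maximalRealSubfield L)) L (IsCMField.complexConj L) 3 H v)) →
              c ∈ (cmSplitPacket L H hH hHd v (splitWitness v hs) (splitWitness_spec v hs) (ξ.splitν₀ μω (splitWitness v hs).1)
                (ξ.locψ (splitWitness v hs).1) (ξ.norm_splitν₀_apply hμu (splitWitness v hs).1)
                (ξ.continuous_splitν₀ μω (splitWitness v hs).1) (ξ.norm_locψ_apply (splitWitness v hs).1)
                (ξ.continuous_locψ (splitWitness v hs).1)).members))

/-- **(B4b) `SocketDefiniteAeRigidity`** = binder `hRig` of ★ `definiteXiMembership_of_ch14` VERBATIM — «E.V.P. ⟹ Π′(ξ)-MEMBERSHIP» (JUNCTION PENDING S6 → S7 ∕ S3 ∕ S2;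
Thm. 13.3.5 + Thm. 14.6.4 for `G′ = U(H)`, `S₀ ≠ ∅`): under (B4)'s binders through `P`, (AE) (the text of (B4a)'s conclusion byte for byte) `→` (B0)'s tail «every
`v`-constituent is `πⁿ ∘ e`, `π² ∘ e` or `((hQS ξ).1 v …).πs`» byte for byte.  THE §14.6 RIGIDITY ORGAN (size XL); stub `sock_S9_definiteAeRigidity`.  Honest: (B4b) ⊋ (B4).
[cite: Rogawski1990, §13.3 Thm. 13.3.5 p. 202; §14.6 Thm. 14.6.1 p. 241, (14.6.2) p. 242, Thm. 14.6.4 p. 243; §13.1 Prop. 13.1.3 (d), Prop. 13.1.4 p. 199] -/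
def SocketDefiniteAeRigidity : Prop :=
  ∀ (L : Type) [Field L] [NumberField L] [IsCMField L] (H : Matrix (Fin 3) (Fin 3) L)
    (hH : (H.map (cmConjRingHom L))ᵀ = H) (hHd : IsUnit H.det),
    (∀ x : Fin 3 → L, Literature.AlgebraicGeometry.ShimuraVarieties.hermForm (cmConjRingHom L) H x x = 0 → x = 0) →
      (∃ τ : L →+* ℂ, (H.map τ).PosDef ∨ (-(H.map τ)).PosDef) →
  ∀ [∀ v : HeightOneSpectrum (𝓞 ↥(maximalRealSubfield L)), MeasurableSpace ((cmDatum L 3 H).Local v)]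
    [∀ v : HeightOneSpectrum (𝓞 ↥(maximalRealSubfield L)),
      MeasurableSpace ((cmDatum L 2 (Matrix.of fun i j : Fin 2 => if i.val + j.val + 1 = 2 then (1 : L) else 0)).Local v ×
        (cmDatum L 1 (Matrix.of fun i j : Fin 1 => if i.val + j.val + 1 = 1 then (1 : L) else 0)).Local v)]
    [∀ (v : HeightOneSpectrum (𝓞 ↥(maximalRealSubfield L)))
        (a : ((cmDatum L 2 (Matrix.of fun i j : Fin 2 => if i.val + j.val + 1 = 2 then (1 : L) else 0)).Local v ×
          (cmDatum L 1 (Matrix.of fun i j : Fin 1 => if i.val + j.val + 1 = 1 then (1 : L) else 0)).Local v)),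
      MeasurableSpace (((cmDatum L 2 (Matrix.of fun i j : Fin 2 => if i.val + j.val + 1 = 2 then (1 : L) else 0)).Local v ×
          (cmDatum L 1 (Matrix.of fun i j : Fin 1 => if i.val + j.val + 1 = 1 then (1 : L) else 0)).Local v) ⧸
        Subgroup.centralizer ({a} : Set ((cmDatum L 2 (Matrix.of fun i j : Fin 2 => if i.val + j.val + 1 = 2 then (1 : L) else 0)).Local v ×
          (cmDatum L 1 (Matrix.of fun i j : Fin 1 => if i.val + j.val + 1 = 1 then (1 : L) else 0)).Local v)))]
    [∀ (v : HeightOneSpectrum (𝓞 ↥(maximalRealSubfield L))) (γ : (cmDatum L 3 H).Local v),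
      MeasurableSpace ((cmDatum L 3 H).Local v ⧸ Subgroup.centralizer ({γ} : Set ((cmDatum L 3 H).Local v)))]
    (Δ : ∀ v : HeightOneSpectrum (𝓞 ↥(maximalRealSubfield L)), LocalTransferFactor L H v)
    (mH : ∀ v : HeightOneSpectrum (𝓞 ↥(maximalRealSubfield L)),
      OrbitalMeasureFamily ((cmDatum L 2 (Matrix.of fun i j : Fin 2 => if i.val + j.val + 1 = 2 then (1 : L) else 0)).Local v ×
        (cmDatum L 1 (Matrix.of fun i j : Fin 1 => if i.val + j.val + 1 = 1 then (1 : L) else 0)).Local v))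
    (mG : ∀ v : HeightOneSpectrum (𝓞 ↥(maximalRealSubfield L)), OrbitalMeasureFamily ((cmDatum L 3 H).Local v))
    (νG : ∀ v : HeightOneSpectrum (𝓞 ↥(maximalRealSubfield L)), Measure ((cmDatum L 3 H).Local v))
    (νH : ∀ v : HeightOneSpectrum (𝓞 ↥(maximalRealSubfield L)),
      Measure ((cmDatum L 2 (Matrix.of fun i j : Fin 2 => if i.val + j.val + 1 = 2 then (1 : L) else 0)).Local v ×
        (cmDatum L 1 (Matrix.of fun i j : Fin 1 => if i.val + j.val + 1 = 1 then (1 : L) else 0)).Local v))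
    [∀ v : HeightOneSpectrum (𝓞 ↥(maximalRealSubfield L)), BorelSpace ((cmDatum L 3 H).Local v)]
    [∀ v : HeightOneSpectrum (𝓞 ↥(maximalRealSubfield L)),
      BorelSpace ((cmDatum L 2 (Matrix.of fun i j : Fin 2 => if i.val + j.val + 1 = 2 then (1 : L) else 0)).Local v ×
        (cmDatum L 1 (Matrix.of fun i j : Fin 1 => if i.val + j.val + 1 = 1 then (1 : L) else 0)).Local v)]
    [∀ (v : HeightOneSpectrum (𝓞 ↥(maximalRealSubfield L)))
        (a : ((cmDatum L 2 (Matrix.of fun i j : Fin 2 => if i.val + j.val + 1 = 2 then (1 : L) else 0)).Local v ×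
          (cmDatum L 1 (Matrix.of fun i j : Fin 1 => if i.val + j.val + 1 = 1 then (1 : L) else 0)).Local v)),
      BorelSpace (((cmDatum L 2 (Matrix.of fun i j : Fin 2 => if i.val + j.val + 1 = 2 then (1 : L) else 0)).Local v ×
          (cmDatum L 1 (Matrix.of fun i j : Fin 1 => if i.val + j.val + 1 = 1 then (1 : L) else 0)).Local v) ⧸
        Subgroup.centralizer ({a} : Set ((cmDatum L 2 (Matrix.of fun i j : Fin 2 => if i.val + j.val + 1 = 2 then (1 : L) else 0)).Local v ×
          (cmDatum L 1 (Matrix.of fun i j : Fin 1 => if i.val + j.val + 1 = 1 then (1 : L) else 0)).Local v)))]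
    [∀ (v : HeightOneSpectrum (𝓞 ↥(maximalRealSubfield L))) (γ : (cmDatum L 3 H).Local v),
      BorelSpace ((cmDatum L 3 H).Local v ⧸ Subgroup.centralizer ({γ} : Set ((cmDatum L 3 H).Local v)))]
    [∀ v, (νG v).IsHaarMeasure] [∀ v, (νG v).IsMulRightInvariant] [∀ v, (νH v).IsHaarMeasure] [∀ v, (νH v).IsMulRightInvariant],
    ∀ (μω : HeckeCharacter L) (hμu : μω.IsUnitary),
    (∀ x : Literature.NumberTheory.GaloisRepresentations.ideleGroup ↥(maximalRealSubfield L),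
      μω (AdeleRing.ideleBaseChange (↥(maximalRealSubfield L)) L x) = quadraticHeckeCharCM L x) →
    Δ = finExplicitCollection L H μω (finExplicitDelta_conj_left_all L H μω) (finExplicitDelta_conj_right_all L H μω) →
    (∀ v : HeightOneSpectrum (𝓞 ↥(maximalRealSubfield L)), (mH v).IsCanonical (IsLocalGRegular L v) (νH v) ∧
      (mG v).IsCanonical (fun γ => IsRegularElt (γ.val : GL (Fin 3) (UnitaryGroup.LocalRing L v))) (νG v)) →
    ∀ (hQS : CMCharIdentityPackageTestSigned L H hH hHd νH νG μω hμu Δ mH mG),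
    (∀ v : HeightOneSpectrum (𝓞 ↥(maximalRealSubfield L)), (∀ w : PlacesOver L v, IsCMField.complexConj L • w.1 = w.1) →
      IsLocalDeltaTransferExists L H v (Δ v) (mH v) (mG v) Literature.NumberTheory.Rogawski1990.IsLocSmooth
        Literature.NumberTheory.Rogawski1990.IsLocSmooth) →
    ∀ (ξ : OneDimAutRepH L)
      (μA : Measure (adelicGroupData (↥(maximalRealSubfield L)) L (IsCMField.complexConj L) 3 H).automorphicQuotient)
      [(adelicGroupData (↥(maximalRealSubfield L)) L (IsCMField.complexConj L) 3 H).IsAutomorphicMeasure μA]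
      (P : DiscreteAutomorphicRep (adelicGroupData (↥(maximalRealSubfield L)) L (IsCMField.complexConj L) 3 H) μA),
      -- hypothesis (AE) «t(P) = t(Π(ξ))» — the e.v.p. of P is that of the A-packet Π(ξ) (TEXT = the conclusion of `hAE` BYTE FOR BYTE)
      (∃ S : Finset (HeightOneSpectrum (𝓞 ↥(maximalRealSubfield L))),
        (∀ v : HeightOneSpectrum (𝓞 ↥(maximalRealSubfield L)), v ∉ S →
          ∀ (hns : ∀ w : PlacesOver L v, IsCMField.complexConj L • w.1 = w.1)
            (T : GL (Fin 3) (LocalRing L v)) (a : LocalRing L v) (ha : IsUnit a)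
            (h : formCongr (conjLocal L (IsCMField.complexConj L) v) T (H.map (algebraMap L (LocalRing L v))) =
              a • (Matrix.of fun i j : Fin 3 => if i.val + j.val + 1 = 3 then (1 : L) else 0).map (algebraMap L (LocalRing L v))),
          ∀ [MeasurableSpace (Gqs L v ⧸ Subgroup.center (Gqs L v))] [BorelSpace (Gqs L v ⧸ Subgroup.center (Gqs L v))]
            (μZ : Measure (Gqs L v ⧸ Subgroup.center (Gqs L v))) [μZ.IsHaarMeasure],
          ∀ (π2 πn : IrrClass (Gqs L v)),
            KeysCaseTwoLabels L v (μω.semilocalComponent L v) (torusLocalComponent L (IsCMField.complexConj L) v ξ.η)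
              (torusLocalComponent L (IsCMField.complexConj L) v ξ.ψ) π2 πn →
            ¬ πn.IsSquareIntegrable μZ →
            ∀ c : IrrClass ((cmDatum L 3 H).Local v),
              (IrrClass.comap (localPiEquiv L (IsCMField.complexConj L) 3 H v) c).IsConstituentOf
                  (P.finRep.smoothPart.toRepresentation.comp (inclPlace (↥(maximalRealSubfield L)) L (IsCMField.complexConj L) 3 H v)) →
              c = IrrClass.comap (cmDatumLocalCongr L v T ha h).symm πn) ∧
        (∀ v : HeightOneSpectrum (𝓞 ↥(maximalRealSubfield L)), v ∉ S →
          ∀ (hs : ∃ w : PlacesOver L v, IsCMField.complexConj L • w.1 ≠ w.1),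
            ∀ c : IrrClass ((cmDatum L 3 H).Local v),
              (IrrClass.comap (localPiEquiv L (IsCMField.complexConj L) 3 H v) c).IsConstituentOf
                  (P.finRep.smoothPart.toRepresentation.comp (inclPlace (↥(maximalRealSubfield L)) L (IsCMField.complexConj L) 3 H v)) →
              c ∈ (cmSplitPacket L H hH hHd v (splitWitness v hs) (splitWitness_spec v hs) (ξ.splitν₀ μω (splitWitness v hs).1)
                (ξ.locψ (splitWitness v hs).1) (ξ.norm_splitν₀_apply hμu (splitWitness v hs).1)
                (ξ.continuous_splitν₀ μω (splitWitness v hs).1) (ξ.norm_locψ_apply (splitWitness v hs).1)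
                (ξ.continuous_locψ (splitWitness v hs).1)).members)) →
      ∀ (v : HeightOneSpectrum (𝓞 ↥(maximalRealSubfield L))) (hns : ∀ w : PlacesOver L v, IsCMField.complexConj L • w.1 = w.1),
      ∀ (T : GL (Fin 3) (LocalRing L v)) (a : LocalRing L v) (ha : IsUnit a)
        (h : formCongr (conjLocal L (IsCMField.complexConj L) v) T (H.map (algebraMap L (LocalRing L v))) =
          a • (Matrix.of fun i j : Fin 3 => if i.val + j.val + 1 = 3 then (1 : L) else 0).map (algebraMap L (LocalRing L v))),
      ∀ [MeasurableSpace (Gqs L v ⧸ Subgroup.center (Gqs L v))] [BorelSpace (Gqs L v ⧸ Subgroup.center (Gqs L v))]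
        (μZ : Measure (Gqs L v ⧸ Subgroup.center (Gqs L v))) [μZ.IsHaarMeasure],
      ∀ (π2 πn : IrrClass (Gqs L v)),
      ∀ (hK : KeysCaseTwoLabels L v (μω.semilocalComponent L v) (torusLocalComponent L (IsCMField.complexConj L) v ξ.η)
          (torusLocalComponent L (IsCMField.complexConj L) v ξ.ψ) π2 πn)
        (hn : ¬ πn.IsSquareIntegrable μZ),
        -- (S-G) «13.3.6 (c) ∕ §14.6 AT PRINT'S PINNED DATA»: every v-constituent of P is πⁿ ∘ e, π² ∘ e, or the πˢ(ξ_v) ∘ e of `hQS`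
        ∀ c : IrrClass ((cmDatum L 3 H).Local v),
          (IrrClass.comap (localPiEquiv L (IsCMField.complexConj L) 3 H v) c).IsConstituentOf
              (P.finRep.smoothPart.toRepresentation.comp (inclPlace (↥(maximalRealSubfield L)) L (IsCMField.complexConj L) 3 H v)) →
          c = IrrClass.comap (cmDatumLocalCongr L v T ha h).symm πn ∨
            c = IrrClass.comap (cmDatumLocalCongr L v T ha h).symm π2 ∨
            c = ((hQS ξ).1 v hns T a ha h μZ π2 πn hK hn).πs

/-! ## §2 THE NAMED SOCKETS — `sorry` ×2 (`sock_S9_similitudeTransport`, `sock_S9_definiteXiMembership`); (B1) `sock_S9_qsXiMembership` is PAID from S5#4 BY NAME (ED. 2, J3); (B2) `sock_S9_indefiniteSimilitude` is PAID over ★ -/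

/-- **(B1) PAID `sock_S9_qsXiMembership : SocketQsXiMembership`** — JUNCTION S9-J3 (R90-IF-plan (g0) 2026-09-04T15:23:38Z): paid from S5#4
`R90.S5.stub_R90_1335_qsXiRigidity : R90.S5.SocketQsXiRigidity` (tree `R90_S5_QuasiSplitRigidityD.lean`, first GREEN BW148) — the same (S-G) body at `H := Φ₃`
(S5's proof arguments `F0P3cStCharTSCharField.qsForm_map_cmConjRingHom_transpose L` ∕ `F0P3cStCharTSShellOrbitalG.isUnit_det_qsForm L` vs this file's
`antidiagOne_isHermitian L 3` ∕ `isUnit_antidiagOne_det L 3` are proof-irrelevant).  THIS SOCKET IS NO LONGER AN S9 LEAF: name and statement bytes = ED. 1, the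
`sorry` is gone; the kernel leaf behind it is S5's by name.  13.3.5 ∕ 13.3.6 (c) on the quasi-split `U(3)` at print's pinned data; PRINT, GLOBAL.
[cite: Rogawski1990, §13.3 Thm. 13.3.5 p. 202, Thm. 13.3.6 (c) p. 202; §12.2 (2) p. 174; §13.1 Prop. 13.1.4 p. 199] -/
theorem sock_S9_qsXiMembership : SocketQsXiMembership :=
  fun L _ _ _ => R90.S5.stub_R90_1335_qsXiRigidity L

/-- **JUNCTION READ-BACK (S9-J3)** — (B1) and S5#4 are ONE statement (`Iff.rfl`, kernel `δ` + proof irrelevance).  No sorry. [cite: Rogawski1990, §13.3 Thm. 13.3.6 (c) p. 202] -/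
theorem socketQsXiMembership_iff_qsXiRigidity : SocketQsXiMembership ↔ R90.S5.SocketQsXiRigidity :=
  Iff.rfl

/-- **★ Witt step** — an ISOTROPIC hermitian `H ∈ M₃(L)` with `det H` a unit is globally congruent to `b • Φ₃`: `2 ≠ 0` in `L`; `x̄̄ = x` (Mathlib
`IsCMField.complexConj_apply_apply`); a hyperbolic partner of the isotropic `x` by ★ `UnitaryGroup.exists_hyperbolic_partner_hermForm`; the frame by ★
`UnitaryGroup.exists_formCongr_eq_smul_antidiag_of_hyperbolicPair` (the two tree pairings `UnitaryGroup.hermForm` ∕ `ShimuraVarieties.hermForm` are one term).  No sorry.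
[cite: Jacobowitz1962, §3 Thm. 3.1] [cite: Dieudonne1971GroupesClassiques, Chap. II §5] -/
theorem exists_formCongr_eq_smul_qsForm_of_isotropic (L : Type) [Field L] [NumberField L] [IsCMField L]
    (H : Matrix (Fin 3) (Fin 3) L) (hH : (H.map (cmConjRingHom L))ᵀ = H) (hHd : IsUnit H.det) {x : Fin 3 → L} (hx0 : x ≠ 0)
    (hx : Literature.AlgebraicGeometry.ShimuraVarieties.hermForm (cmConjRingHom L) H x x = 0) :
    ∃ (T : GL (Fin 3) L) (b : L), b ≠ 0 ∧ cmConjRingHom L b = b ∧ formCongr (cmConjRingHom L) T H = b • qsForm L := by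
  have hσ : ∀ s : L, cmConjRingHom L (cmConjRingHom L s) = s := fun s => by
    rw [cmConjRingHom_apply, cmConjRingHom_apply, IsCMField.complexConj_apply_apply]
  have h2 : (2 : L) ≠ 0 := two_ne_zero
  obtain ⟨y, hy, hxy⟩ := exists_hyperbolic_partner_hermForm (cmConjRingHom L) H h2 hσ hH hHd.ne_zero hx hx0
  exact exists_formCongr_eq_smul_antidiag_of_hyperbolicPair (cmConjRingHom L) H hσ hH hHd.ne_zero hx hy hxy

/-- **★ Landherr step** — a hermitian `H ∈ M₃(L)` INDEFINITE at every complex embedding is ISOTROPIC over `L`: otherwise it is anisotropic, hence positive or negative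
definite at some `τ` by ★ `QuadraticForms.hermitianMatrix_exists_posDef_embedding_of_anisotropic` (Landherr [La36] ∕ Hasse–Minkowski over `L⁺`, rank `3 ≥ 3`; the two
spellings of complex conjugation agree by ★ `F0P3aArchDefinitePlace.cmConjRingHom_eq_coe_complexConj`, `ᵗ(H̄) = (ᵗH)‾` by Mathlib `Matrix.transpose_map`).  No sorry.
[cite: Landherr1936HermitianForms] [cite: Rogawski1990, §14.2 p. 232] -/
theorem exists_isotropic_of_indefinite (L : Type) [Field L] [NumberField L] [IsCMField L]
    (H : Matrix (Fin 3) (Fin 3) L) (hH : (H.map (cmConjRingHom L))ᵀ = H)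
    (hind : ∀ τ : L →+* ℂ, ¬(H.map τ).PosDef ∧ ¬(-(H.map τ)).PosDef) :
    ∃ x : Fin 3 → L, x ≠ 0 ∧ Literature.AlgebraicGeometry.ShimuraVarieties.hermForm (cmConjRingHom L) H x x = 0 := by
  classical
  by_contra hno
  have hanis : ∀ x : Fin 3 → L, Literature.AlgebraicGeometry.ShimuraVarieties.hermForm (cmConjRingHom L) H x x = 0 → x = 0 :=
    fun x hx => Classical.byContradiction fun hx0 => hno ⟨x, hx0, hx⟩
  have hH' := hH
  rw [F0P3aArchDefinitePlace.cmConjRingHom_eq_coe_complexConj] at hH' hanis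
  obtain ⟨τ, hτ⟩ :=
    Literature.NumberTheory.QuadraticForms.hermitianMatrix_exists_posDef_embedding_of_anisotropic L H
      (by rw [Matrix.transpose_map]; exact hH') hanis (by simp)
  exact hτ.elim (hind τ).1 (hind τ).2

/-- **(B2) PAID — `indefiniteSimilitude_holds : SocketIndefiniteSimilitude`**: indefinite everywhere ⇒ isotropic (`exists_isotropic_of_indefinite`) ⇒ `ᵗT̄ H T = b • Φ₃`
(`exists_formCongr_eq_smul_qsForm_of_isotropic`) ⇒ `ᵗ(T⁻¹)‾ (b • Φ₃) T⁻¹ = H` (★ `formCongr_inv_formCongr`).  No sorry.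
[cite: Landherr1936HermitianForms] [cite: Jacobowitz1962, §3 Thm. 3.1] -/
theorem indefiniteSimilitude_holds : SocketIndefiniteSimilitude := by
  intro L _ _ _ H hH hHd hind
  obtain ⟨x, hx0, hx⟩ := exists_isotropic_of_indefinite L H hH hind
  obtain ⟨T, b, hb0, hb, hT⟩ := exists_formCongr_eq_smul_qsForm_of_isotropic L H hH hHd hx0 hx
  exact ⟨T⁻¹, b, hb, hb0, by rw [← hT, formCongr_inv_formCongr]⟩

/-- **SOCKET (B2), by the dealt name: `sock_S9_indefiniteSimilitude : SocketIndefiniteSimilitude`** — PAID (`:= indefiniteSimilitude_holds`), no sorry (LEAD C4: a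
★-closable item is not socketed).  [cite: Landherr1936HermitianForms] -/
theorem sock_S9_indefiniteSimilitude : SocketIndefiniteSimilitude :=
  indefiniteSimilitude_holds

/-- (B3-pkg) **PAID** (JUNCTION S9-B3-pkg, by name): ★ p861849 `R90.S9.cmCharIdentityPackageTestSigned_transport_of_simil`
(`Theorems/R90S9SignedPackageCongrTransport.lean`, R90-IF-p03) — the signed Q-package of print for `H` at `Δ‴_H` OF RECORD yields the
package for `Φ₃` at `Δ‴_Φ₃` OF RECORD and the transported `G`-side data along the frame of the similitude; the payer needs FEWER
hypotheses than the socket offers (`hμω`, `hcan`, `hex` unused) and its frame PROOF arguments (`isUnit_algebraMap_localRing_of_ne_zero`,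
`formCongr_toLocalGL_inv_of_simil`) differ from the socket's ★ p861761 ones only inside `Prop` (δ-irrelevant).  NOT an S9 kernel leaf. -/
theorem sock_S9_signedPackageTransport : SocketSignedPackageTransport :=
  fun L _ _ _ H hH hHd B a haσ ha0 hB _ _ _ _ _ _ mH mG νG νH _ _ _ _ _ _ _ _ _ _ μω hμu _ _ hQS _ =>
    cmCharIdentityPackageTestSigned_transport_of_simil L H hH hHd B a haσ ha0 hB mH mG νG νH μω hμu hQS

/-- **SOCKET `sock_S9_similitudeTransport : SocketSimilitudeTransport` — PAID (ED. 3)** by the ★ B3 CUT p862077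
`R90.S9.similitudeTransport_of_parts` (`Theorems/R90S9SimilitudeTransportCut.lean`, R90-IF-p02: B0's ≈ 45 binders carried `H → Φ₃ → H` along
`Ad(B)` — `borel` on the model, `ν₀ = (e v)⁻¹_* νG`, `m₀ = (e v)⁻¹_* mG` canonical (★ p861761), `Δ₀` by `rfl`, (H₇)₀ (★ `isLocalDeltaTransferExists_model_of_formCongr`),
`(μ₀, P₀, MemXiFamily P₀, constituent dictionary)` (★ p861741 over ★ p861490∕p861645∕p861492), model frame `(B_v·T, a_v⁻¹·a′)`, `πⁿ∕π²` read back by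
★ `comap_comap_symm_cmDatumLocalCongr_mul`, `πˢ` by model-side uniqueness ★ p861411) applied to the PAID sub-socket `sock_S9_signedPackageTransport`
(★ p861849, R90-IF-p03).  Name and statement bytes = ED. 1; `sorry` gone; axioms TRIO.  NOT an S9 kernel leaf.
[cite: Rogawski1990, §1.9 p. 8; §14.2 p. 232; §13.1 Prop. 13.1.3 (d), Prop. 13.1.4 p. 199] [cite: PlatonovRapinchuk1994, §2.3] -/
theorem sock_S9_similitudeTransport : SocketSimilitudeTransport :=
  similitudeTransport_of_parts sock_S9_signedPackageTransport

/-- (B4a) **PAID** (by name): ★ p861905 `R90.S9.definiteAeXiTrigger_holds` (`Theorems/R90S9AeXiTriggerOfAnisotropic.lean`, R90-IF-p05) —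
(AE-ⅰ) «ENVELOPE ⟹ E.V.P.»: for ANISOTROPIC `H` the automorphic quotient is compact (Godement ★), every discrete `P` is
Flath-admissible (★ `flath_of_anisotropic` p861871, ★ `F0LD2AutomorphicFlathAdmissibleOfCompact`), and ★ p861639's routine
`aeXiTrigger_of_memXiFamily_of_flath` gives the (AE) clause; statement = ★ p861479's binder `hAE` TOKEN FOR TOKEN = this socket's
body.  NOT an S9 kernel leaf. -/
theorem sock_S9_aeXiTrigger : SocketAeXiTrigger :=
  definiteAeXiTrigger_holds

/-- **SOCKET `sock_S9_definiteAeRigidity : SocketDefiniteAeRigidity`** (ED. 3; (B4b), size XL) — THE §14.6 RIGIDITY ORGAN for the definite inner form `G′ = U(H)`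
(`S₀ ≠ ∅`, `D = M₃(E)`): a.e.-`Π′(ξ)` membership ⟹ membership at every non-split `v` at print's pinned data (Thm. 14.6.1 comparison + (14.6.2) multiplicity + Thm.
14.6.4, fed by S6 → S7 ∕ S3 ∕ S2 — JUNCTION PENDING); PRINT, GLOBAL; sorried.
[cite: Rogawski1990, §14.6 Thm. 14.6.1 p. 241, (14.6.2) p. 242, Thm. 14.6.4 p. 243; §13.3 Thm. 13.3.5 p. 202] -/
theorem sock_S9_definiteAeRigidity : SocketDefiniteAeRigidity := by
  sorry

/-- **(B4) PAID `sock_S9_definiteXiMembership : SocketDefiniteXiMembership`** (ED. 3) — from the two sub-sockets by ★ p861479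
`definiteXiMembership_of_ch14 : (AE-ⅰ) → (AE-ⅱ) → (B4)` (R90-IF-p04), BY NAME; name and statement bytes = ED. 1, the `sorry` is gone (it now lives in
`sock_S9_aeXiTrigger` ∕ `sock_S9_definiteAeRigidity`).  [cite: Rogawski1990, §14.6 Thm. 14.6.1 p. 241, Thm. 14.6.4 p. 243; §14.2 p. 232; §14.5 p. 237; Ch. 14 p. 231] -/
theorem sock_S9_definiteXiMembership : SocketDefiniteXiMembership :=
  definiteXiMembership_of_ch14 sock_S9_aeXiTrigger sock_S9_definiteAeRigidity

/-- **★ trivial direction «definite at some `τ` ⇒ anisotropic over `L`»** (the HEAD feeds (B4)'s `hanis` from its `hS₀`): for the `τ(H)` disjunct this is ★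
`UnitaryGroup.anisotropic_of_posDef_map` on the nose; for `-τ(H)` apply it to `-H` (`(-H)^τ = -(H^τ)`, Mathlib `Matrix.map_neg`; `⟪x, x⟫_{-H} = -⟪x, x⟫_H` by
`Matrix.neg_mulVec` ∕ `dotProduct_neg` on ★ `hermForm σ H u v = (σ ∘ u) ⬝ᵥ (H *ᵥ v)`).  No sorry.  (S9-typ1's ★ pointer, R90 bus 2026-09-04T15:17:39Z.)
[cite: Rogawski1990, §14.2 p. 232; §14.5 p. 237] -/
theorem anisotropic_of_exists_posDef (L : Type) [Field L] [NumberField L] [IsCMField L] (H : Matrix (Fin 3) (Fin 3) L)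
    (hdef : ∃ τ : L →+* ℂ, (H.map τ).PosDef ∨ (-(H.map τ)).PosDef) :
    ∀ x : Fin 3 → L, Literature.AlgebraicGeometry.ShimuraVarieties.hermForm (cmConjRingHom L) H x x = 0 → x = 0 := by
  obtain ⟨τ, hτ | hτ⟩ := hdef
  · exact anisotropic_of_posDef_map L H τ hτ
  · intro x hx
    have hτ' : ((-H).map τ).PosDef := by rwa [Matrix.map_neg _ (map_neg τ)]
    refine anisotropic_of_posDef_map L (-H) τ hτ' x ?_
    show ((cmConjRingHom L) ∘ x) ⬝ᵥ ((-H) *ᵥ x) = 0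
    rw [Matrix.neg_mulVec, dotProduct_neg, neg_eq_zero]
    exact hx

/-! ## §3 Certificates «NOT STRONGER THAN THE RECORD» (LEAD C2′): (B1), (B3), (B4) are IMPLIED BY `∀ L H hH hHd, XiMembershipAt L H hH hHd` (= FILE A's (S-G)); (B2) is a ★ theorem outright -/

/-- (B1) is (S-G) at `H := Φ₃`.  No sorry. [cite: Rogawski1990, §13.3 Thm. 13.3.6 (c) p. 202] -/
theorem qsXiMembership_of_forall_at
    (hAll : ∀ (L : Type) [Field L] [NumberField L] [IsCMField L] (H : Matrix (Fin 3) (Fin 3) L)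
      (hH : (H.map (cmConjRingHom L))ᵀ = H) (hHd : IsUnit H.det), XiMembershipAt L H hH hHd) :
    SocketQsXiMembership :=
  fun L _ _ _ => hAll L (qsForm L) (antidiagOne_isHermitian L 3) (isUnit_antidiagOne_det L 3)

/-- (B3) is weaker than (S-G) (it concludes (S-G) at `(L, H)` from extra hypotheses).  No sorry. [cite: Rogawski1990, §14.2 p. 232] -/
theorem similitudeTransport_of_forall_at
    (hAll : ∀ (L : Type) [Field L] [NumberField L] [IsCMField L] (H : Matrix (Fin 3) (Fin 3) L)
      (hH : (H.map (cmConjRingHom L))ᵀ = H) (hHd : IsUnit H.det), XiMembershipAt L H hH hHd) :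
    SocketSimilitudeTransport :=
  fun L _ _ _ H hH hHd _ _ _ _ _ _ => hAll L H hH hHd

/-- (B4) is (S-G) restricted to `H` definite at some `τ`.  No sorry. [cite: Rogawski1990, §14.6 Thm. 14.6.4 p. 243] -/
theorem definiteXiMembership_of_forall_at
    (hAll : ∀ (L : Type) [Field L] [NumberField L] [IsCMField L] (H : Matrix (Fin 3) (Fin 3) L)
      (hH : (H.map (cmConjRingHom L))ᵀ = H) (hHd : IsUnit H.det), XiMembershipAt L H hH hHd) :
    SocketDefiniteXiMembership :=
  fun L _ _ _ H hH hHd _ _ => hAll L H hH hHd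

/-! ## §4 HEAD (PROVED, no sorry) and the PAID line FILE A ED. 2 cites by name -/

/-- **HEAD `xiMembershipAt_of_cases`** — the four sockets pay (S-G) at every `(L, H)`: `by_cases` on «`H` definite at some `τ`»; if so, (B4); if not, `H` is indefinite at
every `τ`, (B2) gives the similitude `ᵗB̄ (a • Φ₃) B = H`, and (B3) transports (B1) along it; in the definite branch (B4)'s `hanis` is fed by
`anisotropic_of_exists_posDef`.  No sorry; axioms `propext`, `Classical.choice`, `Quot.sound` only.
[cite: Rogawski1990, §13.3 Thm. 13.3.6 (c) p. 202; §14.6 Thm. 14.6.4 p. 243; §1.9 p. 8] [cite: Landherr1936HermitianForms] -/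
theorem xiMembershipAt_of_cases :
    SocketQsXiMembership → SocketIndefiniteSimilitude → SocketSimilitudeTransport → SocketDefiniteXiMembership →
      ∀ (L : Type) [Field L] [NumberField L] [IsCMField L] (H : Matrix (Fin 3) (Fin 3) L)
      (hH : (H.map (cmConjRingHom L))ᵀ = H) (hHd : IsUnit H.det), XiMembershipAt L H hH hHd := by
  intro hqs hI hT hD L _ _ _ H hH hHd
  by_cases hdef : ∃ τ : L →+* ℂ, (H.map τ).PosDef ∨ (-(H.map τ)).PosDef
  · exact hD L H hH hHd (anisotropic_of_exists_posDef L H hdef) hdef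
  · obtain ⟨B, a, ha, ha0, hB⟩ :=
      hI L H hH hHd fun τ => ⟨fun h => hdef ⟨τ, Or.inl h⟩, fun h => hdef ⟨τ, Or.inr h⟩⟩
    exact hT L H hH hHd B a ha ha0 hB (hqs L)

/-- **PAID `xiMembershipAt_paidB`** — (S-G) at every `(L, H)` from the four named sockets (two sorried; (B1) paid from S5#4 by name, (B2) proved); FILE A ED. 2 pays
`stub_globalXiMembership := fun L _ _ _ H hH hHd => xiMembershipAt_paidB L H hH hHd`.  [cite: Rogawski1990, §13.3 Thm. 13.3.6 (c) p. 202; §14.6 Thm. 14.6.4 p. 243] -/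
theorem xiMembershipAt_paidB :
    ∀ (L : Type) [Field L] [NumberField L] [IsCMField L] (H : Matrix (Fin 3) (Fin 3) L)
      (hH : (H.map (cmConjRingHom L))ᵀ = H) (hHd : IsUnit H.det), XiMembershipAt L H hH hHd :=
  xiMembershipAt_of_cases sock_S9_qsXiMembership sock_S9_indefiniteSimilitude sock_S9_similitudeTransport
    sock_S9_definiteXiMembership


/-! ## ED. 4 — THE FRAMED-KIT ORGAN `SocketDefiniteAeRigidityFramedKit` AND ITS HEAD (R90-IF-typ2 (g2); S9 dealer rulings (K-b″)∕(K-b‴), TG-5, J8 PINS, S9-R-PH (α))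

ED. 3's bytes above are untouched (25 frozen blocks).  INSERT-ONLY block: §1 `SocketDefiniteAeRigidityFramedKit` (ONE TELESCOPE WITH A ED. 4; body sha16 1991c8670baaa17a); §0 `MnNeZeroCohTriv_cm` (D7);
§0a∕§0b the J8 pins + glue and the lifts-uniqueness rows (p02 certs VERBATIM); §2 the junction sub-sockets — 5 named `sorry`s (slab convention, COUNTED: B's sorries go
from 1 to 6 before they go down) + 1 PAID socket (row 28′) + ONE ∃-producer `sock_S9_recordDatumLaws_cm` with the laws as NAMED GROUPS; §4 the HEAD, paid by the ★
pay line `definiteAeRigidity_payLine_stableA2'` (★ p864612 PAY⁵ (stableA2′: A2 arch group + F-LEV-1 guard)) at `X_cm` — 0 sorry in the head.  `mk_B_ed4.py` (R90/R90-IF-typ2/g2); v0.2 = v0.1 code byte-for-byte,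
SLIM docstrings (gate cap 200 000 B). -/

open Summit.HodgeConjecture.HodgeConjecture.Cruxes.H413.F0T1InnerFormTraceIdentity (ComparisonKit GpAdelic GpLocal HLocal GpInf GInf HInf TestGp TestG TestH)
open Summit.HodgeConjecture.HodgeConjecture.Cruxes.H413.F0P3InnerFormClassificationV6 (Gp Places splitForm)
open Summit.HodgeConjecture.HodgeConjecture.R90.S9.InnerFormSec146 (IsKcSpherical)

open scoped Classical in
set_option synthInstance.maxHeartbeats 400000 in
set_option maxHeartbeats 8000000 in
/-- **(B4b-K) `SocketDefiniteAeRigidityFramedKit`** — «E.V.P. ⟹ Π′(ξ)-MEMBERSHIP for the DEFINITE inner form, AT THE CONSUMER'S FRAME AND KIT ROW, for `K^c`-fixed `P`»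
(ONE TELESCOPE WITH A ED. 4): BODY = S9-typ1 (g2)'s proposal bytes (A-ED4.framed.scratch.lean ca98a46279d652fd :362–:484) BYTE FOR BYTE — A ED. 4's PAY-K
`globalXiMembershipFK_of_B` keys on them.  Head: §4. [cite: Rogawski1990, §13.3 Thm. 13.3.6 (c) p. 202; §14.6 Thm. 14.6.1 p. 241, Thm. 14.6.4 p. 243] -/
def SocketDefiniteAeRigidityFramedKit : Prop :=
  ∀ (L : Type) [Field L] [NumberField L] [IsCMField L] (ι : L →+* ℂ) (H : Matrix (Fin 3) (Fin 3) L) (T : GL (Fin 3) ℂ)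
  (hT : (T : Matrix (Fin 3) (Fin 3) ℂ)ᴴ * H.map ι * (T : Matrix (Fin 3) (Fin 3) ℂ) = Literature.Geometry.ComplexHyperbolic.BallModel.J)
  (hdef : ∀ τ' : L →+* ℂ, InfinitePlace.mk τ' ≠ InfinitePlace.mk ι → (H.map τ').PosDef) (h2 : 2 ≤ Module.finrank ℚ ↥(maximalRealSubfield L))
  (μ : Measure (Gp L H).automorphicQuotient) [(Gp L H).IsAutomorphicMeasure μ] (μω : HeckeCharacter L) (hμu : μω.IsUnitary)
  (hμω : ∀ x : Literature.NumberTheory.GaloisRepresentations.ideleGroup ↥(maximalRealSubfield L), μω (AdeleRing.ideleBaseChange (↥(maximalRealSubfield L)) L x) = quadraticHeckeCharCM L x)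
  (ν : @Measure (GpAdelic L H) (borel _))
  (νH : ∀ v : Places L, @Measure (HLocal L v) (borel _)) (νG : ∀ v : Places L, @Measure (GpLocal L H v) (borel _))
  (νGi : @Measure (GpInf L H) (borel _)) (νqi : @Measure (GInf L) (borel _)) (νHi : @Measure (HInf L) (borel _))
  (μZ : ∀ v : Places L, @Measure (Gqs L v ⧸ Subgroup.center (Gqs L v)) (borel _))
  (isHaar_ν : letI : MeasurableSpace (GpAdelic L H) := borel _; ν.IsHaarMeasure)
  (isInvInv_ν : letI : MeasurableSpace (GpAdelic L H) := borel _; ν.IsInvInvariant)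
  (isHaar_νH : ∀ v : Places L, letI : MeasurableSpace (HLocal L v) := borel _; (νH v).IsHaarMeasure)
  (isRightInv_νH : ∀ v : Places L, letI : MeasurableSpace (HLocal L v) := borel _; (νH v).IsMulRightInvariant)
  (isHaar_νG : ∀ v : Places L, letI : MeasurableSpace (GpLocal L H v) := borel _; (νG v).IsHaarMeasure)
  (isRightInv_νG : ∀ v : Places L, letI : MeasurableSpace (GpLocal L H v) := borel _; (νG v).IsMulRightInvariant)
  (finCpt_νGi : letI : MeasurableSpace (GpInf L H) := borel _; IsFiniteMeasureOnCompacts νGi)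
  (rightInv_νGi : letI : MeasurableSpace (GpInf L H) := borel _; νGi.IsMulRightInvariant)
  (finCpt_νqi : letI : MeasurableSpace (GInf L) := borel _; IsFiniteMeasureOnCompacts νqi)
  (rightInv_νqi : letI : MeasurableSpace (GInf L) := borel _; νqi.IsMulRightInvariant)
  (finCpt_νHi : letI : MeasurableSpace (HInf L) := borel _; IsFiniteMeasureOnCompacts νHi)
  (rightInv_νHi : letI : MeasurableSpace (HInf L) := borel _; νHi.IsMulRightInvariant)
  (isHaar_μZ : ∀ v : Places L, letI : MeasurableSpace (Gqs L v ⧸ Subgroup.center (Gqs L v)) := borel _; (μZ v).IsHaarMeasure)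
  (hquad : ∀ v : Places L, (∀ w : PlacesOver L v, IsCMField.complexConj L • w.1 = w.1) →
    IsQuadraticCharExtension (conjLocal L (IsCMField.complexConj L) v) (μω.semilocalComponent L v))
  -- binders 33∕34: `vol_{νG_v}(K′_v) = 1` = `Rung0WitnessS.hK`, `vol_{νH_v}(K_{2,v} × K_{1,v}) = 1` = `Rung0WitnessS.hKH` (desk D35 (11)–(13); PROBE v7 :95–:99 VERBATIM)
  (hvol : ∀ v : Places L, νG v (cmLocalIntegralLevel L 3 H v : Set (GpLocal L H v)) = 1)
  (hvolH : ∀ v : Places L,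
    νH v (((cmLocalIntegralLevel L 2 (Matrix.of fun i j : Fin 2 => if i.val + j.val + 1 = 2 then (1 : L) else 0) v).prod
        (cmLocalIntegralLevel L 1 (Matrix.of fun i j : Fin 1 => if i.val + j.val + 1 = 1 then (1 : L) else 0) v) :
          Subgroup (HLocal L v)) : Set (HLocal L v)) = 1),
    -- SEAM 1 (S9-typ1 (g2) 22:17Z; import-free form, ★ `R90S8ResidualDefs` idiom): the kit ∕ `cmDatum`-keyed tokens below read the `Gp`-keyed automorphic-measure instance
    haveI : (cmDatum L 3 H).IsAutomorphicMeasure μ := ‹(Gp L H).IsAutomorphicMeasure μ›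
    letI : ∀ (v : Places L) (a : HLocal L v), MeasurableSpace (HLocal L v ⧸ Subgroup.centralizer ({a} : Set (HLocal L v))) := fun _ _ => borel _
    letI : ∀ (v : Places L) (γ : (cmDatum L 3 H).Local v),
        MeasurableSpace ((cmDatum L 3 H).Local v ⧸ Subgroup.centralizer ({γ} : Set ((cmDatum L 3 H).Local v))) := fun _ _ => borel _
    haveI : ∀ (v : Places L) (a : HLocal L v), BorelSpace (HLocal L v ⧸ Subgroup.centralizer ({a} : Set (HLocal L v))) := fun _ _ => ⟨rfl⟩
    haveI : ∀ (v : Places L) (γ : (cmDatum L 3 H).Local v),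
        BorelSpace ((cmDatum L 3 H).Local v ⧸ Subgroup.centralizer ({γ} : Set ((cmDatum L 3 H).Local v))) := fun _ _ => ⟨rfl⟩
    -- the K9 inner prefix of ★ `K9SpectralLetterSigned` (Defs :1402–:1447) VERBATIM, `hpin` NAMED
    ∀ (mH : ∀ v : Places L, OrbitalMeasureFamily (HLocal L v)) (mG : ∀ v : Places L, OrbitalMeasureFamily ((cmDatum L 3 H).Local v)),
      letI : MeasurableSpace (GpAdelic L H) := borel _
      haveI : BorelSpace (GpAdelic L H) := ⟨rfl⟩
      haveI : ν.IsHaarMeasure := isHaar_ν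
      haveI : ν.IsInvInvariant := isInvInv_ν
      letI : ∀ v : Places L, MeasurableSpace (GpLocal L H v) := fun _ => borel _
      haveI : ∀ v : Places L, BorelSpace (GpLocal L H v) := fun _ => ⟨rfl⟩
      letI : ∀ v : Places L, MeasurableSpace (HLocal L v) := fun _ => borel _
      haveI : ∀ v : Places L, BorelSpace (HLocal L v) := fun _ => ⟨rfl⟩
      letI : ∀ (v : Places L) (a : HLocal L v), MeasurableSpace (HLocal L v ⧸ Subgroup.centralizer ({a} : Set (HLocal L v))) := fun _ _ => borel _
      letI : ∀ (v : Places L) (γ : GpLocal L H v), MeasurableSpace (GpLocal L H v ⧸ Subgroup.centralizer ({γ} : Set (GpLocal L H v))) := fun _ _ => borel _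
      letI : MeasurableSpace (GpInf L H) := borel _
      haveI : BorelSpace (GpInf L H) := ⟨rfl⟩
      letI : MeasurableSpace (GInf L) := borel _
      haveI : BorelSpace (GInf L) := ⟨rfl⟩
      letI : MeasurableSpace (HInf L) := borel _
      haveI : BorelSpace (HInf L) := ⟨rfl⟩
      haveI : ∀ v : Places L, (νH v).IsHaarMeasure := isHaar_νH
      haveI : ∀ v : Places L, (νH v).IsMulRightInvariant := isRightInv_νH
      haveI : ∀ v : Places L, (νG v).IsHaarMeasure := isHaar_νG
      haveI : ∀ v : Places L, (νG v).IsMulRightInvariant := isRightInv_νG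
      haveI : IsFiniteMeasureOnCompacts νGi := finCpt_νGi
      haveI : νGi.IsMulRightInvariant := rightInv_νGi
      haveI : IsFiniteMeasureOnCompacts νqi := finCpt_νqi
      haveI : νqi.IsMulRightInvariant := rightInv_νqi
      haveI : IsFiniteMeasureOnCompacts νHi := finCpt_νHi
      haveI : νHi.IsMulRightInvariant := rightInv_νHi
      (∀ v : Places L, (mH v).IsCanonical (IsLocalGRegular L v) (νH v) ∧
          (mG v).IsCanonical (fun γ => IsRegularElt (γ.val : GL (Fin 3) (UnitaryGroup.LocalRing L v))) (νG v)) →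
      ∀ (𝔨 : ComparisonKit L H μ) (hpin : 𝔨.IsPinned ν (archCanonicalTransferFactor L H μω) νH νG νGi νqi νHi), 𝔨.TransferExistence → 𝔨.SimpleTraceFormula → 𝔨.Δ = (finExplicitCollection L H μω (finExplicitDelta_conj_left_all L H μω) (finExplicitDelta_conj_right_all L H μω)) → 𝔨.mH = mH →
        (∀ (v : Places L) (c' : ConjClasses ((cmDatum L 3 H).Local v)),
          Literature.NumberTheory.Rogawski1990.IsRegularElt ((Quotient.out c').val : GL (Fin 3) (UnitaryGroup.LocalRing L v)) → 𝔨.mG v c' = mG v c') →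
        ∀ (hQ : CMCharIdentityPackageTestSigned L H (transpose_map_cmConjRingHom_eq_of_frame L ι H T hT) (isUnit_det_of_frame L ι H T hT) νH νG μω hμu (finExplicitCollection L H μω (finExplicitDelta_conj_left_all L H μω) (finExplicitDelta_conj_right_all L H μω)) mH mG),
          -- (H₇) LOCAL Δ‴-TRANSFER EXISTENCE AT NON-SPLIT `v` — the ONE hypothesis beyond the consumer telescope, in LH10 `DbTSAtRecordW1`'s `hex` bytes under σ (= A ED. 3 :139–:141 = B ED. 3 :473–:475;
          -- ★ predicate `IsLocalDeltaTransferExists` of ★ `Literature…Rogawski1990.LocalTransferExistence`). NOTE: the consumer's `hΔ` (:160) is the kit pin `𝔨.Δ = Δ‴`, NOT this letter;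
          -- `F0_P3c_PKtuplePaydown` ED. 6 carries no local-transfer-existence clause in its telescope (grep count 0), so (H₇) cannot be «bound by name» there — J7 pays it from LH10's `hex`.
          (∀ v : HeightOneSpectrum (𝓞 ↥(maximalRealSubfield L)), (∀ w : PlacesOver L v, IsCMField.complexConj L • w.1 = w.1) →
            IsLocalDeltaTransferExists L H v (finExplicitCollection L H μω (finExplicitDelta_conj_left_all L H μω) (finExplicitDelta_conj_right_all L H μω) v) (mH v) (mG v) Literature.NumberTheory.Rogawski1990.IsLocSmooth
              Literature.NumberTheory.Rogawski1990.IsLocSmooth) →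
          -- S9 PART: print's `ξ`, a `K^c`-FIXED discrete `P` of `U(H)`, hypothesis (AE) (= ★ trigger p861905's conclusion under σ), then (S-G)'s tail under σ
          ∀ (ξ : OneDimAutRepH L) (P : DiscreteAutomorphicRep (Gp L H) μ) (hsph : IsKcSpherical L ι H T hT μ P),
          -- hypothesis (AE) «t(P) = t(Π(ξ))» — the e.v.p. of P is that of the A-packet Π(ξ) (TEXT = the conclusion of `hAE` BYTE FOR BYTE)
          (∃ S : Finset (HeightOneSpectrum (𝓞 ↥(maximalRealSubfield L))),
            (∀ v : HeightOneSpectrum (𝓞 ↥(maximalRealSubfield L)), v ∉ S →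
              ∀ (hns : ∀ w : PlacesOver L v, IsCMField.complexConj L • w.1 = w.1)
                (T : GL (Fin 3) (LocalRing L v)) (a : LocalRing L v) (ha : IsUnit a)
                (h : formCongr (conjLocal L (IsCMField.complexConj L) v) T (H.map (algebraMap L (LocalRing L v))) =
                  a • (Matrix.of fun i j : Fin 3 => if i.val + j.val + 1 = 3 then (1 : L) else 0).map (algebraMap L (LocalRing L v))),
              ∀ [MeasurableSpace (Gqs L v ⧸ Subgroup.center (Gqs L v))] [BorelSpace (Gqs L v ⧸ Subgroup.center (Gqs L v))]
                (μZ : Measure (Gqs L v ⧸ Subgroup.center (Gqs L v))) [μZ.IsHaarMeasure],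
              ∀ (π2 πn : IrrClass (Gqs L v)),
                KeysCaseTwoLabels L v (μω.semilocalComponent L v) (torusLocalComponent L (IsCMField.complexConj L) v ξ.η)
                  (torusLocalComponent L (IsCMField.complexConj L) v ξ.ψ) π2 πn →
                ¬ πn.IsSquareIntegrable μZ →
                ∀ c : IrrClass ((cmDatum L 3 H).Local v),
                  (IrrClass.comap (localPiEquiv L (IsCMField.complexConj L) 3 H v) c).IsConstituentOf
                      (P.finRep.smoothPart.toRepresentation.comp (inclPlace (↥(maximalRealSubfield L)) L (IsCMField.complexConj L) 3 H v)) →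
                  c = IrrClass.comap (cmDatumLocalCongr L v T ha h).symm πn) ∧
            (∀ v : HeightOneSpectrum (𝓞 ↥(maximalRealSubfield L)), v ∉ S →
              ∀ (hs : ∃ w : PlacesOver L v, IsCMField.complexConj L • w.1 ≠ w.1),
                ∀ c : IrrClass ((cmDatum L 3 H).Local v),
                  (IrrClass.comap (localPiEquiv L (IsCMField.complexConj L) 3 H v) c).IsConstituentOf
                      (P.finRep.smoothPart.toRepresentation.comp (inclPlace (↥(maximalRealSubfield L)) L (IsCMField.complexConj L) 3 H v)) →
                  c ∈ (cmSplitPacket L H (transpose_map_cmConjRingHom_eq_of_frame L ι H T hT) (isUnit_det_of_frame L ι H T hT) v (splitWitness v hs) (splitWitness_spec v hs) (ξ.splitν₀ μω (splitWitness v hs).1)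
                    (ξ.locψ (splitWitness v hs).1) (ξ.norm_splitν₀_apply hμu (splitWitness v hs).1)
                    (ξ.continuous_splitν₀ μω (splitWitness v hs).1) (ξ.norm_locψ_apply (splitWitness v hs).1)
                    (ξ.continuous_locψ (splitWitness v hs).1)).members)) →
          ∀ (v : HeightOneSpectrum (𝓞 ↥(maximalRealSubfield L))) (hns : ∀ w : PlacesOver L v, IsCMField.complexConj L • w.1 = w.1),
          ∀ (T : GL (Fin 3) (LocalRing L v)) (a : LocalRing L v) (ha : IsUnit a)
            (h : formCongr (conjLocal L (IsCMField.complexConj L) v) T (H.map (algebraMap L (LocalRing L v))) =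
              a • (Matrix.of fun i j : Fin 3 => if i.val + j.val + 1 = 3 then (1 : L) else 0).map (algebraMap L (LocalRing L v))),
          ∀ [MeasurableSpace (Gqs L v ⧸ Subgroup.center (Gqs L v))] [BorelSpace (Gqs L v ⧸ Subgroup.center (Gqs L v))]
            (μZ : Measure (Gqs L v ⧸ Subgroup.center (Gqs L v))) [μZ.IsHaarMeasure],
          ∀ (π2 πn : IrrClass (Gqs L v)),
          ∀ (hK : KeysCaseTwoLabels L v (μω.semilocalComponent L v) (torusLocalComponent L (IsCMField.complexConj L) v ξ.η)
              (torusLocalComponent L (IsCMField.complexConj L) v ξ.ψ) π2 πn)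
            (hn : ¬ πn.IsSquareIntegrable μZ),
            -- (S-G) «13.3.6 (c) ∕ §14.6 AT PRINT'S PINNED DATA»: every v-constituent of P is πⁿ ∘ e, π² ∘ e, or the πˢ(ξ_v) ∘ e of `hQS`
            ∀ c : IrrClass ((cmDatum L 3 H).Local v),
              (IrrClass.comap (localPiEquiv L (IsCMField.complexConj L) 3 H v) c).IsConstituentOf
                  (P.finRep.smoothPart.toRepresentation.comp (inclPlace (↥(maximalRealSubfield L)) L (IsCMField.complexConj L) 3 H v)) →
              c = IrrClass.comap (cmDatumLocalCongr L v T ha h).symm πn ∨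
                c = IrrClass.comap (cmDatumLocalCongr L v T ha h).symm π2 ∨
                c = ((hQ ξ).1 v hns T a ha h μZ π2 πn hK hn).πs

open Summit.HodgeConjecture.HodgeConjecture.Cruxes.H413.F0P3XiPacketFamilyOfRecordSCD (xiPacketFamilyOfRecordSCD hSCD_of_cmCharIdentityPackageTestSigned)
open Summit.HodgeConjecture.HodgeConjecture.Cruxes.H413.F0P3XiArchDataOfRecord (archTypeOfRecord)
open Summit.HodgeConjecture.HodgeConjecture.Cruxes.H413.F0P3LocalPacketKit
open Summit.HodgeConjecture.HodgeConjecture.Cruxes.H413.F0P3GlobalPacket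
open Summit.HodgeConjecture.HodgeConjecture.Cruxes.H413.F0P3GlobalPacketDiscrete
open Summit.HodgeConjecture.HodgeConjecture.Cruxes.H413.F0P3ArchPacketKit
open Summit.HodgeConjecture.HodgeConjecture.Cruxes.H413.F0P3SpectralPacket
open Summit.HodgeConjecture.HodgeConjecture.Cruxes.H413.K2E1SpectralTermsDiscreteHalf (DiscreteClass)
open Literature.NumberTheory.Automorphic.UnitaryGroup.CotangentForms
open Literature.RepresentationTheory.KonnoKonno2007 Literature.RepresentationTheory.KonnoKonno2007.RealDualPair
open Literature.RepresentationTheory.KonnoKonno2007.RealDualPair.UForm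
open Summit.HodgeConjecture.HodgeConjecture.R90.S5 (gOfRecord gOfRecord_packetTrichotomy gOfRecord_n PacketHOfRecord PacketGOfRecord Φ MemOfRecord IsAPacketOfRecord LiftsToOfRecord trGOfRecord nGOfRecord nGOfRecord_eq_n_discH)

/-- **§0 (D7) `MnNeZeroCohTriv_cm` — the COH-TRIVIAL reading of «`m_v n_v ≠ 0`»** (p02 (J7-d) F-2 bytes): at a compact archimedean place `w`, «`F_φ(ξ_τ) = 𝟙`» for every `τ` over `w`
(★ `OneDimAutRepH.IsCohTrivialAt` at `tOfArchType (archTypeOfRecord μω) τ`); at a finite place the caller's PARAMETER `MnFin ρ v` — never read, since ★ `InnerFormSec146.S0 L H`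
has no finite place (B passes `MnFin := fun _ _ => True`). [cite: Rogawski1990, §14.4 (14.4.1)–(14.4.2) p. 236; §14.2 p. 232] -/
def MnNeZeroCohTriv_cm (L : Type) [Field L] [NumberField L] [IsCMField L] (μω : HeckeCharacter L)
    (G : GlobalPacketData.{0} (TestG L) (TestH L)) (IsOneDimH : G.PacketH → Prop) (oneDimOf : (ρ : G.PacketH) → IsOneDimH ρ → OneDimAutRepH L)
    (MnFin : G.PacketH → HeightOneSpectrum (𝓞 ↥(maximalRealSubfield L)) → Prop) (ρ : G.PacketH) : InnerFormSec146.Place L → Prop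
  | Sum.inl v => MnFin ρ v
  | Sum.inr w => ∀ τ : L →+* ℂ, InfinitePlace.mk τ = w → ∀ h₁ : IsOneDimH ρ, (oneDimOf ρ h₁).IsCohTrivialAt (ArchSignRecipe.tOfArchType (archTypeOfRecord μω) τ) τ

/-! ### §0a (J8 FOLD, RULING (K-b‴)(a)) THE J8 PINS `trB` ∕ `pairG_cm` AND THE `hG` GLUE — p02 (g2) cert `CERT_J8_hG_glue.lean` faf29eed72648f89 ≡ §00 of
`CERT_rows_p02_J8fold_closed_at_Xcm.v3.lean` bbb948030a87480b (J8 FOLD OF RECORD, dealer 00:58:36Z) VERBATIM, namespace nested as `R90.S9.J8` (was `R90.S5.J8GlueCert`). -/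

namespace J8

open Filter
open scoped Classical
open Literature.RepresentationTheory Literature.RepresentationTheory.BorelWallach2000 Literature.RepresentationTheory.KonnoKonno2007

section Glue

variable {L : Type} [Field L] [NumberField L] [IsCMField L]
  (𝔩 : ∀ v : HeightOneSpectrum (𝓞 ↥(maximalRealSubfield L)), LocalPacketKit L (splitForm L 3) v) (𝔞 : ArchPacketKit) (𝔞H : ArchPacketKitH 𝔞)
  (μ : Measure (adelicGroupData (↥(maximalRealSubfield L)) L (IsCMField.complexConj L) 3 (splitForm L 3)).automorphicQuotient)
  [(adelicGroupData (↥(maximalRealSubfield L)) L (IsCMField.complexConj L) 3 (splitForm L 3)).IsAutomorphicMeasure μ]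
  (μ₂ : Measure (adelicGroupData (↥(maximalRealSubfield L)) L (IsCMField.complexConj L) 2 (Φ L 2)).automorphicQuotient)
  [(adelicGroupData (↥(maximalRealSubfield L)) L (IsCMField.complexConj L) 2 (Φ L 2)).IsAutomorphicMeasure μ₂]
  (μ₁ : Measure (adelicGroupData (↥(maximalRealSubfield L)) L (IsCMField.complexConj L) 1 (Φ L 1)).automorphicQuotient)
  [(adelicGroupData (↥(maximalRealSubfield L)) L (IsCMField.complexConj L) 1 (Φ L 1)).IsAutomorphicMeasure μ₁]
  (archH : (∀ v : HeightOneSpectrum (𝓞 ↥(maximalRealSubfield L)), IrrClass ((cmDatum L 2 (Φ L 2)).Local v)) →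
    (∀ v : HeightOneSpectrum (𝓞 ↥(maximalRealSubfield L)), ((cmDatum L 1 (Φ L 1)).Local v) →* ℂˣ) → 𝔞H.PktInfH)
  [Nonempty 𝔞.PktInf] (Pk : OneDimAutRepH L → ∀ v : HeightOneSpectrum (𝓞 ↥(maximalRealSubfield L)), CMLocalAPacket L (splitForm L 3) v)
  (μω : HeckeCharacter L)
  -- the packet-trace presentation data (J8-R5): bad set `S₀`, local measures `νGψ := fun v => (νG v).map (𝔨.ψ v)`, archimedean trace `archTr`
  (S₀ : Finset (HeightOneSpectrum (𝓞 ↥(maximalRealSubfield L))))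
  [∀ v : HeightOneSpectrum (𝓞 ↥(maximalRealSubfield L)), MeasurableSpace ((cmDatum L 3 (splitForm L 3)).Local v)]
  (νGψ : ∀ v : HeightOneSpectrum (𝓞 ↥(maximalRealSubfield L)), Measure ((cmDatum L 3 (splitForm L 3)).Local v))
  (archTr : GKIrrClass (uFormGroup (Fin 2) (Fin 1)) →
    (UnitaryGroup.arch (↥(maximalRealSubfield L)) L (IsCMField.complexConj L) 3 (splitForm L 3) → ℂ) → ℂ)
  (pairSome : PacketHOfRecord 𝔩 𝔞 𝔞H μ₂ μ₁ archH →
    DiscreteClass (adelicGroupData (↥(maximalRealSubfield L)) L (IsCMField.complexConj L) 3 (splitForm L 3)) μ → ℂ)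

/-- **`pktOf c` — the packet of record of which the class `c` is a member** (`some (choose _)` if `c` is a member of some packet, `none` otherwise — no `Nonempty` posit). -/
def pktOf (c : DiscreteClass (adelicGroupData (↥(maximalRealSubfield L)) L (IsCMField.complexConj L) 3 (splitForm L 3)) μ) : Option (PacketGOfRecord 𝔩 𝔞 μ Pk) :=
  if h : ∃ Q : PacketGOfRecord 𝔩 𝔞 μ Pk, MemOfRecord 𝔩 𝔞 μ Pk c Q then some (Classical.choose h) else none


omit [∀ v : HeightOneSpectrum (𝓞 ↥(maximalRealSubfield L)), MeasurableSpace ((cmDatum L 3 (splitForm L 3)).Local v)] in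
/-- **Every packet of record HAS a member class** (hypothesis-free): the discrete witness of `Q.1.isDiscrete` — a family `π ∈ Π` and a discrete `P` whose `v`-constituents are exactly
the `π_v` — gives the member `DiscreteClass.mk P` (constituents are constant on the unitary class). -/
theorem exists_memOfRecord (Q : PacketGOfRecord 𝔩 𝔞 μ Pk) :
    ∃ c : DiscreteClass (adelicGroupData (↥(maximalRealSubfield L)) L (IsCMField.complexConj L) 3 (splitForm L 3)) μ, MemOfRecord 𝔩 𝔞 μ Pk c Q := by
  obtain ⟨π, hmem, hocc⟩ := Q.1.isDiscrete
  obtain ⟨P, W, _, _, σ, hirr, -, hadm, hfin, hex⟩ := (cmOccursInDiscreteSpectrum_iff L 3 (splitForm L 3) μ π).1 hocc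
  refine ⟨DiscreteClass.mk P, fun P' hP' v c' hc' => ?_⟩
  -- `P′ ≃ P` (same class): same `v`-constituents; those of `P` are those of `σ`, i.e. exactly `π_v`
  have huP : ContRepresentation.AreUnitarilyEquivalent P'.space.toContRep P.space.toContRep := (DiscreteClass.mk_eq_mk_iff P' P).1 hP'
  have h1 := (InnerFormSec146.isConstituentOf_iff_of_areUnitarilyEquivalent P' P huP v c').1 hc'
  have h2 := (F0P3FinPartConstituentTransfer.smoothConstituents_iff_of_hasFinComponent P hirr hadm hfin v _).1 h1
  have h3 : IrrClass.comap (localPiEquiv L (IsCMField.complexConj L) 3 (splitForm L 3) v) c' =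
      IrrClass.comap (localPiEquiv L (IsCMField.complexConj L) 3 (splitForm L 3) v) (π v) := (hex v _).1 h2
  have h4 : c' = π v := by
    have := congrArg (IrrClass.comap (localPiEquiv L (IsCMField.complexConj L) 3 (splitForm L 3) v).symm) h3
    rwa [IrrClass.comap_symm_comap, IrrClass.comap_symm_comap] at this
  rw [h4]
  exact hmem.1 v

/-- **`repOf Q` — a designated member of the packet `Q`** (`Classical.choose` of `exists_memOfRecord`; `memOfRecord_repOf`: it IS a member).  CAVEAT (S5-R6): `MemOfRecord c Q` asks every
`v`-constituent of every representative of `c` to lie in `Q_v` — a class with no constituents at all would be a vacuous member of every packet; the designated member chosen here is the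
HONEST one of `exists_memOfRecord`. -/
def repOf (Q : PacketGOfRecord 𝔩 𝔞 μ Pk) : DiscreteClass (adelicGroupData (↥(maximalRealSubfield L)) L (IsCMField.complexConj L) 3 (splitForm L 3)) μ :=
  Classical.choose (exists_memOfRecord 𝔩 𝔞 μ Pk Q)

omit [∀ v : HeightOneSpectrum (𝓞 ↥(maximalRealSubfield L)), MeasurableSpace ((cmDatum L 3 (splitForm L 3)).Local v)] in
/-- **`repOf Q` IS a member of `Q`.** -/
theorem memOfRecord_repOf (Q : PacketGOfRecord 𝔩 𝔞 μ Pk) : MemOfRecord 𝔩 𝔞 μ Pk (repOf 𝔩 𝔞 μ Pk Q) Q :=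
  Classical.choose_spec (exists_memOfRecord 𝔩 𝔞 μ Pk Q)

omit [∀ v : HeightOneSpectrum (𝓞 ↥(maximalRealSubfield L)), MeasurableSpace ((cmDatum L 3 (splitForm L 3)).Local v)] in
/-- **`pktOf c = some Q′` with `MemOfRecord c Q′` as soon as `c` is a member of some packet.** -/
theorem pktOf_spec {c : DiscreteClass (adelicGroupData (↥(maximalRealSubfield L)) L (IsCMField.complexConj L) 3 (splitForm L 3)) μ}
    {Q : PacketGOfRecord 𝔩 𝔞 μ Pk} (h : MemOfRecord 𝔩 𝔞 μ Pk c Q) :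
    ∃ Q' : PacketGOfRecord 𝔩 𝔞 μ Pk, pktOf 𝔩 𝔞 μ Pk c = some Q' ∧ MemOfRecord 𝔩 𝔞 μ Pk c Q' := by
  have hex : ∃ Q : PacketGOfRecord 𝔩 𝔞 μ Pk, MemOfRecord 𝔩 𝔞 μ Pk c Q := ⟨Q, h⟩
  refine ⟨Classical.choose hex, ?_, Classical.choose_spec hex⟩
  unfold pktOf
  rw [dif_pos hex]

/-- **`trB c f := Tr Π_c(f)`** — the packet-level trace ★ S5-C `trGOfRecord` read on classes through `pktOf` (J8-R3 (b)); junk `0` on a member of no packet. -/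
def trB (c : DiscreteClass (adelicGroupData (↥(maximalRealSubfield L)) L (IsCMField.complexConj L) 3 (splitForm L 3)) μ) (f : TestG L) : ℂ :=
  (pktOf 𝔩 𝔞 μ Pk c).elim 0 fun Q => trGOfRecord 𝔩 𝔞 μ Pk S₀ νGψ archTr Q f

/-- **`pairG_cm`** — `⟨1, c⟩ :=` the indicator of «`c` is the designated member of its packet»; `⟨ρ, c⟩ := pairSome ρ c` (free; no reader on the stable route). -/
def pairG_cm : Option (PacketHOfRecord 𝔩 𝔞 𝔞H μ₂ μ₁ archH) →
    DiscreteClass (adelicGroupData (↥(maximalRealSubfield L)) L (IsCMField.complexConj L) 3 (splitForm L 3)) μ → ℂ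
  | none, c => (pktOf 𝔩 𝔞 μ Pk c).elim 0 fun Q => if repOf 𝔩 𝔞 μ Pk Q = c then 1 else 0
  | some ρ, c => pairSome ρ c

/-- **THE PACKET-TRACE DICTIONARY modulo membership UNIQUENESS** (`hdisj` = B's `sock_S9_memUnique_cm`, payer S5∕S4): `Σᶠ_{c ∈ Q} ⟨1,c⟩ · trB c f = Tr Q(f)` — under `hdisj`
every member `c` of `Q` has `pktOf c = Q`, so the summand is `𝟙[c = repOf Q] · Tr Q(f)`, and `repOf Q ∈ Q`. -/
theorem packetTrace_trB_eq_of_memUnique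
    (hdisj : ∀ (c : DiscreteClass (adelicGroupData (↥(maximalRealSubfield L)) L (IsCMField.complexConj L) 3 (splitForm L 3)) μ) (Q Q' : PacketGOfRecord 𝔩 𝔞 μ Pk),
      MemOfRecord 𝔩 𝔞 μ Pk c Q → MemOfRecord 𝔩 𝔞 μ Pk c Q' → Q = Q')
    (Q : PacketGOfRecord 𝔩 𝔞 μ Pk) (f : TestG L) :
    (gOfRecord 𝔩 𝔞 𝔞H μ μ₂ μ₁ archH Pk μω (pairG_cm 𝔩 𝔞 𝔞H μ μ₂ μ₁ archH Pk pairSome)).packetTrace (trB 𝔩 𝔞 μ Pk S₀ νGψ archTr) Q f =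
      trGOfRecord 𝔩 𝔞 μ Pk S₀ νGψ archTr Q f := by
  have hrep : MemOfRecord 𝔩 𝔞 μ Pk (repOf 𝔩 𝔞 μ Pk Q) Q := memOfRecord_repOf 𝔩 𝔞 μ Pk Q
  -- for a member `c` of `Q`: `pktOf c = some Q`
  have hpkt : ∀ c, MemOfRecord 𝔩 𝔞 μ Pk c Q → pktOf 𝔩 𝔞 μ Pk c = some Q := fun c hc => by
    obtain ⟨Q', hQ', hc'⟩ := pktOf_spec 𝔩 𝔞 μ Pk hc
    rw [hQ', hdisj c Q' Q hc' hc]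
  rw [GlobalPacketData.packetTrace_def, finsum_mem_def]
  -- restate in the record's currency (`Rep = DiscreteClass …`, `members Q = {c | MemOfRecord c Q}`, `pair none = pairG_cm … none` — all by `rfl`)
  change ∑ᶠ c : DiscreteClass (adelicGroupData (↥(maximalRealSubfield L)) L (IsCMField.complexConj L) 3 (splitForm L 3)) μ,
      ({c | MemOfRecord 𝔩 𝔞 μ Pk c Q} : Set _).indicator
        (fun c => pairG_cm 𝔩 𝔞 𝔞H μ μ₂ μ₁ archH Pk pairSome none c * trB 𝔩 𝔞 μ Pk S₀ νGψ archTr c f) c =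
      trGOfRecord 𝔩 𝔞 μ Pk S₀ νGψ archTr Q f
  rw [finsum_eq_single _ (repOf 𝔩 𝔞 μ Pk Q)]
  · -- the designated member contributes `1 · Tr Q(f)`
    rw [Set.indicator_of_mem (show repOf 𝔩 𝔞 μ Pk Q ∈ ({c | MemOfRecord 𝔩 𝔞 μ Pk c Q} : Set _) from hrep)]
    show ((pktOf 𝔩 𝔞 μ Pk (repOf 𝔩 𝔞 μ Pk Q)).elim 0 fun Q' => if repOf 𝔩 𝔞 μ Pk Q' = repOf 𝔩 𝔞 μ Pk Q then (1 : ℂ) else 0) *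
        ((pktOf 𝔩 𝔞 μ Pk (repOf 𝔩 𝔞 μ Pk Q)).elim 0 fun Q' => trGOfRecord 𝔩 𝔞 μ Pk S₀ νGψ archTr Q' f) = trGOfRecord 𝔩 𝔞 μ Pk S₀ νGψ archTr Q f
    rw [hpkt _ hrep]
    simp
  · -- every other class contributes `0`
    intro c hc
    by_cases hcm : c ∈ ({c | MemOfRecord 𝔩 𝔞 μ Pk c Q} : Set _)
    · rw [Set.indicator_of_mem hcm]
      show ((pktOf 𝔩 𝔞 μ Pk c).elim 0 fun Q' => if repOf 𝔩 𝔞 μ Pk Q' = c then (1 : ℂ) else 0) *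
          ((pktOf 𝔩 𝔞 μ Pk c).elim 0 fun Q' => trGOfRecord 𝔩 𝔞 μ Pk S₀ νGψ archTr Q' f) = 0
      rw [hpkt c hcm]
      simp [Ne.symm hc]
    · rw [Set.indicator_of_notMem hcm]

/-- **(J8-g) THE LAST J8 GLUE — `hG` IN-FILE** (J8-R5 (ⅲ), deal (J8-g) R90-IF-plan (g2) 23:44:35Z): S8's T1e AT THE PACKET LEVEL (`hT1e`, over ABSTRACT `SθG`, `PSV` — at B
`𝔨.SJGtot`, `PSVanish_cm`, socket «`sock_S9_stableSpecG_trOn_cm`») + membership uniqueness (`hdisj`, socket «`sock_S9_memUnique_cm`») give the carpet's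
`StableDiscreteExpansionG trB SθG PSV` for `gOfRecord … (pairG_cm … pairSome)`: `n = nGOfRecord` (`gOfRecord_n`, `rfl`) and `packetTrace trB Q f = trGOfRecord Q f`
(`packetTrace_trB_eq_of_memUnique`). -/
theorem stableDiscreteExpansionG_of_trOn_of_memUnique (SθG : TestG L → ℂ) (PSV : TestG L → Prop)
    (hT1e : ∀ f : TestG L, PSV f →
      Summable (fun Q : PacketGOfRecord 𝔩 𝔞 μ Pk => nGOfRecord 𝔩 𝔞 μ μ₂ μ₁ Pk Q * trGOfRecord 𝔩 𝔞 μ Pk S₀ νGψ archTr Q f) ∧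
        SθG f = ∑' Q : PacketGOfRecord 𝔩 𝔞 μ Pk, nGOfRecord 𝔩 𝔞 μ μ₂ μ₁ Pk Q * trGOfRecord 𝔩 𝔞 μ Pk S₀ νGψ archTr Q f)
    (hdisj : ∀ (c : DiscreteClass (adelicGroupData (↥(maximalRealSubfield L)) L (IsCMField.complexConj L) 3 (splitForm L 3)) μ) (Q Q' : PacketGOfRecord 𝔩 𝔞 μ Pk),
      MemOfRecord 𝔩 𝔞 μ Pk c Q → MemOfRecord 𝔩 𝔞 μ Pk c Q' → Q = Q') :
    (gOfRecord 𝔩 𝔞 𝔞H μ μ₂ μ₁ archH Pk μω (pairG_cm 𝔩 𝔞 𝔞H μ μ₂ μ₁ archH Pk pairSome)).StableDiscreteExpansionG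
      (trB 𝔩 𝔞 μ Pk S₀ νGψ archTr) SθG PSV := by
  intro f hf
  have hsummand : (fun Q : PacketGOfRecord 𝔩 𝔞 μ Pk =>
      (gOfRecord 𝔩 𝔞 𝔞H μ μ₂ μ₁ archH Pk μω (pairG_cm 𝔩 𝔞 𝔞H μ μ₂ μ₁ archH Pk pairSome)).n Q *
        (gOfRecord 𝔩 𝔞 𝔞H μ μ₂ μ₁ archH Pk μω (pairG_cm 𝔩 𝔞 𝔞H μ μ₂ μ₁ archH Pk pairSome)).packetTrace (trB 𝔩 𝔞 μ Pk S₀ νGψ archTr) Q f) =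
      fun Q => nGOfRecord 𝔩 𝔞 μ μ₂ μ₁ Pk Q * trGOfRecord 𝔩 𝔞 μ Pk S₀ νGψ archTr Q f := by
    funext Q
    rw [gOfRecord_n, packetTrace_trB_eq_of_memUnique 𝔩 𝔞 𝔞H μ μ₂ μ₁ archH Pk μω S₀ νGψ archTr pairSome hdisj Q f]
  obtain ⟨hs, he⟩ := hT1e f hf
  refine ⟨?_, ?_⟩
  · change Summable fun Q : PacketGOfRecord 𝔩 𝔞 μ Pk =>
      (gOfRecord 𝔩 𝔞 𝔞H μ μ₂ μ₁ archH Pk μω (pairG_cm 𝔩 𝔞 𝔞H μ μ₂ μ₁ archH Pk pairSome)).n Q *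
        (gOfRecord 𝔩 𝔞 𝔞H μ μ₂ μ₁ archH Pk μω (pairG_cm 𝔩 𝔞 𝔞H μ μ₂ μ₁ archH Pk pairSome)).packetTrace (trB 𝔩 𝔞 μ Pk S₀ νGψ archTr) Q f
    rw [hsummand]
    exact hs
  · change SθG f = ∑' Q : PacketGOfRecord 𝔩 𝔞 μ Pk,
      (gOfRecord 𝔩 𝔞 𝔞H μ μ₂ μ₁ archH Pk μω (pairG_cm 𝔩 𝔞 𝔞H μ μ₂ μ₁ archH Pk pairSome)).n Q *
        (gOfRecord 𝔩 𝔞 𝔞H μ μ₂ μ₁ archH Pk μω (pairG_cm 𝔩 𝔞 𝔞H μ μ₂ μ₁ archH Pk pairSome)).packetTrace (trB 𝔩 𝔞 μ Pk S₀ νGψ archTr) Q f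
    rw [hsummand]
    exact he

end Glue

/-! ### §0b (rows `hlifts1` ∕ `hn`) p02 (g2) (S5-rows) (c) SNIPPET `hn_of_preimageUnique.snippet.lean` 0901e988203f3333 ≡ §0 of cert v3 bbb948030a87480b VERBATIM (namespace nested as
`R90.S9.J8`): the rows `hn`, `hlifts1` AT THE RECORD from the producer group «`sock_S9_lifts1_cm`» (S5: A-packets of record have a unique lift). -/

section Lifts1

variable {L : Type} [Field L] [NumberField L] [IsCMField L]
  (𝔩 : ∀ v : HeightOneSpectrum (𝓞 ↥(maximalRealSubfield L)), LocalPacketKit L (splitForm L 3) v) (𝔞 : ArchPacketKit) (𝔞H : ArchPacketKitH 𝔞)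
  (μ : Measure (adelicGroupData (↥(maximalRealSubfield L)) L (IsCMField.complexConj L) 3 (splitForm L 3)).automorphicQuotient)
  [(adelicGroupData (↥(maximalRealSubfield L)) L (IsCMField.complexConj L) 3 (splitForm L 3)).IsAutomorphicMeasure μ]
  (μ₂ : Measure (adelicGroupData (↥(maximalRealSubfield L)) L (IsCMField.complexConj L) 2 (Φ L 2)).automorphicQuotient)
  [(adelicGroupData (↥(maximalRealSubfield L)) L (IsCMField.complexConj L) 2 (Φ L 2)).IsAutomorphicMeasure μ₂]
  (μ₁ : Measure (adelicGroupData (↥(maximalRealSubfield L)) L (IsCMField.complexConj L) 1 (Φ L 1)).automorphicQuotient)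
  [(adelicGroupData (↥(maximalRealSubfield L)) L (IsCMField.complexConj L) 1 (Φ L 1)).IsAutomorphicMeasure μ₁]
  (archH : (∀ v : HeightOneSpectrum (𝓞 ↥(maximalRealSubfield L)), IrrClass ((cmDatum L 2 (Φ L 2)).Local v)) →
    (∀ v : HeightOneSpectrum (𝓞 ↥(maximalRealSubfield L)), ((cmDatum L 1 (Φ L 1)).Local v) →* ℂˣ) → 𝔞H.PktInfH)
  [Nonempty 𝔞.PktInf] (Pk : OneDimAutRepH L → ∀ v : HeightOneSpectrum (𝓞 ↥(maximalRealSubfield L)), CMLocalAPacket L (splitForm L 3) v)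
  (μω : HeckeCharacter L)
  (pairG : Option (PacketHOfRecord 𝔩 𝔞 𝔞H μ₂ μ₁ archH) →
    DiscreteClass (adelicGroupData (↥(maximalRealSubfield L)) L (IsCMField.complexConj L) 3 (splitForm L 3)) μ → ℂ)

/-- **ROW `hn` AT THE RECORD from «`sock_S9_lifts1_cm`»**: `IsAPacketOfRecord Q → LiftsToOfRecord ρ Q → (gOfRecord …).n Q = ½`. -/
theorem n_eq_half_of_preimageUnique
    (sock_S9_lifts1_cm : ∀ (Q : PacketGOfRecord 𝔩 𝔞 μ Pk) (ρ ρ' : PacketHOfRecord 𝔩 𝔞 𝔞H μ₂ μ₁ archH),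
      IsAPacketOfRecord 𝔩 𝔞 𝔞H μ μ₂ μ₁ archH Pk Q → LiftsToOfRecord 𝔩 𝔞 𝔞H μ μ₂ μ₁ archH Pk ρ Q → LiftsToOfRecord 𝔩 𝔞 𝔞H μ μ₂ μ₁ archH Pk ρ' Q → ρ = ρ')
    (Q : PacketGOfRecord 𝔩 𝔞 μ Pk) (ρ : PacketHOfRecord 𝔩 𝔞 𝔞H μ₂ μ₁ archH)
    (hA : IsAPacketOfRecord 𝔩 𝔞 𝔞H μ μ₂ μ₁ archH Pk Q) (hl : LiftsToOfRecord 𝔩 𝔞 𝔞H μ μ₂ μ₁ archH Pk ρ Q) :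
    (gOfRecord 𝔩 𝔞 𝔞H μ μ₂ μ₁ archH Pk μω pairG).n Q = 1 / 2 := by
  rw [gOfRecord_n, nGOfRecord_eq_n_discH 𝔩 𝔞 𝔞H μ μ₂ μ₁ archH Pk Q]
  refine Q.1.n_existsDisc_eq_half_of_unique ρ (fun v => (hl v).symm) fun σ hσ himg => ?_
  obtain ⟨Pinf, hdisc⟩ := hσ
  -- the realisable preimage `σ` IS the finite part of an `H`-packet of record lifting to `Q`
  have hunr : ∀ᶠ v : HeightOneSpectrum (𝓞 ↥(maximalRealSubfield L)) in cofinite, (𝔩 v).unr ((𝔩 v).xiH (σ.loc v)) :=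
    Q.1.fin.cofinite_unr.mono fun v hv => by rw [himg v]; exact hv
  have h := sock_S9_lifts1_cm Q ρ ⟨σ, Pinf, hunr, hdisc⟩ hA hl fun v => (himg v).symm
  rw [h]

/-- **ROW `hlifts1` AT THE RECORD from the same group**: `lifts Q = {ρ}`. -/
theorem lifts_eq_singleton_of_preimageUnique
    (sock_S9_lifts1_cm : ∀ (Q : PacketGOfRecord 𝔩 𝔞 μ Pk) (ρ ρ' : PacketHOfRecord 𝔩 𝔞 𝔞H μ₂ μ₁ archH),
      IsAPacketOfRecord 𝔩 𝔞 𝔞H μ μ₂ μ₁ archH Pk Q → LiftsToOfRecord 𝔩 𝔞 𝔞H μ μ₂ μ₁ archH Pk ρ Q → LiftsToOfRecord 𝔩 𝔞 𝔞H μ μ₂ μ₁ archH Pk ρ' Q → ρ = ρ')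
    (Q : PacketGOfRecord 𝔩 𝔞 μ Pk) (ρ : PacketHOfRecord 𝔩 𝔞 𝔞H μ₂ μ₁ archH)
    (hA : IsAPacketOfRecord 𝔩 𝔞 𝔞H μ μ₂ μ₁ archH Pk Q) (hl : LiftsToOfRecord 𝔩 𝔞 𝔞H μ μ₂ μ₁ archH Pk ρ Q) :
    (gOfRecord 𝔩 𝔞 𝔞H μ μ₂ μ₁ archH Pk μω pairG).lifts Q = {ρ} := by
  ext ρ'
  change LiftsToOfRecord 𝔩 𝔞 𝔞H μ μ₂ μ₁ archH Pk ρ' Q ↔ ρ' = ρ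
  exact ⟨fun h => (sock_S9_lifts1_cm Q ρ ρ' hA hl h).symm, fun h => h ▸ hl⟩

end Lifts1

end J8

/-! ### §2 junction sub-sockets (statements + `sorry` stubs; slab convention, counted) -/

open scoped Classical in
set_option synthInstance.maxHeartbeats 400000 in
set_option maxHeartbeats 8000000 in
/-- **(letter F1b) `hF1b` — `K^c`-SPHERICAL discrete representations have unitarily equivalent compact-factor components** (pay-line binder VERBATIM at `μA := μ`; X-free, kit-free floor letter). PAYER: floor (LH10∕F0T1a «F1b general», `DiscreteAutomorphicRep.UnitaryEquivOfComponents`). (η′-1) S9 spelling `InnerFormSec146.IsKcSpherical` vs the floor's subtype form: 1-line bridge each way, ★ p862440 `cptTriv₀_classOf_iff`. [cite: Rogawski1990, §14.6 p. 244; §12.3 p. 178] [cite: FlathCorvallis1979, Thm. 4] -/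
def SocketKcSphericalComponentsCm : Prop :=
  ∀ (L : Type) [Field L] [NumberField L] [IsCMField L] (ι : L →+* ℂ) (H : Matrix (Fin 3) (Fin 3) L) (T : GL (Fin 3) ℂ)
    (hT : (T : Matrix (Fin 3) (Fin 3) ℂ)ᴴ * H.map ι * (T : Matrix (Fin 3) (Fin 3) ℂ) = Literature.Geometry.ComplexHyperbolic.BallModel.J)
    (μ : Measure (Gp L H).automorphicQuotient) [(Gp L H).IsAutomorphicMeasure μ],
    ∀ P₀ Q₀ : DiscreteAutomorphicRep (adelicGroupData (↥(maximalRealSubfield L)) L (IsCMField.complexConj L) 3 H) μ, InnerFormSec146.IsKcSpherical L ι H T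
      hT μ P₀ → InnerFormSec146.IsKcSpherical L ι H T hT μ Q₀ → P₀.UnitaryEquivOfComponents Q₀ (uFormGroup (Fin 2) (Fin 1)) (cmArchSectionUForm L ι H T hT)
      (cmCompactFactor L ι H T hT)

/-- socket stub (letter F1b `hF1b`); payer LH10∕S2 arch floor. -/
theorem sock_S9_kcSphericalComponents_cm : SocketKcSphericalComponentsCm := by
  sorry

open scoped Classical in
set_option synthInstance.maxHeartbeats 400000 in
set_option maxHeartbeats 8000000 in
/-- **(letter ARCH) `hARCH : ArchComponentOfDiscrete L ι H T hT μ`** — the archimedean component of a discrete automorphic representation of `U(H)` is an irreducible admissible unitary `(𝔤,K)`-module (Harish-Chandra; ★ Literature `UnitaryGroupArchComponentOfDiscrete`). X-free, kit-free floor letter; PAYER: S2∕arch floor. [cite: HarishChandra1953, Thms. 4–6] [cite: BorelJacquet1979, §4.6] [cite: Rogawski1990, §14.6 p. 244] -/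
def SocketArchComponentCm : Prop :=
  ∀ (L : Type) [Field L] [NumberField L] [IsCMField L] (ι : L →+* ℂ) (H : Matrix (Fin 3) (Fin 3) L) (T : GL (Fin 3) ℂ)
    (hT : (T : Matrix (Fin 3) (Fin 3) ℂ)ᴴ * H.map ι * (T : Matrix (Fin 3) (Fin 3) ℂ) = Literature.Geometry.ComplexHyperbolic.BallModel.J)
    (μ : Measure (Gp L H).automorphicQuotient) [(Gp L H).IsAutomorphicMeasure μ],
    ArchComponentOfDiscrete L ι H T hT μ

/-- socket stub (letter ARCH `hARCH`); payer S2∕arch floor. -/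
theorem sock_S9_archComponent_cm : SocketArchComponentCm := by
  sorry

open scoped Classical in
set_option synthInstance.maxHeartbeats 400000 in
set_option maxHeartbeats 8000000 in
/-- **(row 27, arch half) `SocketArchPosDetectorCm` — ARCHIMEDEAN POSITIVE DETECTOR**: for every `K^c`-spherical `π′` a `K^c`-bi-invariant archimedean test `φ` with `tr π_∞(φ) ≥ 0` on all `K^c`-spherical `π` and `tr π′_∞(φ) ≠ 0`, at the head's archimedean Haar measure `νinf` (★ p862958). Feeds `hcoverR` via ★ p863531 ∘ ★ p863310 (+ ★ p862997). PAYER: S2∕arch floor (detector). [cite: Rogawski1990, §14.6 p. 244; §12.3 p. 178] [cite: Knapp1986, Thm. 8.49, §XIV.9] -/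
def SocketArchPosDetectorCm : Prop :=
  ∀ (L : Type) [Field L] [NumberField L] [IsCMField L] (ι : L →+* ℂ) (H : Matrix (Fin 3) (Fin 3) L) (T : GL (Fin 3) ℂ)
    (hT : (T : Matrix (Fin 3) (Fin 3) ℂ)ᴴ * H.map ι * (T : Matrix (Fin 3) (Fin 3) ℂ) = Literature.Geometry.ComplexHyperbolic.BallModel.J)
    (μ : Measure (Gp L H).automorphicQuotient) [(Gp L H).IsAutomorphicMeasure μ],
    ∀ (νinf : @Measure (GpInf L H) (borel _)) (hνinf : letI : MeasurableSpace (GpInf L H) := borel _; νinf.IsHaarMeasure),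
    ∀ π' : InnerFormSec146.RepPrimeSph L ι H T hT μ, ∃ φ : GpInf L H → ℂ, ArchTestKc L ι H T hT φ ∧
      (∀ π : InnerFormSec146.RepPrimeSph L ι H T hT μ, 0 ≤ UnitaryGroup.archTr₀ L ι H T hT νinf (InnerFormSec146.tupleOf L ι H T hT μ π).1 φ) ∧
      UnitaryGroup.archTr₀ L ι H T hT νinf (InnerFormSec146.tupleOf L ι H T hT μ π').1 φ ≠ 0

/-- socket stub (row 27 arch detector); payer S2∕arch floor. -/
theorem sock_S9_archPosDetector_cm : SocketArchPosDetectorCm := by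
  sorry

open scoped Classical in
set_option synthInstance.maxHeartbeats 400000 in
set_option maxHeartbeats 8000000 in
/-- **(row 28′) `hframe` — COFINITE LEVEL-MATCHING FRAMES `H_v ≃ a·J_v`** (pay-line binder VERBATIM at `H′ := splitForm L 3`). **PAID ★ p863547** `UnitaryGroup.eventually_exists_cmDatumLocalCongr_levelMatching_all_three` — a named theorem, NOT a debt (ED. 2 precedent `sock_S9_indefiniteSimilitude`). [cite: Rogawski1990, §13.7 p. 206; §14.2 p. 233] [cite: Jacobowitz1962, §3 Thm. 3.1] -/
def SocketLevelMatchingFramesCm : Prop :=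
  ∀ (L : Type) [Field L] [NumberField L] [IsCMField L] (H : Matrix (Fin 3) (Fin 3) L),
    (H.map (cmConjRingHom L))ᵀ = H → IsUnit H.det →
    ∀ᶠ v : HeightOneSpectrum (𝓞 ↥(maximalRealSubfield L)) in Filter.cofinite, ∃ (T₁ : GL (Fin 3) (LocalRing L v)) (a : LocalRing L v) (ha : IsUnit a) (h :
      formCongr (conjLocal L (IsCMField.complexConj L) v) T₁ (H.map (algebraMap L (LocalRing L v))) = a • (splitForm L 3).map (algebraMap L (LocalRing L
      v))), ∀ g : (cmDatum L 3 H).Local v, (cmDatumLocalCongr L v T₁ ha h).symm g ∈ cmLocalIntegralLevel L 3 (splitForm L 3) v ↔ g ∈ cmLocalIntegralLevel L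
      3 H v

/-- PAID (row 28′ `hframe`) by ★ p863547 — 0 sorry. -/
theorem sock_S9_levelMatchingFrames_cm : SocketLevelMatchingFramesCm :=
  fun L _ _ _ H hH hHd => UnitaryGroup.eventually_exists_cmDatumLocalCongr_levelMatching_all_three L H hH hHd

open scoped Classical in
set_option synthInstance.maxHeartbeats 400000 in
set_option maxHeartbeats 8000000 in
/-- **(row 30, non-split half) `hDisj` — the A-PACKETS OF RECORD `Π(ξ)_v` ARE PAIRWISE DISJOINT at every NON-SPLIT finite `v`** (pay-line binder VERBATIM at `Ξ := Ξ₀`, the ★ SCD family of record; the split half is ★ p863965, so `hDisj := aPacketsOfRecordDisjointAt_recordSCD_of_nonsplit … (this socket … hex7)`; AMENDMENT (v) S9-R-CAP-2: the prefix runs through `hQ` AND the (H₇) letter — head bytes VERBATIM — since every ★ payer (★ p865005, p05 cert 59a4cbdd) consumes (H₇)). PAYER E1∕S4: A ED. 6 carrier laws (α)(γ) by name through ★ p864777 ∕ ★ p865005 (S9 side ★ end to end); (β) ★ `eq_packagePis_of_charIdentityAtTestSigned`; (δ) sc∕non-sc reading. [cite: Rogawski1990, §13.1 Prop. 13.1.3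 (d) p. 199; §12.2 (2) pp. 173–174; Lemma 12.7.3 p. 188] -/
def SocketAPacketsDisjointNonsplitCm : Prop :=
  ∀ (L : Type) [Field L] [NumberField L] [IsCMField L] (ι : L →+* ℂ) (H : Matrix (Fin 3) (Fin 3) L) (T : GL (Fin 3) ℂ)
  (hT : (T : Matrix (Fin 3) (Fin 3) ℂ)ᴴ * H.map ι * (T : Matrix (Fin 3) (Fin 3) ℂ) = Literature.Geometry.ComplexHyperbolic.BallModel.J)
  (hdef : ∀ τ' : L →+* ℂ, InfinitePlace.mk τ' ≠ InfinitePlace.mk ι → (H.map τ').PosDef) (h2 : 2 ≤ Module.finrank ℚ ↥(maximalRealSubfield L))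
  (μ : Measure (Gp L H).automorphicQuotient) [(Gp L H).IsAutomorphicMeasure μ] (μω : HeckeCharacter L) (hμu : μω.IsUnitary)
  (hμω : ∀ x : Literature.NumberTheory.GaloisRepresentations.ideleGroup ↥(maximalRealSubfield L), μω (AdeleRing.ideleBaseChange (↥(maximalRealSubfield L)) L x) = quadraticHeckeCharCM L x)
  (ν : @Measure (GpAdelic L H) (borel _))
  (νH : ∀ v : Places L, @Measure (HLocal L v) (borel _)) (νG : ∀ v : Places L, @Measure (GpLocal L H v) (borel _))
  (νGi : @Measure (GpInf L H) (borel _)) (νqi : @Measure (GInf L) (borel _)) (νHi : @Measure (HInf L) (borel _))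
  (μZ : ∀ v : Places L, @Measure (Gqs L v ⧸ Subgroup.center (Gqs L v)) (borel _))
  (isHaar_ν : letI : MeasurableSpace (GpAdelic L H) := borel _; ν.IsHaarMeasure)
  (isInvInv_ν : letI : MeasurableSpace (GpAdelic L H) := borel _; ν.IsInvInvariant)
  (isHaar_νH : ∀ v : Places L, letI : MeasurableSpace (HLocal L v) := borel _; (νH v).IsHaarMeasure)
  (isRightInv_νH : ∀ v : Places L, letI : MeasurableSpace (HLocal L v) := borel _; (νH v).IsMulRightInvariant)
  (isHaar_νG : ∀ v : Places L, letI : MeasurableSpace (GpLocal L H v) := borel _; (νG v).IsHaarMeasure)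
  (isRightInv_νG : ∀ v : Places L, letI : MeasurableSpace (GpLocal L H v) := borel _; (νG v).IsMulRightInvariant)
  (finCpt_νGi : letI : MeasurableSpace (GpInf L H) := borel _; IsFiniteMeasureOnCompacts νGi)
  (rightInv_νGi : letI : MeasurableSpace (GpInf L H) := borel _; νGi.IsMulRightInvariant)
  (finCpt_νqi : letI : MeasurableSpace (GInf L) := borel _; IsFiniteMeasureOnCompacts νqi)
  (rightInv_νqi : letI : MeasurableSpace (GInf L) := borel _; νqi.IsMulRightInvariant)
  (finCpt_νHi : letI : MeasurableSpace (HInf L) := borel _; IsFiniteMeasureOnCompacts νHi)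
  (rightInv_νHi : letI : MeasurableSpace (HInf L) := borel _; νHi.IsMulRightInvariant)
  (isHaar_μZ : ∀ v : Places L, letI : MeasurableSpace (Gqs L v ⧸ Subgroup.center (Gqs L v)) := borel _; (μZ v).IsHaarMeasure)
  (hquad : ∀ v : Places L, (∀ w : PlacesOver L v, IsCMField.complexConj L • w.1 = w.1) →
    IsQuadraticCharExtension (conjLocal L (IsCMField.complexConj L) v) (μω.semilocalComponent L v))
  -- binders 33∕34: `vol_{νG_v}(K′_v) = 1` = `Rung0WitnessS.hK`, `vol_{νH_v}(K_{2,v} × K_{1,v}) = 1` = `Rung0WitnessS.hKH` (desk D35 (11)–(13); PROBE v7 :95–:99 VERBATIM)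
  (hvol : ∀ v : Places L, νG v (cmLocalIntegralLevel L 3 H v : Set (GpLocal L H v)) = 1)
  (hvolH : ∀ v : Places L,
    νH v (((cmLocalIntegralLevel L 2 (Matrix.of fun i j : Fin 2 => if i.val + j.val + 1 = 2 then (1 : L) else 0) v).prod
        (cmLocalIntegralLevel L 1 (Matrix.of fun i j : Fin 1 => if i.val + j.val + 1 = 1 then (1 : L) else 0) v) :
          Subgroup (HLocal L v)) : Set (HLocal L v)) = 1),
    -- SEAM 1 (S9-typ1 (g2) 22:17Z; import-free form, ★ `R90S8ResidualDefs` idiom): the kit ∕ `cmDatum`-keyed tokens below read the `Gp`-keyed automorphic-measure instance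
    haveI : (cmDatum L 3 H).IsAutomorphicMeasure μ := ‹(Gp L H).IsAutomorphicMeasure μ›
    letI : ∀ (v : Places L) (a : HLocal L v), MeasurableSpace (HLocal L v ⧸ Subgroup.centralizer ({a} : Set (HLocal L v))) := fun _ _ => borel _
    letI : ∀ (v : Places L) (γ : (cmDatum L 3 H).Local v),
        MeasurableSpace ((cmDatum L 3 H).Local v ⧸ Subgroup.centralizer ({γ} : Set ((cmDatum L 3 H).Local v))) := fun _ _ => borel _
    haveI : ∀ (v : Places L) (a : HLocal L v), BorelSpace (HLocal L v ⧸ Subgroup.centralizer ({a} : Set (HLocal L v))) := fun _ _ => ⟨rfl⟩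
    haveI : ∀ (v : Places L) (γ : (cmDatum L 3 H).Local v),
        BorelSpace ((cmDatum L 3 H).Local v ⧸ Subgroup.centralizer ({γ} : Set ((cmDatum L 3 H).Local v))) := fun _ _ => ⟨rfl⟩
    -- the K9 inner prefix of ★ `K9SpectralLetterSigned` (Defs :1402–:1447) VERBATIM, `hpin` NAMED
    ∀ (mH : ∀ v : Places L, OrbitalMeasureFamily (HLocal L v)) (mG : ∀ v : Places L, OrbitalMeasureFamily ((cmDatum L 3 H).Local v)),
      letI : MeasurableSpace (GpAdelic L H) := borel _
      haveI : BorelSpace (GpAdelic L H) := ⟨rfl⟩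
      haveI : ν.IsHaarMeasure := isHaar_ν
      haveI : ν.IsInvInvariant := isInvInv_ν
      letI : ∀ v : Places L, MeasurableSpace (GpLocal L H v) := fun _ => borel _
      haveI : ∀ v : Places L, BorelSpace (GpLocal L H v) := fun _ => ⟨rfl⟩
      letI : ∀ v : Places L, MeasurableSpace (HLocal L v) := fun _ => borel _
      haveI : ∀ v : Places L, BorelSpace (HLocal L v) := fun _ => ⟨rfl⟩
      letI : ∀ (v : Places L) (a : HLocal L v), MeasurableSpace (HLocal L v ⧸ Subgroup.centralizer ({a} : Set (HLocal L v))) := fun _ _ => borel _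
      letI : ∀ (v : Places L) (γ : GpLocal L H v), MeasurableSpace (GpLocal L H v ⧸ Subgroup.centralizer ({γ} : Set (GpLocal L H v))) := fun _ _ => borel _
      letI : MeasurableSpace (GpInf L H) := borel _
      haveI : BorelSpace (GpInf L H) := ⟨rfl⟩
      letI : MeasurableSpace (GInf L) := borel _
      haveI : BorelSpace (GInf L) := ⟨rfl⟩
      letI : MeasurableSpace (HInf L) := borel _
      haveI : BorelSpace (HInf L) := ⟨rfl⟩
      haveI : ∀ v : Places L, (νH v).IsHaarMeasure := isHaar_νH
      haveI : ∀ v : Places L, (νH v).IsMulRightInvariant := isRightInv_νH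
      haveI : ∀ v : Places L, (νG v).IsHaarMeasure := isHaar_νG
      haveI : ∀ v : Places L, (νG v).IsMulRightInvariant := isRightInv_νG
      haveI : IsFiniteMeasureOnCompacts νGi := finCpt_νGi
      haveI : νGi.IsMulRightInvariant := rightInv_νGi
      haveI : IsFiniteMeasureOnCompacts νqi := finCpt_νqi
      haveI : νqi.IsMulRightInvariant := rightInv_νqi
      haveI : IsFiniteMeasureOnCompacts νHi := finCpt_νHi
      haveI : νHi.IsMulRightInvariant := rightInv_νHi
      (∀ v : Places L, (mH v).IsCanonical (IsLocalGRegular L v) (νH v) ∧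
          (mG v).IsCanonical (fun γ => IsRegularElt (γ.val : GL (Fin 3) (UnitaryGroup.LocalRing L v))) (νG v)) →
      ∀ (𝔨 : ComparisonKit L H μ) (hpin : 𝔨.IsPinned ν (archCanonicalTransferFactor L H μω) νH νG νGi νqi νHi), 𝔨.TransferExistence → 𝔨.SimpleTraceFormula → 𝔨.Δ = (finExplicitCollection L H μω (finExplicitDelta_conj_left_all L H μω) (finExplicitDelta_conj_right_all L H μω)) → 𝔨.mH = mH →
        (∀ (v : Places L) (c' : ConjClasses ((cmDatum L 3 H).Local v)),
          Literature.NumberTheory.Rogawski1990.IsRegularElt ((Quotient.out c').val : GL (Fin 3) (UnitaryGroup.LocalRing L v)) → 𝔨.mG v c' = mG v c') →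
        ∀ (hQ : CMCharIdentityPackageTestSigned L H (transpose_map_cmConjRingHom_eq_of_frame L ι H T hT) (isUnit_det_of_frame L ι H T hT) νH νG μω hμu (finExplicitCollection L H μω (finExplicitDelta_conj_left_all L H μω) (finExplicitDelta_conj_right_all L H μω)) mH mG),
          (∀ v : HeightOneSpectrum (𝓞 ↥(maximalRealSubfield L)), (∀ w : PlacesOver L v, IsCMField.complexConj L • w.1 = w.1) →
            IsLocalDeltaTransferExists L H v (finExplicitCollection L H μω (finExplicitDelta_conj_left_all L H μω) (finExplicitDelta_conj_right_all L H μω) v) (mH v) (mG v) Literature.NumberTheory.Rogawski1990.IsLocSmooth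
              Literature.NumberTheory.Rogawski1990.IsLocSmooth) →
          letI : ∀ v : Places L, MeasurableSpace (Gqs L v ⧸ Subgroup.center (Gqs L v)) := fun _ => borel _
          haveI : ∀ v : Places L, BorelSpace (Gqs L v ⧸ Subgroup.center (Gqs L v)) := fun _ => ⟨rfl⟩
          haveI : ∀ v : Places L, (μZ v).IsHaarMeasure := isHaar_μZ
          letI : ∀ v : Places L, MeasurableSpace ((cmDatum L 3 (splitForm L 3)).Local v) := fun _ => borel _
          let keys := F0P3XiPacketFamilyOfRecord.keysOfKeysCaseTwo L μω (F0P3KeysCaseTwoOfStubs.keysCaseTwo_of_stubs L (F0P2oLocalLettersHold.keysCaseTwoReducible_holds L) (F0P3U3SquareIntegrableExponentsHolds.u3SquareIntegrableExponents_holds (L := L))) μZ hquad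
          let Ξ₀ : OneDimAutRepH L → InnerFormSec146.PacketPrimeFin L H := xiPacketFamilyOfRecordSCD L H (transpose_map_cmConjRingHom_eq_of_frame L ι H T hT) (isUnit_det_of_frame L ι H T hT) μω hμu μZ keys (hSCD_of_cmCharIdentityPackageTestSigned L H (transpose_map_cmConjRingHom_eq_of_frame L ι H T hT) (isUnit_det_of_frame L ι H T hT) μω hμu (finExplicitCollection L H μω (finExplicitDelta_conj_left_all L H μω) (finExplicitDelta_conj_right_all L H μω)) mH mG νG νH μZ hQ)
          ∀ v : HeightOneSpectrum (𝓞 ↥(maximalRealSubfield L)), (∀ w : PlacesOver L v, IsCMField.complexConj L • w.1 = w.1) →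
            InnerFormSec146.APacketsOfRecordDisjointAt L H Ξ₀ v

/-- socket stub (row 30 `hDisj`, non-split half); payer E1∕S4 (A ED. 6 rows (α)(γ), (β) ★, (δ) definitional). -/
theorem sock_S9_aPacketsDisjointNonsplit_cm : SocketAPacketsDisjointNonsplitCm := by
  sorry

open scoped Classical in
set_option synthInstance.maxHeartbeats 400000 in
set_option maxHeartbeats 8000000 in
/-- **`SocketRecordDatumLawsCm` — THE ∃-PRODUCER OF THE QUASI-SPLIT-SIDE RECORD DATUM WITH ITS §13–§14 LAWS AS NAMED GROUPS** (RULINGS (K-b″)∕(K-b‴): no ∀-socket over lawless kit data; the J8 carrier is folded to the pins `J8.trB` ∕ `J8.pairG_cm` (§0a); every conjunct GROUP is booked under its name with payer and the split-out rule «pure cut, text unchanged under σ, the moment the group's data close by name»). DEBT CENSUS (both numbers, always): `sorry` TOKENS 6 (= 4 standalone sockets + 1 producer + 1 untouched ED. 3 off-path shell `sock_S9_definiteAeRigidity`) ∕ NAMED DEBTS 25 (= 21 producer conjunct groups incl. `hxiR` + 4 standalone); PAID socket row 28′; ED. 3: 1 ∕ 1 — the leaf count goes UP before it comes down. ∃-DATA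 (no closed term of record tonight): `𝔞 𝔞H archH`, `μqs μ₂ μ₁` (+ instances), `𝔩` (JQ-S9-S3-2), `Pk` («`Pk` of record: JQ-S9-S5∕S8-6 PENDING» — ∃ until answered), the T1e presentation `S₀ νGψ archTr pairSome` and `trH` (σ-swaps, ED. 5), the `X_cm` field readers (`MnNeZero := MnNeZeroCohTriv_cm`; `MnFin := fun _ _ => True`, never consumed), `tw twH`, `𝓣` (intended `𝓕₀`), the level floor `l₁` (F-LEV-1: the four twist conjuncts read `∀ l, l₁ ⊆ l → …`), and — under `let X := X_cm …` (★ p862941) — the A2 data `p a₀ a₂ cpt`. INTENDED WITNESS TERMS of the A2 group (dealer 02:05:14Z labelling, p07 A2-STATEMENTS 94a90f4587beab30 — named pins, NOT closed code terms tonight: `archPacketOfRecord` takes the rung-1 letters `jInf dsInf` as arguments): (1) `a₀ ↦` the `πn`-class of `archPacketOfRecord ι μω jInf dsInf (oneDimOf ξ h₁)`; (2) `a₂ ↦` its `dsInf`-class (the `πs` member); (3) `cpt ↦ cptXi₀ ι μω (oneDimOf ξ h₁)` (★ `cptXi₀_iff`, `F0P3KitOfRecord` :128); (4) `p ↦` the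 partner predicate of record (`p ξ h₁ v := ∀ w : PlacesOver L v, c̄ • w.1 = w.1`, the non-split finite places); `p a₀ a₂ cpt` are producer ∃-DATA; named pins, NOT closed code terms (★ p864929 B-PINS spells them for ED. 5). LAWS: the CONJUNCTION of the pay line's X-dependent residual binders VERBATIM under σ = {Ξ₀-literal ↦ `Ξ₀`, `μA` ↦ `μ`, `μv` ↦ `νG`} in 20 named groups (each labelled `-- name (junction)` in the statement; A2 «two-member arch» group LAST) + the Ξ-reader `hxiR`. ADAPTERS (p01 (η′-3)∕(η′-3H)): S8 ⟹ «stableSpecG_trOn» by `fun f ⟨p, hSm, hTr⟩ => hS8 (tensOfPair L H ι T hT p) f hSm.2 hTr.2`; H-side via `simpleStableSpecH_cm_iff` after the `trH` σ-swap. Payer map + ED. 5 kit: `R90/R90-IF-p07/g3/CENSUS-payer-map-B-ed4-v01.md` 2bc3a45c, `KIT-ED5-discharge-rows.md` cfac2c7f. [cite: Rogawski1990, §14.6 Thm. 14.6.1 p. 241, (14.6.2) p. 242, Thm. 14.6.4 p. 243; §13.3 Thm. 13.3.6 (c) p. 202] -/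
def SocketRecordDatumLawsCm : Prop :=
  ∀ (L : Type) [Field L] [NumberField L] [IsCMField L] (ι : L →+* ℂ) (H : Matrix (Fin 3) (Fin 3) L) (T : GL (Fin 3) ℂ)
  (hT : (T : Matrix (Fin 3) (Fin 3) ℂ)ᴴ * H.map ι * (T : Matrix (Fin 3) (Fin 3) ℂ) = Literature.Geometry.ComplexHyperbolic.BallModel.J)
  (hdef : ∀ τ' : L →+* ℂ, InfinitePlace.mk τ' ≠ InfinitePlace.mk ι → (H.map τ').PosDef) (h2 : 2 ≤ Module.finrank ℚ ↥(maximalRealSubfield L))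
  (μ : Measure (Gp L H).automorphicQuotient) [(Gp L H).IsAutomorphicMeasure μ] (μω : HeckeCharacter L) (hμu : μω.IsUnitary)
  (hμω : ∀ x : Literature.NumberTheory.GaloisRepresentations.ideleGroup ↥(maximalRealSubfield L), μω (AdeleRing.ideleBaseChange (↥(maximalRealSubfield L)) L x) = quadraticHeckeCharCM L x)
  (ν : @Measure (GpAdelic L H) (borel _))
  (νH : ∀ v : Places L, @Measure (HLocal L v) (borel _)) (νG : ∀ v : Places L, @Measure (GpLocal L H v) (borel _))
  (νGi : @Measure (GpInf L H) (borel _)) (νqi : @Measure (GInf L) (borel _)) (νHi : @Measure (HInf L) (borel _))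
  (μZ : ∀ v : Places L, @Measure (Gqs L v ⧸ Subgroup.center (Gqs L v)) (borel _))
  (isHaar_ν : letI : MeasurableSpace (GpAdelic L H) := borel _; ν.IsHaarMeasure)
  (isInvInv_ν : letI : MeasurableSpace (GpAdelic L H) := borel _; ν.IsInvInvariant)
  (isHaar_νH : ∀ v : Places L, letI : MeasurableSpace (HLocal L v) := borel _; (νH v).IsHaarMeasure)
  (isRightInv_νH : ∀ v : Places L, letI : MeasurableSpace (HLocal L v) := borel _; (νH v).IsMulRightInvariant)
  (isHaar_νG : ∀ v : Places L, letI : MeasurableSpace (GpLocal L H v) := borel _; (νG v).IsHaarMeasure)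
  (isRightInv_νG : ∀ v : Places L, letI : MeasurableSpace (GpLocal L H v) := borel _; (νG v).IsMulRightInvariant)
  (finCpt_νGi : letI : MeasurableSpace (GpInf L H) := borel _; IsFiniteMeasureOnCompacts νGi)
  (rightInv_νGi : letI : MeasurableSpace (GpInf L H) := borel _; νGi.IsMulRightInvariant)
  (finCpt_νqi : letI : MeasurableSpace (GInf L) := borel _; IsFiniteMeasureOnCompacts νqi)
  (rightInv_νqi : letI : MeasurableSpace (GInf L) := borel _; νqi.IsMulRightInvariant)
  (finCpt_νHi : letI : MeasurableSpace (HInf L) := borel _; IsFiniteMeasureOnCompacts νHi)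
  (rightInv_νHi : letI : MeasurableSpace (HInf L) := borel _; νHi.IsMulRightInvariant)
  (isHaar_μZ : ∀ v : Places L, letI : MeasurableSpace (Gqs L v ⧸ Subgroup.center (Gqs L v)) := borel _; (μZ v).IsHaarMeasure)
  (hquad : ∀ v : Places L, (∀ w : PlacesOver L v, IsCMField.complexConj L • w.1 = w.1) →
    IsQuadraticCharExtension (conjLocal L (IsCMField.complexConj L) v) (μω.semilocalComponent L v))
  -- binders 33∕34: `vol_{νG_v}(K′_v) = 1` = `Rung0WitnessS.hK`, `vol_{νH_v}(K_{2,v} × K_{1,v}) = 1` = `Rung0WitnessS.hKH` (desk D35 (11)–(13); PROBE v7 :95–:99 VERBATIM)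
  (hvol : ∀ v : Places L, νG v (cmLocalIntegralLevel L 3 H v : Set (GpLocal L H v)) = 1)
  (hvolH : ∀ v : Places L,
    νH v (((cmLocalIntegralLevel L 2 (Matrix.of fun i j : Fin 2 => if i.val + j.val + 1 = 2 then (1 : L) else 0) v).prod
        (cmLocalIntegralLevel L 1 (Matrix.of fun i j : Fin 1 => if i.val + j.val + 1 = 1 then (1 : L) else 0) v) :
          Subgroup (HLocal L v)) : Set (HLocal L v)) = 1),
    -- SEAM 1 (S9-typ1 (g2) 22:17Z; import-free form, ★ `R90S8ResidualDefs` idiom): the kit ∕ `cmDatum`-keyed tokens below read the `Gp`-keyed automorphic-measure instance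
    haveI : (cmDatum L 3 H).IsAutomorphicMeasure μ := ‹(Gp L H).IsAutomorphicMeasure μ›
    letI : ∀ (v : Places L) (a : HLocal L v), MeasurableSpace (HLocal L v ⧸ Subgroup.centralizer ({a} : Set (HLocal L v))) := fun _ _ => borel _
    letI : ∀ (v : Places L) (γ : (cmDatum L 3 H).Local v),
        MeasurableSpace ((cmDatum L 3 H).Local v ⧸ Subgroup.centralizer ({γ} : Set ((cmDatum L 3 H).Local v))) := fun _ _ => borel _
    haveI : ∀ (v : Places L) (a : HLocal L v), BorelSpace (HLocal L v ⧸ Subgroup.centralizer ({a} : Set (HLocal L v))) := fun _ _ => ⟨rfl⟩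
    haveI : ∀ (v : Places L) (γ : (cmDatum L 3 H).Local v),
        BorelSpace ((cmDatum L 3 H).Local v ⧸ Subgroup.centralizer ({γ} : Set ((cmDatum L 3 H).Local v))) := fun _ _ => ⟨rfl⟩
    -- the K9 inner prefix of ★ `K9SpectralLetterSigned` (Defs :1402–:1447) VERBATIM, `hpin` NAMED
    ∀ (mH : ∀ v : Places L, OrbitalMeasureFamily (HLocal L v)) (mG : ∀ v : Places L, OrbitalMeasureFamily ((cmDatum L 3 H).Local v)),
      letI : MeasurableSpace (GpAdelic L H) := borel _
      haveI : BorelSpace (GpAdelic L H) := ⟨rfl⟩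
      haveI : ν.IsHaarMeasure := isHaar_ν
      haveI : ν.IsInvInvariant := isInvInv_ν
      letI : ∀ v : Places L, MeasurableSpace (GpLocal L H v) := fun _ => borel _
      haveI : ∀ v : Places L, BorelSpace (GpLocal L H v) := fun _ => ⟨rfl⟩
      letI : ∀ v : Places L, MeasurableSpace (HLocal L v) := fun _ => borel _
      haveI : ∀ v : Places L, BorelSpace (HLocal L v) := fun _ => ⟨rfl⟩
      letI : ∀ (v : Places L) (a : HLocal L v), MeasurableSpace (HLocal L v ⧸ Subgroup.centralizer ({a} : Set (HLocal L v))) := fun _ _ => borel _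
      letI : ∀ (v : Places L) (γ : GpLocal L H v), MeasurableSpace (GpLocal L H v ⧸ Subgroup.centralizer ({γ} : Set (GpLocal L H v))) := fun _ _ => borel _
      letI : MeasurableSpace (GpInf L H) := borel _
      haveI : BorelSpace (GpInf L H) := ⟨rfl⟩
      letI : MeasurableSpace (GInf L) := borel _
      haveI : BorelSpace (GInf L) := ⟨rfl⟩
      letI : MeasurableSpace (HInf L) := borel _
      haveI : BorelSpace (HInf L) := ⟨rfl⟩
      haveI : ∀ v : Places L, (νH v).IsHaarMeasure := isHaar_νH
      haveI : ∀ v : Places L, (νH v).IsMulRightInvariant := isRightInv_νH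
      haveI : ∀ v : Places L, (νG v).IsHaarMeasure := isHaar_νG
      haveI : ∀ v : Places L, (νG v).IsMulRightInvariant := isRightInv_νG
      haveI : IsFiniteMeasureOnCompacts νGi := finCpt_νGi
      haveI : νGi.IsMulRightInvariant := rightInv_νGi
      haveI : IsFiniteMeasureOnCompacts νqi := finCpt_νqi
      haveI : νqi.IsMulRightInvariant := rightInv_νqi
      haveI : IsFiniteMeasureOnCompacts νHi := finCpt_νHi
      haveI : νHi.IsMulRightInvariant := rightInv_νHi
      (∀ v : Places L, (mH v).IsCanonical (IsLocalGRegular L v) (νH v) ∧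
          (mG v).IsCanonical (fun γ => IsRegularElt (γ.val : GL (Fin 3) (UnitaryGroup.LocalRing L v))) (νG v)) →
      ∀ (𝔨 : ComparisonKit L H μ) (hpin : 𝔨.IsPinned ν (archCanonicalTransferFactor L H μω) νH νG νGi νqi νHi), 𝔨.TransferExistence → 𝔨.SimpleTraceFormula → 𝔨.Δ = (finExplicitCollection L H μω (finExplicitDelta_conj_left_all L H μω) (finExplicitDelta_conj_right_all L H μω)) → 𝔨.mH = mH →
        (∀ (v : Places L) (c' : ConjClasses ((cmDatum L 3 H).Local v)),
          Literature.NumberTheory.Rogawski1990.IsRegularElt ((Quotient.out c').val : GL (Fin 3) (UnitaryGroup.LocalRing L v)) → 𝔨.mG v c' = mG v c') →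
        ∀ (hQ : CMCharIdentityPackageTestSigned L H (transpose_map_cmConjRingHom_eq_of_frame L ι H T hT) (isUnit_det_of_frame L ι H T hT) νH νG μω hμu (finExplicitCollection L H μω (finExplicitDelta_conj_left_all L H μω) (finExplicitDelta_conj_right_all L H μω)) mH mG),
          -- SEAM 1′ (typ2): the pay line keys `ν` on `(Gp L H).Adelic` (= `adelicGroupData …`), the carpet on `GpAdelic L H` (= `cmDatum …`) — equal carriers; the Gp-keyed σ-algebra is the SAME literal `borel (GpAdelic L H)` that `ν` carries (instance unification is reducible-only)
          letI : MeasurableSpace (Gp L H).Adelic := borel (GpAdelic L H)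
          haveI : BorelSpace (Gp L H).Adelic := ⟨rfl⟩
          haveI : Measure.IsHaarMeasure (G := (Gp L H).Adelic) ν := isHaar_ν
          ∀ (νinf : @Measure (GpInf L H) (borel _)) (hPH : F0P3LettersTraceFactorisation.IsProductHaar L H ν νinf νG),
          letI : ∀ v : Places L, MeasurableSpace (Gqs L v ⧸ Subgroup.center (Gqs L v)) := fun _ => borel _
          haveI : ∀ v : Places L, BorelSpace (Gqs L v ⧸ Subgroup.center (Gqs L v)) := fun _ => ⟨rfl⟩
          haveI : ∀ v : Places L, (μZ v).IsHaarMeasure := isHaar_μZ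
          letI : ∀ v : Places L, MeasurableSpace ((cmDatum L 3 (splitForm L 3)).Local v) := fun _ => borel _
          let keys := F0P3XiPacketFamilyOfRecord.keysOfKeysCaseTwo L μω (F0P3KeysCaseTwoOfStubs.keysCaseTwo_of_stubs L (F0P2oLocalLettersHold.keysCaseTwoReducible_holds L) (F0P3U3SquareIntegrableExponentsHolds.u3SquareIntegrableExponents_holds (L := L))) μZ hquad
          let Ξ₀ : OneDimAutRepH L → InnerFormSec146.PacketPrimeFin L H := xiPacketFamilyOfRecordSCD L H (transpose_map_cmConjRingHom_eq_of_frame L ι H T hT) (isUnit_det_of_frame L ι H T hT) μω hμu μZ keys (hSCD_of_cmCharIdentityPackageTestSigned L H (transpose_map_cmConjRingHom_eq_of_frame L ι H T hT) (isUnit_det_of_frame L ι H T hT) μω hμu (finExplicitCollection L H μω (finExplicitDelta_conj_left_all L H μω) (finExplicitDelta_conj_right_all L H μω)) mH mG νG νH μZ hQ)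
          let Smooth := (Smooth_cm L ι H T hT 𝔨.Smooth)
          let Transfer := (Transfer_cm L ι H T hT 𝔨.Transfer)
          let TransferH := (TransferH_cm L ι H T hT 𝔨.Smooth 𝔨.TransferH)
          let SθG : TestG L → ℂ := (fun f => 𝔨.SJGtot f)
          let SθH : TestH L → ℂ := (fun fH => 𝔨.SJHtot fH)
          let PSVanish := (PSVanish_cm L ι H T hT 𝔨.Smooth 𝔨.Transfer)
          let PSVanishH := (PSVanishH_cm L ι H T hT 𝔨.Smooth 𝔨.TransferH)
          let MatchH := (MatchH_cm L ι H T hT 𝔨.Smooth 𝔨.Transfer 𝔨.TransferH)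
          ∃ (μqs : Measure (adelicGroupData (↥(maximalRealSubfield L)) L (IsCMField.complexConj L) 3 (splitForm L 3)).automorphicQuotient) (iqs : (adelicGroupData (↥(maximalRealSubfield L)) L (IsCMField.complexConj L) 3 (splitForm L 3)).IsAutomorphicMeasure μqs)
            (μ₂ : Measure (adelicGroupData (↥(maximalRealSubfield L)) L (IsCMField.complexConj L) 2 (Φ L 2)).automorphicQuotient) (i₂ : (adelicGroupData (↥(maximalRealSubfield L)) L (IsCMField.complexConj L) 2 (Φ L 2)).IsAutomorphicMeasure μ₂)
            (μ₁ : Measure (adelicGroupData (↥(maximalRealSubfield L)) L (IsCMField.complexConj L) 1 (Φ L 1)).automorphicQuotient) (i₁ : (adelicGroupData (↥(maximalRealSubfield L)) L (IsCMField.complexConj L) 1 (Φ L 1)).IsAutomorphicMeasure μ₁)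
            (𝔩 : ∀ v : Places L, LocalPacketKit L (splitForm L 3) v) (𝔞 : ArchPacketKit) (𝔞H : ArchPacketKitH 𝔞)
            (archH : (∀ v : Places L, IrrClass ((cmDatum L 2 (Φ L 2)).Local v)) → (∀ v : Places L, ((cmDatum L 1 (Φ L 1)).Local v) →* ℂˣ) → 𝔞H.PktInfH)
            (ine : Nonempty 𝔞.PktInf),
          haveI : (adelicGroupData (↥(maximalRealSubfield L)) L (IsCMField.complexConj L) 3 (splitForm L 3)).IsAutomorphicMeasure μqs := iqs
          haveI : (adelicGroupData (↥(maximalRealSubfield L)) L (IsCMField.complexConj L) 2 (Φ L 2)).IsAutomorphicMeasure μ₂ := i₂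
          haveI : (adelicGroupData (↥(maximalRealSubfield L)) L (IsCMField.complexConj L) 1 (Φ L 1)).IsAutomorphicMeasure μ₁ := i₁
          haveI : Nonempty 𝔞.PktInf := ine
          ∃ (Pk : OneDimAutRepH L → ∀ v : Places L, CMLocalAPacket L (splitForm L 3) v)
            (pairSome : PacketHOfRecord 𝔩 𝔞 𝔞H μ₂ μ₁ archH → DiscreteClass (adelicGroupData (↥(maximalRealSubfield L)) L (IsCMField.complexConj L) 3 (splitForm L 3)) μqs → ℂ)
            (S₀ : Finset (Places L)) (νGψ : ∀ v : Places L, Measure ((cmDatum L 3 (splitForm L 3)).Local v))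
            (archTr : GKIrrClass (uFormGroup (Fin 2) (Fin 1)) → (UnitaryGroup.arch (↥(maximalRealSubfield L)) L (IsCMField.complexConj L) 3 (splitForm L 3) → ℂ) → ℂ)
            (trH : PacketHOfRecord 𝔩 𝔞 𝔞H μ₂ μ₁ archH → TestH L → ℂ)
            (IsOneDim : PacketGOfRecord 𝔩 𝔞 μqs Pk → Prop)
            (AllPkt : Type) (ofDisc : PacketGOfRecord 𝔩 𝔞 μqs Pk → AllPkt) (trAll : AllPkt → TestG L → ℂ) (IsL2At : PacketGOfRecord 𝔩 𝔞 μqs Pk → InnerFormSec146.Place L → Prop)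
            (trPPrime : InnerFormSec146.PacketPrime L H μ Ξ₀ → (GpInf L H → ℂ) × (∀ v : Places L, (cmDatum L 3 H).Local v → ℂ) → ℂ)
            (psi' : InnerFormSec146.PacketPrime L H μ Ξ₀ → AllPkt) (LiftL2At : PacketHOfRecord 𝔩 𝔞 𝔞H μ₂ μ₁ archH → InnerFormSec146.Place L → Prop)
            (PiRho' : (ρ : PacketHOfRecord 𝔩 𝔞 𝔞H μ₂ μ₁ archH) → (∀ p : InnerFormSec146.Place L, p ∈ InnerFormSec146.S0 L H → LiftL2At ρ p) → InnerFormSec146.PacketPrime L H μ Ξ₀)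
            (sgn' : Option (PacketHOfRecord 𝔩 𝔞 𝔞H μ₂ μ₁ archH) → InnerFormSec146.RepPrimeSph L ι H T hT μ → ℤ) (HasPinComponent : InnerFormSec146.RepPrimeSph L ι H T hT μ → Prop)
            (tw : ∀ l : InnerFormSec146.Level L, InnerFormSec146.HeckeOff L H l → (CompactlySupportedContinuousMap (cmDatum L 3 (Matrix.of fun i j : Fin 3 => if i.val + j.val + 1 = 3 then (1 : L) else 0)).Adelic ℂ) → (CompactlySupportedContinuousMap (cmDatum L 3 (Matrix.of fun i j : Fin 3 => if i.val + j.val + 1 = 3 then (1 : L) else 0)).Adelic ℂ))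
            (twH : ∀ l : InnerFormSec146.Level L, InnerFormSec146.HeckeOff L H l → (CompactlySupportedContinuousMap ((cmDatum L 2 (Matrix.of fun i j : Fin 2 => if i.val + j.val + 1 = 2 then (1 : L) else 0)).Adelic × (cmDatum L 1 (Matrix.of fun i j : Fin 1 => if i.val + j.val + 1 = 1 then (1 : L) else 0)).Adelic) ℂ) → (CompactlySupportedContinuousMap ((cmDatum L 2 (Matrix.of fun i j : Fin 2 => if i.val + j.val + 1 = 2 then (1 : L) else 0)).Adelic × (cmDatum L 1 (Matrix.of fun i j : Fin 1 => if i.val + j.val + 1 = 1 then (1 : L) else 0)).Adelic) ℂ))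
            (l₁ : InnerFormSec146.Level L),
            let X := X_cm L ι H T hT μ Ξ₀ 𝔩 (gOfRecord 𝔩 𝔞 𝔞H μqs μ₂ μ₁ archH Pk μω (J8.pairG_cm 𝔩 𝔞 𝔞H μqs μ₂ μ₁ archH Pk pairSome)) (fun Q => Q.1.fin) (fun f' => 𝔨.traceGp f') νinf νG (J8.trB 𝔩 𝔞 μqs Pk S₀ νGψ archTr) trH IsOneDim (fun ρ => R90.S5.IsOneDimH ρ) (fun ρ h => h.choose) AllPkt ofDisc trAll IsL2At trPPrime psi' (MnNeZeroCohTriv_cm L μω (gOfRecord 𝔩 𝔞 𝔞H μqs μ₂ μ₁ archH Pk μω (J8.pairG_cm 𝔩 𝔞 𝔞H μqs μ₂ μ₁ archH Pk pairSome)) (fun ρ => R90.S5.IsOneDimH ρ) (fun ρ h => h.choose) (fun _ _ => True)) LiftL2At PiRho' sgn' HasPinComponent;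
            ∃ (p : ∀ ξ : X.G.PacketH, X.IsOneDimH ξ → HeightOneSpectrum (𝓞 ↥(maximalRealSubfield L)) → Prop) (a₀ : ∀ ξ : X.G.PacketH, X.IsOneDimH ξ → GKIrrClass (uFormGroup (Fin 2) (Fin 1))) (a₂ : ∀ ξ : X.G.PacketH, X.IsOneDimH ξ → GKIrrClass (uFormGroup (Fin 2) (Fin 1))) (cpt : ∀ ξ : X.G.PacketH, X.IsOneDimH ξ → Prop),
            -- hT1e (J8-G «sock_S9_stableSpecG_trOn_cm» (+ (K-b‴)(e) «T1e-presentation» data `S₀ νGψ archTr`))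
            (∀ f : TestG L, PSVanish f → Summable (fun Q : PacketGOfRecord 𝔩 𝔞 μqs Pk => nGOfRecord 𝔩 𝔞 μqs μ₂ μ₁ Pk Q * trGOfRecord 𝔩 𝔞 μqs Pk S₀ νGψ archTr Q f)
              ∧ SθG f = ∑' Q : PacketGOfRecord 𝔩 𝔞 μqs Pk, nGOfRecord 𝔩 𝔞 μqs μ₂ μ₁ Pk Q * trGOfRecord 𝔩 𝔞 μqs Pk S₀ νGψ archTr Q f) ∧
            -- hMU (S9-MEMUNIQ «sock_S9_memUnique_cm»)
            (∀ (c : DiscreteClass (adelicGroupData (↥(maximalRealSubfield L)) L (IsCMField.complexConj L) 3 (splitForm L 3)) μqs) (Q Q' : PacketGOfRecord 𝔩 𝔞 μqs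
              Pk), MemOfRecord 𝔩 𝔞 μqs Pk c Q → MemOfRecord 𝔩 𝔞 μqs Pk c Q' → Q = Q') ∧
            -- hH61 (J8-H «sock_S9_stableSpecH_cm»)
            (X.G.StableDiscreteExpansionH X.trH SθH PSVanishH) ∧
            -- hTw (S9-J7 twist)
            (∀ (l : InnerFormSec146.Level L), l₁ ⊆ l → ∀ (h : InnerFormSec146.HeckeOff L H l) (f' : ((UnitaryGroup.arch (↥(maximalRealSubfield L)) L
              (IsCMField.complexConj L) 3 H → ℂ) × (∀ v : HeightOneSpectrum (𝓞 ↥(maximalRealSubfield L)), (cmDatum L 3 H).Local v → ℂ))) (f :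
              (CompactlySupportedContinuousMap (cmDatum L 3 (Matrix.of fun i j : Fin 3 => if i.val + j.val + 1 = 3 then (1 : L) else 0)).Adelic ℂ)),
              InnerFormSec146.IsLevelTest L ι H T hT l f' → (Smooth f' ∧ Transfer f' f) → (Smooth (InnerFormSec146.twistTest L H νG l h f') ∧ Transfer
              (InnerFormSec146.twistTest L H νG l h f') (tw l h f))) ∧
            -- hTHw (S9-J7 twist)
            (∀ (l : InnerFormSec146.Level L), l₁ ⊆ l → ∀ (h : InnerFormSec146.HeckeOff L H l) (f' : ((UnitaryGroup.arch (↥(maximalRealSubfield L)) L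
              (IsCMField.complexConj L) 3 H → ℂ) × (∀ v : HeightOneSpectrum (𝓞 ↥(maximalRealSubfield L)), (cmDatum L 3 H).Local v → ℂ))) (fH :
              (CompactlySupportedContinuousMap ((cmDatum L 2 (Matrix.of fun i j : Fin 2 => if i.val + j.val + 1 = 2 then (1 : L) else 0)).Adelic × (cmDatum L 1
              (Matrix.of fun i j : Fin 1 => if i.val + j.val + 1 = 1 then (1 : L) else 0)).Adelic) ℂ)), InnerFormSec146.IsLevelTest L ι H T hT l f' → TransferH f'
              fH → TransferH (InnerFormSec146.twistTest L H νG l h f') (twH l h fH)) ∧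
            -- hEP (S9-J7 twist)
            (∀ (l : InnerFormSec146.Level L), l₁ ⊆ l → ∀ (h : InnerFormSec146.HeckeOff L H l) (f' : ((UnitaryGroup.arch (↥(maximalRealSubfield L)) L
              (IsCMField.complexConj L) 3 H → ℂ) × (∀ v : HeightOneSpectrum (𝓞 ↥(maximalRealSubfield L)), (cmDatum L 3 H).Local v → ℂ))) (f :
              (CompactlySupportedContinuousMap (cmDatum L 3 (Matrix.of fun i j : Fin 3 => if i.val + j.val + 1 = 3 then (1 : L) else 0)).Adelic ℂ)),
              InnerFormSec146.IsLevelTest L ι H T hT l f' → (Smooth f' ∧ Transfer f' f) → ∀ P : X.G.Packet, X.G.packetTrace X.tr P (tw l h f) =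
              ((InnerFormSec146.gradePacket _ _ _ L ι H T hT μ νG Ξ₀ 𝔩 X l P).elim 0 fun e => InnerFormSec146.evOff L H νG l e h) * X.G.packetTrace X.tr P f) ∧
            -- hEH (S9-J7 twist)
            (∀ (l : InnerFormSec146.Level L), l₁ ⊆ l → ∀ (h : InnerFormSec146.HeckeOff L H l) (f' : ((UnitaryGroup.arch (↥(maximalRealSubfield L)) L
              (IsCMField.complexConj L) 3 H → ℂ) × (∀ v : HeightOneSpectrum (𝓞 ↥(maximalRealSubfield L)), (cmDatum L 3 H).Local v → ℂ))) (fH :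
              (CompactlySupportedContinuousMap ((cmDatum L 2 (Matrix.of fun i j : Fin 2 => if i.val + j.val + 1 = 2 then (1 : L) else 0)).Adelic × (cmDatum L 1
              (Matrix.of fun i j : Fin 1 => if i.val + j.val + 1 = 1 then (1 : L) else 0)).Adelic) ℂ)), InnerFormSec146.IsLevelTest L ι H T hT l f' → TransferH f'
              fH → ∀ ρ : X.G.PacketH, X.trH ρ (twH l h fH) = ((InnerFormSec146.gradePacketH _ _ _ L ι H T hT μ νG Ξ₀ 𝔩 X l ρ).elim 0 fun e => InnerFormSec146.evOff
              L H νG l e h) * X.trH ρ fH) ∧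
            -- hrigG (S9-PKTRIG (row 29 `htP` via ★ p03))
            (∀ P Q : X.G.Packet, (∀ᶠ v : HeightOneSpectrum (𝓞 ↥(maximalRealSubfield L)) in Filter.cofinite, ∃ (huP : (𝔩 v).unr ((X.finOfG P).loc v)) (huQ : (𝔩
              v).unr ((X.finOfG Q).loc v)), (𝔩 v).sph ((X.finOfG P).loc v) huP = (𝔩 v).sph ((X.finOfG Q).loc v) huQ) → P = Q) ∧
            -- hcore (S9-EVPRIG «sock_S9_evpRigidityCore_cm»)
            (∀ (l : InnerFormSec146.Level L) (π' : InnerFormSec146.RepPrimeSph L ι H T hT μ) (P : X.G.Packet) (e : InnerFormSec146.Evp L H),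
              InnerFormSec146.gradePacket _ _ _ L ι H T hT μ νG Ξ₀ 𝔩 X l P = some e → (InnerFormSec146.gammaSph _ _ _ L ι H T hT μ Ξ₀ 𝔩 X).evpRep π' P → (∀ v, v ∉ l
              → ((InnerFormSec146.tupleOf L ι H T hT μ π').2 v).IsSpherical (cmLocalIntegralLevel L 3 H v)) → ∀ v, v ∉ l → InnerFormSec146.TransportsToSphAt L H 𝔩 v
              ((InnerFormSec146.tupleOf L ι H T hT μ π').2 v) ((X.finOfG P).loc v)) ∧
            -- hL1 (S5 «sock_S9_lifts1_cm»)
            (∀ (Q : PacketGOfRecord 𝔩 𝔞 μqs Pk) (ρ ρ' : PacketHOfRecord 𝔩 𝔞 𝔞H μ₂ μ₁ archH), IsAPacketOfRecord 𝔩 𝔞 𝔞H μqs μ₂ μ₁ archH Pk Q → LiftsToOfRecord 𝔩 𝔞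
              𝔞H μqs μ₂ μ₁ archH Pk ρ Q → LiftsToOfRecord 𝔩 𝔞 𝔞H μqs μ₂ μ₁ archH Pk ρ' Q → ρ = ρ') ∧
            -- hvan144G (J6 «sock_S9_hvan144G_cm»)
            (∀ (P : X.G.Packet) (ξ : X.G.PacketH) (v : InnerFormSec146.Place L), v ∈ InnerFormSec146.S0 L H → X.IsOneDimH ξ → X.G.liftsTo ξ P → ¬ X.MnNeZero ξ v →
              ∀ (f' : ((UnitaryGroup.arch (↥(maximalRealSubfield L)) L (IsCMField.complexConj L) 3 H → ℂ) × (∀ v : HeightOneSpectrum (𝓞 ↥(maximalRealSubfield L)),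
              (cmDatum L 3 H).Local v → ℂ))) (f : (CompactlySupportedContinuousMap (cmDatum L 3 (Matrix.of fun i j : Fin 3 => if i.val + j.val + 1 = 3 then (1 : L)
              else 0)).Adelic ℂ)), (ArchTestKc L ι H T hT f'.1 ∧ (∀ v, IsLocallyConstant (f'.2 v) ∧ HasCompactSupport (f'.2 v)) ∧ {v | f'.2 v ≠
              (cmLocalIntegralLevel L 3 H v : Set ((cmDatum L 3 H).Local v)).indicator fun _ => (1 : ℂ)}.Finite) → (Smooth f' ∧ Transfer f' f) → X.G.packetTrace
              X.tr P f = 0) ∧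
            -- hvan144H (J6 «sock_S9_hvan144H_cm»)
            (∀ (ξ : X.G.PacketH) (v : InnerFormSec146.Place L), v ∈ InnerFormSec146.S0 L H → X.IsOneDimH ξ → ¬ X.MnNeZero ξ v → ∀ (f' : ((UnitaryGroup.arch
              (↥(maximalRealSubfield L)) L (IsCMField.complexConj L) 3 H → ℂ) × (∀ v : HeightOneSpectrum (𝓞 ↥(maximalRealSubfield L)), (cmDatum L 3 H).Local v →
              ℂ))) (fH : (CompactlySupportedContinuousMap ((cmDatum L 2 (Matrix.of fun i j : Fin 2 => if i.val + j.val + 1 = 2 then (1 : L) else 0)).Adelic ×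
              (cmDatum L 1 (Matrix.of fun i j : Fin 1 => if i.val + j.val + 1 = 1 then (1 : L) else 0)).Adelic) ℂ)), (ArchTestKc L ι H T hT f'.1 ∧ (∀ v,
              IsLocallyConstant (f'.2 v) ∧ HasCompactSupport (f'.2 v)) ∧ {v | f'.2 v ≠ (cmLocalIntegralLevel L 3 H v : Set ((cmDatum L 3 H).Local v)).indicator fun
              _ => (1 : ℂ)}.Finite) → TransferH f' fH → X.trH ξ fH = 0) ∧
            -- hp (A2 group: place predicate)
            (∀ (ξ : X.G.PacketH) (h₁ : X.IsOneDimH ξ) (v : HeightOneSpectrum (𝓞 ↥(maximalRealSubfield L))), p ξ h₁ v → ∀ w : PlacesOver L v, IsCMField.complexConj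
              L • w.1 = w.1) ∧
            -- ha₀ (A2 «two-member arch» group (LAST group; JQ-S7-13))
            (∀ (ξ : X.G.PacketH) (h₁ : X.IsOneDimH ξ), ∃ r : GKIrrep (uFormGroup (Fin 2) (Fin 1)), GKIrrClass.mk r = a₀ ξ h₁ ∧ IsAdmissibleGK r.ρK ∧
              r.IsInfUnitaryAlongP) ∧
            -- ha₂ (A2 «two-member arch» group (LAST group; JQ-S7-13))
            (∀ (ξ : X.G.PacketH) (h₁ : X.IsOneDimH ξ), ∃ r : GKIrrep (uFormGroup (Fin 2) (Fin 1)), GKIrrClass.mk r = a₂ ξ h₁ ∧ IsAdmissibleGK r.ρK ∧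
              r.IsInfUnitaryAlongP) ∧
            -- hane (A2 «two-member arch» group (LAST group; JQ-S7-13))
            (∀ (ξ : X.G.PacketH) (h₁ : X.IsOneDimH ξ), a₂ ξ h₁ ≠ a₀ ξ h₁) ∧
            -- hR₁ (A2 «two-member arch» group (LAST group; JQ-S7-13))
            (∀ (P : X.G.Packet) (ξ : X.G.PacketH) (h₁ : X.IsOneDimH ξ), X.G.IsAPacket P → X.G.liftsTo ξ P → cpt ξ h₁ → ∀ φf (f : (CompactlySupportedContinuousMap
              (cmDatum L 3 (Matrix.of fun i j : Fin 3 => if i.val + j.val + 1 = 3 then (1 : L) else 0)).Adelic ℂ)), (ArchTestKc L ι H T hT φf.1 ∧ (∀ v,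
              IsLocallyConstant (φf.2 v) ∧ HasCompactSupport (φf.2 v)) ∧ {v | φf.2 v ≠ (cmLocalIntegralLevel L 3 H v : Set ((cmDatum L 3 H).Local v)).indicator fun
              _ => (1 : ℂ)}.Finite) → (Smooth φf ∧ Transfer φf f) → X.G.packetTrace X.tr P f = (-1) ^ (InnerFormSec146.gammaSph _ (CompactlySupportedContinuousMap
              (cmDatum L 3 (Matrix.of fun i j : Fin 3 => if i.val + j.val + 1 = 3 then (1 : L) else 0)).Adelic ℂ) (CompactlySupportedContinuousMap ((cmDatum L 2
              (Matrix.of fun i j : Fin 2 => if i.val + j.val + 1 = 2 then (1 : L) else 0)).Adelic × (cmDatum L 1 (Matrix.of fun i j : Fin 1 => if i.val + j.val + 1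
              = 1 then (1 : L) else 0)).Adelic) ℂ) L ι H T hT μ Ξ₀ 𝔩 X).N * ((archTr₀ L ι H T hT νinf (a₀ ξ h₁) φf.1 - archTr₀ L ι H T hT νinf (a₂ ξ h₁) φf.1) * ∏ v
              ∈ (xiTruncOfRecordSCD L H (transpose_map_cmConjRingHom_eq_of_frame L ι H T hT) (isUnit_det_of_frame L ι H T hT) μω hμu μZ keys
              (hSCD_of_cmCharIdentityPackageTestSigned L H (transpose_map_cmConjRingHom_eq_of_frame L ι H T hT) (isUnit_det_of_frame L ι H T hT) μω hμu
              (finExplicitCollection L H μω (finExplicitDelta_conj_left_all L H μω) (finExplicitDelta_conj_right_all L H μω)) mH mG νG νH μZ hQ) νG (X.oneDimOf ξ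
              h₁) φf.2) with ¬ p ξ h₁ v, (letI : MeasurableSpace ((cmDatum L 3 H).Local v) := borel _; ((Ξ₀ (X.oneDimOf ξ h₁) v).πn).smoothTrace (νG v) (φf.2 v))) *
              ∏ i ∈ (xiTruncOfRecordSCD L H (transpose_map_cmConjRingHom_eq_of_frame L ι H T hT) (isUnit_det_of_frame L ι H T hT) μω hμu μZ keys
              (hSCD_of_cmCharIdentityPackageTestSigned L H (transpose_map_cmConjRingHom_eq_of_frame L ι H T hT) (isUnit_det_of_frame L ι H T hT) μω hμu
              (finExplicitCollection L H μω (finExplicitDelta_conj_left_all L H μω) (finExplicitDelta_conj_right_all L H μω)) mH mG νG νH μZ hQ) νG (X.oneDimOf ξ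
              h₁) φf.2).subtype (p ξ h₁), (letI : MeasurableSpace ((cmDatum L 3 H).Local i) := borel _; (((Ξ₀ (X.oneDimOf ξ h₁) (i : _)).πn).smoothTrace (νG i)
              (φf.2 i) - ((Ξ₀ (X.oneDimOf ξ h₁) (i : _)).πs.getD (Ξ₀ (X.oneDimOf ξ h₁) (i : _)).πn).smoothTrace (νG i) (φf.2 i)))) ∧
            -- hR₂ (A2 «two-member arch» group (LAST group; JQ-S7-13))
            (∀ (ξ : X.G.PacketH) (h₁ : X.IsOneDimH ξ), cpt ξ h₁ → ∀ φf (fH : (CompactlySupportedContinuousMap ((cmDatum L 2 (Matrix.of fun i j : Fin 2 => if i.val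
              + j.val + 1 = 2 then (1 : L) else 0)).Adelic × (cmDatum L 1 (Matrix.of fun i j : Fin 1 => if i.val + j.val + 1 = 1 then (1 : L) else 0)).Adelic) ℂ)),
              (ArchTestKc L ι H T hT φf.1 ∧ (∀ v, IsLocallyConstant (φf.2 v) ∧ HasCompactSupport (φf.2 v)) ∧ {v | φf.2 v ≠ (cmLocalIntegralLevel L 3 H v : Set
              ((cmDatum L 3 H).Local v)).indicator fun _ => (1 : ℂ)}.Finite) → TransferH φf fH → X.trH ξ fH = (-1) ^ (InnerFormSec146.gammaSph _
              (CompactlySupportedContinuousMap (cmDatum L 3 (Matrix.of fun i j : Fin 3 => if i.val + j.val + 1 = 3 then (1 : L) else 0)).Adelic ℂ)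
              (CompactlySupportedContinuousMap ((cmDatum L 2 (Matrix.of fun i j : Fin 2 => if i.val + j.val + 1 = 2 then (1 : L) else 0)).Adelic × (cmDatum L 1
              (Matrix.of fun i j : Fin 1 => if i.val + j.val + 1 = 1 then (1 : L) else 0)).Adelic) ℂ) L ι H T hT μ Ξ₀ 𝔩 X).N * (InnerFormSec146.gammaSph _
              (CompactlySupportedContinuousMap (cmDatum L 3 (Matrix.of fun i j : Fin 3 => if i.val + j.val + 1 = 3 then (1 : L) else 0)).Adelic ℂ)
              (CompactlySupportedContinuousMap ((cmDatum L 2 (Matrix.of fun i j : Fin 2 => if i.val + j.val + 1 = 2 then (1 : L) else 0)).Adelic × (cmDatum L 1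
              (Matrix.of fun i j : Fin 1 => if i.val + j.val + 1 = 1 then (1 : L) else 0)).Adelic) ℂ) L ι H T hT μ Ξ₀ 𝔩 X).c * ((archTr₀ L ι H T hT νinf (a₀ ξ h₁)
              φf.1 + archTr₀ L ι H T hT νinf (a₂ ξ h₁) φf.1) * ∏ v ∈ (xiTruncOfRecordSCD L H (transpose_map_cmConjRingHom_eq_of_frame L ι H T hT)
              (isUnit_det_of_frame L ι H T hT) μω hμu μZ keys (hSCD_of_cmCharIdentityPackageTestSigned L H (transpose_map_cmConjRingHom_eq_of_frame L ι H T hT)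
              (isUnit_det_of_frame L ι H T hT) μω hμu (finExplicitCollection L H μω (finExplicitDelta_conj_left_all L H μω) (finExplicitDelta_conj_right_all L H
              μω)) mH mG νG νH μZ hQ) νG (X.oneDimOf ξ h₁) φf.2) with ¬ p ξ h₁ v, (letI : MeasurableSpace ((cmDatum L 3 H).Local v) := borel _; ((Ξ₀ (X.oneDimOf ξ
              h₁) v).πn).smoothTrace (νG v) (φf.2 v))) * ∏ i ∈ (xiTruncOfRecordSCD L H (transpose_map_cmConjRingHom_eq_of_frame L ι H T hT) (isUnit_det_of_frame L ι
              H T hT) μω hμu μZ keys (hSCD_of_cmCharIdentityPackageTestSigned L H (transpose_map_cmConjRingHom_eq_of_frame L ι H T hT) (isUnit_det_of_frame L ι H T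
              hT) μω hμu (finExplicitCollection L H μω (finExplicitDelta_conj_left_all L H μω) (finExplicitDelta_conj_right_all L H μω)) mH mG νG νH μZ hQ) νG
              (X.oneDimOf ξ h₁) φf.2).subtype (p ξ h₁), (letI : MeasurableSpace ((cmDatum L 3 H).Local i) := borel _; (((Ξ₀ (X.oneDimOf ξ h₁) (i :
              _)).πn).smoothTrace (νG i) (φf.2 i) + ((Ξ₀ (X.oneDimOf ξ h₁) (i : _)).πs.getD (Ξ₀ (X.oneDimOf ξ h₁) (i : _)).πn).smoothTrace (νG i) (φf.2 i)))) ∧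
            -- hR₀G (A2 «two-member arch» group (LAST group; JQ-S7-13))
            (∀ (P : X.G.Packet) (ξ : X.G.PacketH) (h₁ : X.IsOneDimH ξ), X.G.IsAPacket P → X.G.liftsTo ξ P → ¬ cpt ξ h₁ → ∀ φf (f :
              (CompactlySupportedContinuousMap (cmDatum L 3 (Matrix.of fun i j : Fin 3 => if i.val + j.val + 1 = 3 then (1 : L) else 0)).Adelic ℂ)), (ArchTestKc L ι
              H T hT φf.1 ∧ (∀ v, IsLocallyConstant (φf.2 v) ∧ HasCompactSupport (φf.2 v)) ∧ {v | φf.2 v ≠ (cmLocalIntegralLevel L 3 H v : Set ((cmDatum L 3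
              H).Local v)).indicator fun _ => (1 : ℂ)}.Finite) → (Smooth φf ∧ Transfer φf f) → X.G.packetTrace X.tr P f = 0) ∧
            -- hR₀H (A2 «two-member arch» group (LAST group; JQ-S7-13))
            (∀ (ξ : X.G.PacketH) (h₁ : X.IsOneDimH ξ), ¬ cpt ξ h₁ → ∀ φf (fH : (CompactlySupportedContinuousMap ((cmDatum L 2 (Matrix.of fun i j : Fin 2 => if
              i.val + j.val + 1 = 2 then (1 : L) else 0)).Adelic × (cmDatum L 1 (Matrix.of fun i j : Fin 1 => if i.val + j.val + 1 = 1 then (1 : L) else 0)).Adelic)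
              ℂ)), (ArchTestKc L ι H T hT φf.1 ∧ (∀ v, IsLocallyConstant (φf.2 v) ∧ HasCompactSupport (φf.2 v)) ∧ {v | φf.2 v ≠ (cmLocalIntegralLevel L 3 H v : Set
              ((cmDatum L 3 H).Local v)).indicator fun _ => (1 : ℂ)}.Finite) → TransferH φf fH → X.trH ξ fH = 0) ∧
            -- hxiR (J9 + S5: rows 35 + D4∕D5 per ξ)
            (∀ ξ' : OneDimAutRepH L, ∃ (ρ : X.G.PacketH) (h₁ : X.IsOneDimH ρ), X.oneDimOf ρ h₁ = ξ' ∧ ∃ Pξ : X.G.Packet, X.G.IsAPacket Pξ ∧ X.G.liftsTo ρ Pξ ∧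
              InnerFormSec146.evp L H μ Ξ₀ 𝔩 (InnerFormSec146.piXiPrime L H μ Ξ₀ ξ') (X.finOfG Pξ))

/-- socket stub — the ∃-producer of the qs-side record datum with its laws; assembler S5 with S2∕S3∕S4∕S8∕S9 conjunct payers (table in the def's docstring). -/
theorem sock_S9_recordDatumLaws_cm : SocketRecordDatumLawsCm := by
  sorry

/-! ### §4 HEAD -/

open scoped Classical in
set_option synthInstance.maxHeartbeats 400000 in
set_option maxHeartbeats 16000000 in
/-- **HEAD (B ED. 4) `sock_S9_definiteAeRigidityFramedKit : SocketDefiniteAeRigidityFramedKit`** — PAID (0 sorry in this proof) by the ★ PAY LINE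
`definiteAeRigidity_payLine_stableA2'` (★ p864612 PAY⁵ (stableA2′: A2 arch group + F-LEV-1 guard)) at `X := X_cm …` (★ p862941) over the in-file terms (rows 14, 21, 27, 28′, 30, `hG`, `hlifts1`∕`hn`, `hanis`, `νinf`∕`hPH`, S5-C2 by name, ★ 7b∕7c)
and the ∃-producer `sock_S9_recordDatumLaws_cm` (20 named groups + the Ξ-reader `hxiR`); explicit tail in the pay line's binder order.  HONEST LABEL: this head moves
the organ's `sorry` into the 5 named junction sockets of §2 (+ the untouched ED. 3 print shell): B's sorries go UP from 1 to 6 before they go down; HC_CM is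
proved only modulo the 7 printed citations (2 remaining named inputs: hLiu418 = stmt-HodgeConjecture-24832, h413 = stmt-HodgeConjecture-24833) until rung 0 closes. -/
theorem sock_S9_definiteAeRigidityFramedKit : SocketDefiniteAeRigidityFramedKit := by
  intro L _ _ _ ι H T hT hdef h2 μ _ μω hμu hμω ν νH νG νGi νqi νHi μZ isHaar_ν isInvInv_ν isHaar_νH isRightInv_νH isHaar_νG isRightInv_νG finCpt_νGi rightInv_νGi finCpt_νqi rightInv_νqi finCpt_νHi rightInv_νHi isHaar_μZ hquad hvol hvolH mH mG hcan 𝔨 hpin htE hstf hΔk hmH hmG hQ hex7 ξ P hsph hAE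
  -- SEAM 1 + the instance carpet of the telescope, re-pinned in the local context
  haveI : (cmDatum L 3 H).IsAutomorphicMeasure μ := ‹(Gp L H).IsAutomorphicMeasure μ›
  letI : MeasurableSpace (GpAdelic L H) := borel _
  haveI : BorelSpace (GpAdelic L H) := ⟨rfl⟩
  haveI : ν.IsHaarMeasure := isHaar_ν
  haveI : ν.IsInvInvariant := isInvInv_ν
  letI : ∀ v : Places L, MeasurableSpace (GpLocal L H v) := fun _ => borel _
  haveI : ∀ v : Places L, BorelSpace (GpLocal L H v) := fun _ => ⟨rfl⟩
  letI : ∀ v : Places L, MeasurableSpace (HLocal L v) := fun _ => borel _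
  haveI : ∀ v : Places L, BorelSpace (HLocal L v) := fun _ => ⟨rfl⟩
  letI : ∀ (v : Places L) (a : HLocal L v), MeasurableSpace (HLocal L v ⧸ Subgroup.centralizer ({a} : Set (HLocal L v))) := fun _ _ => borel _
  letI : ∀ (v : Places L) (γ : GpLocal L H v), MeasurableSpace (GpLocal L H v ⧸ Subgroup.centralizer ({γ} : Set (GpLocal L H v))) := fun _ _ => borel _
  haveI : ∀ (v : Places L) (a : HLocal L v), BorelSpace (HLocal L v ⧸ Subgroup.centralizer ({a} : Set (HLocal L v))) := fun _ _ => ⟨rfl⟩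
  haveI : ∀ (v : Places L) (γ : GpLocal L H v), BorelSpace (GpLocal L H v ⧸ Subgroup.centralizer ({γ} : Set (GpLocal L H v))) := fun _ _ => ⟨rfl⟩
  letI : MeasurableSpace (GpInf L H) := borel _
  haveI : BorelSpace (GpInf L H) := ⟨rfl⟩
  letI : MeasurableSpace (GInf L) := borel _
  haveI : BorelSpace (GInf L) := ⟨rfl⟩
  letI : MeasurableSpace (HInf L) := borel _
  haveI : BorelSpace (HInf L) := ⟨rfl⟩
  haveI : ∀ v : Places L, (νH v).IsHaarMeasure := isHaar_νH
  haveI : ∀ v : Places L, (νH v).IsMulRightInvariant := isRightInv_νH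
  haveI : ∀ v : Places L, (νG v).IsHaarMeasure := isHaar_νG
  haveI : ∀ v : Places L, (νG v).IsMulRightInvariant := isRightInv_νG
  haveI : IsFiniteMeasureOnCompacts νGi := finCpt_νGi
  haveI : νGi.IsMulRightInvariant := rightInv_νGi
  haveI : IsFiniteMeasureOnCompacts νqi := finCpt_νqi
  haveI : νqi.IsMulRightInvariant := rightInv_νqi
  haveI : IsFiniteMeasureOnCompacts νHi := finCpt_νHi
  haveI : νHi.IsMulRightInvariant := rightInv_νHi
  letI : ∀ v : Places L, MeasurableSpace (Gqs L v ⧸ Subgroup.center (Gqs L v)) := fun _ => borel _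
  haveI : ∀ v : Places L, BorelSpace (Gqs L v ⧸ Subgroup.center (Gqs L v)) := fun _ => ⟨rfl⟩
  haveI : ∀ v : Places L, (μZ v).IsHaarMeasure := isHaar_μZ
  letI : ∀ v : Places L, MeasurableSpace ((cmDatum L 3 (splitForm L 3)).Local v) := fun _ => borel _
  -- SEAM 1′: Gp-keyed adelic instances for the pay line's `ν`-binders, valued at the literal `borel (GpAdelic L H)` carried by `ν` (reducible instance unification)
  letI : MeasurableSpace (Gp L H).Adelic := borel (GpAdelic L H)
  haveI : BorelSpace (Gp L H).Adelic := ⟨rfl⟩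
  haveI : Measure.IsHaarMeasure (G := (Gp L H).Adelic) ν := isHaar_ν
  -- `hanis`: `H` is definite at some `τ ≠ ι` (`hdef`, `2 ≤ [L⁺:ℚ]`), hence anisotropic over `L` (Landherr; ED. 3 `anisotropic_of_exists_posDef`) — S9-typ1's A ED. 4 bytes
  have h4 : 4 ≤ Module.finrank ℚ L := by
    have hm := Module.finrank_mul_finrank ℚ ↥(maximalRealSubfield L) L
    rw [Algebra.IsQuadraticExtension.finrank_eq_two ↥(maximalRealSubfield L) L] at hm
    omega
  obtain ⟨τ, hτ⟩ := exists_infinitePlace_ne L h4 ι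
  have hS₀ : ∃ τ : L →+* ℂ, (H.map τ).PosDef ∨ (-(H.map τ)).PosDef := ⟨τ, Or.inl (hdef τ hτ)⟩
  have hanis := anisotropic_of_exists_posDef L H hS₀
  -- S9-R-PH (α): the archimedean Haar measure making `ν` the product Haar (★ p862958)
  obtain ⟨νinf, hνinf, hPH⟩ := exists_archHaar_isProductHaar_and L H ν isHaar_ν νG isHaar_νG hvol
  haveI : νinf.IsHaarMeasure := hνinf
  -- RULING (K-b″): the qs-side record datum and its laws, ∃-produced ONCE
  obtain ⟨μqs, iqs, μ₂, i₂, μ₁, i₁, 𝔩, 𝔞, 𝔞H, archH, ine, Pk, pairSome, S₀, νGψ, archTr, trH, IsOneDim, AllPkt, ofDisc, trAll, IsL2At, trPPrime, psi', LiftL2At, PiRho', sgn', HasPinComponent, tw, twH, l₁, p, a₀, a₂, cpt, hT1e, hMU, hH61, hTw, hTHw, hEP, hEH, hrigG, hcore, hL1, hvan144G, hvan144H, hp, ha₀, ha₂, hane, hR₁, hR₂, hR₀G, hR₀H, hxiR⟩ :=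
    sock_S9_recordDatumLaws_cm L ι H T hT hdef h2 μ μω hμu hμω ν νH νG νGi νqi νHi μZ isHaar_ν isInvInv_ν isHaar_νH isRightInv_νH isHaar_νG isRightInv_νG finCpt_νGi rightInv_νGi finCpt_νqi rightInv_νqi finCpt_νHi rightInv_νHi isHaar_μZ hquad hvol hvolH mH mG hcan 𝔨 hpin htE hstf hΔk hmH hmG hQ νinf hPH
  haveI := iqs
  haveI := i₂
  haveI := i₁
  haveI := ine
  -- J9 + rows 35 ∕ D4 ∕ D5 at print's `ξ`
  obtain ⟨ρ, h₁, hone, Pξ, hA, hl, hevpXi⟩ := hxiR ξ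
  exact definiteAeRigidity_payLine_stableA2' L H (transpose_map_cmConjRingHom_eq_of_frame L ι H T hT) (isUnit_det_of_frame L ι H T hT) (finExplicitCollection L H μω
      (finExplicitDelta_conj_left_all L H μω) (finExplicitDelta_conj_right_all L H μω)) mH mG νG νH hanis μω hμu hμω hQ ι T hT ξ μ P hsph hAE μZ
      (F0P3XiPacketFamilyOfRecord.keysOfKeysCaseTwo L μω (F0P3KeysCaseTwoOfStubs.keysCaseTwo_of_stubs L (F0P2oLocalLettersHold.keysCaseTwoReducible_holds L)
      (F0P3U3SquareIntegrableExponentsHolds.u3SquareIntegrableExponents_holds (L := L))) μZ hquad) 𝔩 νG ν νinf h2 hPH (X_cm L ι H T hT μ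
      (xiPacketFamilyOfRecordSCD L H (transpose_map_cmConjRingHom_eq_of_frame L ι H T hT) (isUnit_det_of_frame L ι H T hT) μω hμu μZ
      (F0P3XiPacketFamilyOfRecord.keysOfKeysCaseTwo L μω (F0P3KeysCaseTwoOfStubs.keysCaseTwo_of_stubs L (F0P2oLocalLettersHold.keysCaseTwoReducible_holds L)
      (F0P3U3SquareIntegrableExponentsHolds.u3SquareIntegrableExponents_holds (L := L))) μZ hquad) (hSCD_of_cmCharIdentityPackageTestSigned L H
      (transpose_map_cmConjRingHom_eq_of_frame L ι H T hT) (isUnit_det_of_frame L ι H T hT) μω hμu (finExplicitCollection L H μω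
      (finExplicitDelta_conj_left_all L H μω) (finExplicitDelta_conj_right_all L H μω)) mH mG νG νH μZ hQ)) 𝔩 (gOfRecord 𝔩 𝔞 𝔞H μqs μ₂ μ₁ archH Pk μω
      (J8.pairG_cm 𝔩 𝔞 𝔞H μqs μ₂ μ₁ archH Pk pairSome)) (fun Q => Q.1.fin) (fun f' => 𝔨.traceGp f') νinf νG (J8.trB 𝔩 𝔞 μqs Pk S₀ νGψ archTr) trH IsOneDim
      (fun ρ => R90.S5.IsOneDimH ρ) (fun ρ h => h.choose) AllPkt ofDisc trAll IsL2At trPPrime psi' (MnNeZeroCohTriv_cm L μω (gOfRecord 𝔩 𝔞 𝔞H μqs μ₂ μ₁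
      archH Pk μω (J8.pairG_cm 𝔩 𝔞 𝔞H μqs μ₂ μ₁ archH Pk pairSome)) (fun ρ => R90.S5.IsOneDimH ρ) (fun ρ h => h.choose) (fun _ _ => True)) LiftL2At PiRho'
      sgn' HasPinComponent) (htrX_cm L ι H T hT μ (xiPacketFamilyOfRecordSCD L H (transpose_map_cmConjRingHom_eq_of_frame L ι H T hT) (isUnit_det_of_frame L
      ι H T hT) μω hμu μZ (F0P3XiPacketFamilyOfRecord.keysOfKeysCaseTwo L μω (F0P3KeysCaseTwoOfStubs.keysCaseTwo_of_stubs L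
      (F0P2oLocalLettersHold.keysCaseTwoReducible_holds L) (F0P3U3SquareIntegrableExponentsHolds.u3SquareIntegrableExponents_holds (L := L))) μZ hquad)
      (hSCD_of_cmCharIdentityPackageTestSigned L H (transpose_map_cmConjRingHom_eq_of_frame L ι H T hT) (isUnit_det_of_frame L ι H T hT) μω hμu
      (finExplicitCollection L H μω (finExplicitDelta_conj_left_all L H μω) (finExplicitDelta_conj_right_all L H μω)) mH mG νG νH μZ hQ)) 𝔩 (gOfRecord 𝔩 𝔞
      𝔞H μqs μ₂ μ₁ archH Pk μω (J8.pairG_cm 𝔩 𝔞 𝔞H μqs μ₂ μ₁ archH Pk pairSome)) (fun Q => Q.1.fin) (fun f' => 𝔨.traceGp f') νinf νG (J8.trB 𝔩 𝔞 μqs Pk S₀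
      νGψ archTr) trH IsOneDim (fun ρ => R90.S5.IsOneDimH ρ) (fun ρ h => h.choose) AllPkt ofDisc trAll IsL2At trPPrime psi' (MnNeZeroCohTriv_cm L μω
      (gOfRecord 𝔩 𝔞 𝔞H μqs μ₂ μ₁ archH Pk μω (J8.pairG_cm 𝔩 𝔞 𝔞H μqs μ₂ μ₁ archH Pk pairSome)) (fun ρ => R90.S5.IsOneDimH ρ) (fun ρ h => h.choose) (fun _ _
      => True)) LiftL2At PiRho' sgn' HasPinComponent) (hspecAll_of_diagTrace_levels _ _ L ι H T hT μ (xiPacketFamilyOfRecordSCD L H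
      (transpose_map_cmConjRingHom_eq_of_frame L ι H T hT) (isUnit_det_of_frame L ι H T hT) μω hμu μZ (F0P3XiPacketFamilyOfRecord.keysOfKeysCaseTwo L μω
      (F0P3KeysCaseTwoOfStubs.keysCaseTwo_of_stubs L (F0P2oLocalLettersHold.keysCaseTwoReducible_holds L)
      (F0P3U3SquareIntegrableExponentsHolds.u3SquareIntegrableExponents_holds (L := L))) μZ hquad) (hSCD_of_cmCharIdentityPackageTestSigned L H
      (transpose_map_cmConjRingHom_eq_of_frame L ι H T hT) (isUnit_det_of_frame L ι H T hT) μω hμu (finExplicitCollection L H μω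
      (finExplicitDelta_conj_left_all L H μω) (finExplicitDelta_conj_right_all L H μω)) mH mG νG νH μZ hQ)) 𝔩 (X_cm L ι H T hT μ (xiPacketFamilyOfRecordSCD
      L H (transpose_map_cmConjRingHom_eq_of_frame L ι H T hT) (isUnit_det_of_frame L ι H T hT) μω hμu μZ (F0P3XiPacketFamilyOfRecord.keysOfKeysCaseTwo L μω
      (F0P3KeysCaseTwoOfStubs.keysCaseTwo_of_stubs L (F0P2oLocalLettersHold.keysCaseTwoReducible_holds L)
      (F0P3U3SquareIntegrableExponentsHolds.u3SquareIntegrableExponents_holds (L := L))) μZ hquad) (hSCD_of_cmCharIdentityPackageTestSigned L H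
      (transpose_map_cmConjRingHom_eq_of_frame L ι H T hT) (isUnit_det_of_frame L ι H T hT) μω hμu (finExplicitCollection L H μω
      (finExplicitDelta_conj_left_all L H μω) (finExplicitDelta_conj_right_all L H μω)) mH mG νG νH μZ hQ)) 𝔩 (gOfRecord 𝔩 𝔞 𝔞H μqs μ₂ μ₁ archH Pk μω
      (J8.pairG_cm 𝔩 𝔞 𝔞H μqs μ₂ μ₁ archH Pk pairSome)) (fun Q => Q.1.fin) (fun f' => 𝔨.traceGp f') νinf νG (J8.trB 𝔩 𝔞 μqs Pk S₀ νGψ archTr) trH IsOneDim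
      (fun ρ => R90.S5.IsOneDimH ρ) (fun ρ h => h.choose) AllPkt ofDisc trAll IsL2At trPPrime psi' (MnNeZeroCohTriv_cm L μω (gOfRecord 𝔩 𝔞 𝔞H μqs μ₂ μ₁
      archH Pk μω (J8.pairG_cm 𝔩 𝔞 𝔞H μqs μ₂ μ₁ archH Pk pairSome)) (fun ρ => R90.S5.IsOneDimH ρ) (fun ρ h => h.choose) (fun _ _ => True)) LiftL2At PiRho'
      sgn' HasPinComponent) ν (fun f' => 𝔨.traceGp f') hanis
        (fun F => (ComparisonKit.IsPinned.traceGp_eq 𝔨 hpin hanis) ▸ rfl) (X_cm_traceL L ι H T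
      hT μ (xiPacketFamilyOfRecordSCD L H (transpose_map_cmConjRingHom_eq_of_frame L ι H T hT) (isUnit_det_of_frame L ι H T hT) μω hμu μZ
      (F0P3XiPacketFamilyOfRecord.keysOfKeysCaseTwo L μω (F0P3KeysCaseTwoOfStubs.keysCaseTwo_of_stubs L (F0P2oLocalLettersHold.keysCaseTwoReducible_holds L)
      (F0P3U3SquareIntegrableExponentsHolds.u3SquareIntegrableExponents_holds (L := L))) μZ hquad) (hSCD_of_cmCharIdentityPackageTestSigned L H
      (transpose_map_cmConjRingHom_eq_of_frame L ι H T hT) (isUnit_det_of_frame L ι H T hT) μω hμu (finExplicitCollection L H μω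
      (finExplicitDelta_conj_left_all L H μω) (finExplicitDelta_conj_right_all L H μω)) mH mG νG νH μZ hQ)) 𝔩 (gOfRecord 𝔩 𝔞 𝔞H μqs μ₂ μ₁ archH Pk μω
      (J8.pairG_cm 𝔩 𝔞 𝔞H μqs μ₂ μ₁ archH Pk pairSome)) (fun Q => Q.1.fin) (fun f' => 𝔨.traceGp f') νinf νG (J8.trB 𝔩 𝔞 μqs Pk S₀ νGψ archTr) trH IsOneDim
      (fun ρ => R90.S5.IsOneDimH ρ) (fun ρ h => h.choose) AllPkt ofDisc trAll IsL2At trPPrime psi' (MnNeZeroCohTriv_cm L μω (gOfRecord 𝔩 𝔞 𝔞H μqs μ₂ μ₁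
      archH Pk μω (J8.pairG_cm 𝔩 𝔞 𝔞H μqs μ₂ μ₁ archH Pk pairSome)) (fun ρ => R90.S5.IsOneDimH ρ) (fun ρ h => h.choose) (fun _ _ => True)) LiftL2At PiRho'
      sgn' HasPinComponent)
        (fun l => InnerFormSec146.IsLevelTest L ι H T hT l) (fun l p h => InnerFormSec146.testPair_of_isLevelTest L ι H T hT l p
      h)) (Smooth_cm L ι H T hT 𝔨.Smooth) (Transfer_cm L ι H T hT 𝔨.Transfer) (TransferH_cm L ι H T hT 𝔨.Smooth 𝔨.TransferH) (fun f => 𝔨.SJGtot f) (fun fH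
      => 𝔨.SJHtot fH) (fun f' f fH _hsm hm => (X_cm_traceL L ι H T hT μ (xiPacketFamilyOfRecordSCD L H (transpose_map_cmConjRingHom_eq_of_frame L ι H T hT)
      (isUnit_det_of_frame L ι H T hT) μω hμu μZ (F0P3XiPacketFamilyOfRecord.keysOfKeysCaseTwo L μω (F0P3KeysCaseTwoOfStubs.keysCaseTwo_of_stubs L
      (F0P2oLocalLettersHold.keysCaseTwoReducible_holds L) (F0P3U3SquareIntegrableExponentsHolds.u3SquareIntegrableExponents_holds (L := L))) μZ hquad)
      (hSCD_of_cmCharIdentityPackageTestSigned L H (transpose_map_cmConjRingHom_eq_of_frame L ι H T hT) (isUnit_det_of_frame L ι H T hT) μω hμu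
      (finExplicitCollection L H μω (finExplicitDelta_conj_left_all L H μω) (finExplicitDelta_conj_right_all L H μω)) mH mG νG νH μZ hQ)) 𝔩 (gOfRecord 𝔩 𝔞
      𝔞H μqs μ₂ μ₁ archH Pk μω (J8.pairG_cm 𝔩 𝔞 𝔞H μqs μ₂ μ₁ archH Pk pairSome)) (fun Q => Q.1.fin) (fun f' => 𝔨.traceGp f') νinf νG (J8.trB 𝔩 𝔞 μqs Pk S₀
      νGψ archTr) trH IsOneDim (fun ρ => R90.S5.IsOneDimH ρ) (fun ρ h => h.choose) AllPkt ofDisc trAll IsL2At trPPrime psi' (MnNeZeroCohTriv_cm L μω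
      (gOfRecord 𝔩 𝔞 𝔞H μqs μ₂ μ₁ archH Pk μω (J8.pairG_cm 𝔩 𝔞 𝔞H μqs μ₂ μ₁ archH Pk pairSome)) (fun ρ => R90.S5.IsOneDimH ρ) (fun ρ h => h.choose) (fun _ _
      => True)) LiftL2At PiRho' sgn' HasPinComponent f').trans ((hstf (tensOfPair L H ι T hT f')).2.trans (ComparisonKit.IsPinned.ellipticStabilisation 𝔨
      hpin hanis (transpose_map_cmConjRingHom_eq_of_frame L ι H T hT) isHaar_νG hvol isHaar_νH hvolH hstf (tensOfPair L H ι T hT f') f fH ⟨hm.1.2,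
      hm.2.2⟩).2)) (PSVanish_cm L ι H T hT 𝔨.Smooth 𝔨.Transfer) (PSVanishH_cm L ι H T hT 𝔨.Smooth 𝔨.TransferH)
      (J8.stableDiscreteExpansionG_of_trOn_of_memUnique 𝔩 𝔞 𝔞H μqs μ₂ μ₁ archH Pk μω S₀ νGψ archTr pairSome (fun f => 𝔨.SJGtot f) (PSVanish_cm L ι H T hT
      𝔨.Smooth 𝔨.Transfer) hT1e hMU) hH61 (fun f' f h => ⟨f', h⟩) (fun f' fH h => ⟨f', h⟩) tw twH l₁ hTw hTHw hEP hEH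
      (InnerFormSec146.isCountablyLinIndepOn_evOff L H hanis νG isHaar_νG) (InnerFormSec146.hcoverR_of_posDetector (TestG L) (TestH L) L ι H T hT μ νG
      (xiPacketFamilyOfRecordSCD L H (transpose_map_cmConjRingHom_eq_of_frame L ι H T hT) (isUnit_det_of_frame L ι H T hT) μω hμu μZ
      (F0P3XiPacketFamilyOfRecord.keysOfKeysCaseTwo L μω (F0P3KeysCaseTwoOfStubs.keysCaseTwo_of_stubs L (F0P2oLocalLettersHold.keysCaseTwoReducible_holds L)
      (F0P3U3SquareIntegrableExponentsHolds.u3SquareIntegrableExponents_holds (L := L))) μZ hquad) (hSCD_of_cmCharIdentityPackageTestSigned L H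
      (transpose_map_cmConjRingHom_eq_of_frame L ι H T hT) (isUnit_det_of_frame L ι H T hT) μω hμu (finExplicitCollection L H μω
      (finExplicitDelta_conj_left_all L H μω) (finExplicitDelta_conj_right_all L H μω)) mH mG νG νH μZ hQ)) 𝔩 (X_cm L ι H T hT μ (xiPacketFamilyOfRecordSCD
      L H (transpose_map_cmConjRingHom_eq_of_frame L ι H T hT) (isUnit_det_of_frame L ι H T hT) μω hμu μZ (F0P3XiPacketFamilyOfRecord.keysOfKeysCaseTwo L μω
      (F0P3KeysCaseTwoOfStubs.keysCaseTwo_of_stubs L (F0P2oLocalLettersHold.keysCaseTwoReducible_holds L)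
      (F0P3U3SquareIntegrableExponentsHolds.u3SquareIntegrableExponents_holds (L := L))) μZ hquad) (hSCD_of_cmCharIdentityPackageTestSigned L H
      (transpose_map_cmConjRingHom_eq_of_frame L ι H T hT) (isUnit_det_of_frame L ι H T hT) μω hμu (finExplicitCollection L H μω
      (finExplicitDelta_conj_left_all L H μω) (finExplicitDelta_conj_right_all L H μω)) mH mG νG νH μZ hQ)) 𝔩 (gOfRecord 𝔩 𝔞 𝔞H μqs μ₂ μ₁ archH Pk μω
      (J8.pairG_cm 𝔩 𝔞 𝔞H μqs μ₂ μ₁ archH Pk pairSome)) (fun Q => Q.1.fin) (fun f' => 𝔨.traceGp f') νinf νG (J8.trB 𝔩 𝔞 μqs Pk S₀ νGψ archTr) trH IsOneDim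
      (fun ρ => R90.S5.IsOneDimH ρ) (fun ρ h => h.choose) AllPkt ofDisc trAll IsL2At trPPrime psi' (MnNeZeroCohTriv_cm L μω (gOfRecord 𝔩 𝔞 𝔞H μqs μ₂ μ₁
      archH Pk μω (J8.pairG_cm 𝔩 𝔞 𝔞H μqs μ₂ μ₁ archH Pk pairSome)) (fun ρ => R90.S5.IsOneDimH ρ) (fun ρ h => h.choose) (fun _ _ => True)) LiftL2At PiRho'
      sgn' HasPinComponent) (Smooth_cm L ι H T hT 𝔨.Smooth) (Transfer_cm L ι H T hT 𝔨.Transfer) (TransferH_cm L ι H T hT 𝔨.Smooth 𝔨.TransferH)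
      (transferPair_exists_of_kitLaws L ι H T hT 𝔨.Smooth 𝔨.Transfer 𝔨.TransferH (fun f' h => (hpin.2.2.2.1 f').2 h) htE)
      (InnerFormSec146.posDetector_of_archDetector (TestG L) (TestH L) L ι H T hT μ νG (xiPacketFamilyOfRecordSCD L H
      (transpose_map_cmConjRingHom_eq_of_frame L ι H T hT) (isUnit_det_of_frame L ι H T hT) μω hμu μZ (F0P3XiPacketFamilyOfRecord.keysOfKeysCaseTwo L μω
      (F0P3KeysCaseTwoOfStubs.keysCaseTwo_of_stubs L (F0P2oLocalLettersHold.keysCaseTwoReducible_holds L)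
      (F0P3U3SquareIntegrableExponentsHolds.u3SquareIntegrableExponents_holds (L := L))) μZ hquad) (hSCD_of_cmCharIdentityPackageTestSigned L H
      (transpose_map_cmConjRingHom_eq_of_frame L ι H T hT) (isUnit_det_of_frame L ι H T hT) μω hμu (finExplicitCollection L H μω
      (finExplicitDelta_conj_left_all L H μω) (finExplicitDelta_conj_right_all L H μω)) mH mG νG νH μZ hQ)) 𝔩 (X_cm L ι H T hT μ (xiPacketFamilyOfRecordSCD
      L H (transpose_map_cmConjRingHom_eq_of_frame L ι H T hT) (isUnit_det_of_frame L ι H T hT) μω hμu μZ (F0P3XiPacketFamilyOfRecord.keysOfKeysCaseTwo L μω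
      (F0P3KeysCaseTwoOfStubs.keysCaseTwo_of_stubs L (F0P2oLocalLettersHold.keysCaseTwoReducible_holds L)
      (F0P3U3SquareIntegrableExponentsHolds.u3SquareIntegrableExponents_holds (L := L))) μZ hquad) (hSCD_of_cmCharIdentityPackageTestSigned L H
      (transpose_map_cmConjRingHom_eq_of_frame L ι H T hT) (isUnit_det_of_frame L ι H T hT) μω hμu (finExplicitCollection L H μω
      (finExplicitDelta_conj_left_all L H μω) (finExplicitDelta_conj_right_all L H μω)) mH mG νG νH μZ hQ)) 𝔩 (gOfRecord 𝔩 𝔞 𝔞H μqs μ₂ μ₁ archH Pk μω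
      (J8.pairG_cm 𝔩 𝔞 𝔞H μqs μ₂ μ₁ archH Pk pairSome)) (fun Q => Q.1.fin) (fun f' => 𝔨.traceGp f') νinf νG (J8.trB 𝔩 𝔞 μqs Pk S₀ νGψ archTr) trH IsOneDim
      (fun ρ => R90.S5.IsOneDimH ρ) (fun ρ h => h.choose) AllPkt ofDisc trAll IsL2At trPPrime psi' (MnNeZeroCohTriv_cm L μω (gOfRecord 𝔩 𝔞 𝔞H μqs μ₂ μ₁
      archH Pk μω (J8.pairG_cm 𝔩 𝔞 𝔞H μqs μ₂ μ₁ archH Pk pairSome)) (fun ρ => R90.S5.IsOneDimH ρ) (fun ρ h => h.choose) (fun _ _ => True)) LiftL2At PiRho'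
      sgn' HasPinComponent) hanis isHaar_νG (fun π φ => UnitaryGroup.archTr₀ L ι H T hT νinf (InnerFormSec146.tupleOf L ι H T hT μ π).1 φ) (htrX_cm L ι H T
      hT μ (xiPacketFamilyOfRecordSCD L H (transpose_map_cmConjRingHom_eq_of_frame L ι H T hT) (isUnit_det_of_frame L ι H T hT) μω hμu μZ
      (F0P3XiPacketFamilyOfRecord.keysOfKeysCaseTwo L μω (F0P3KeysCaseTwoOfStubs.keysCaseTwo_of_stubs L (F0P2oLocalLettersHold.keysCaseTwoReducible_holds L)
      (F0P3U3SquareIntegrableExponentsHolds.u3SquareIntegrableExponents_holds (L := L))) μZ hquad) (hSCD_of_cmCharIdentityPackageTestSigned L H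
      (transpose_map_cmConjRingHom_eq_of_frame L ι H T hT) (isUnit_det_of_frame L ι H T hT) μω hμu (finExplicitCollection L H μω
      (finExplicitDelta_conj_left_all L H μω) (finExplicitDelta_conj_right_all L H μω)) mH mG νG νH μZ hQ)) 𝔩 (gOfRecord 𝔩 𝔞 𝔞H μqs μ₂ μ₁ archH Pk μω
      (J8.pairG_cm 𝔩 𝔞 𝔞H μqs μ₂ μ₁ archH Pk pairSome)) (fun Q => Q.1.fin) (fun f' => 𝔨.traceGp f') νinf νG (J8.trB 𝔩 𝔞 μqs Pk S₀ νGψ archTr) trH IsOneDim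
      (fun ρ => R90.S5.IsOneDimH ρ) (fun ρ h => h.choose) AllPkt ofDisc trAll IsL2At trPPrime psi' (MnNeZeroCohTriv_cm L μω (gOfRecord 𝔩 𝔞 𝔞H μqs μ₂ μ₁
      archH Pk μω (J8.pairG_cm 𝔩 𝔞 𝔞H μqs μ₂ μ₁ archH Pk pairSome)) (fun ρ => R90.S5.IsOneDimH ρ) (fun ρ h => h.choose) (fun _ _ => True)) LiftL2At PiRho'
      sgn' HasPinComponent) (sock_S9_archPosDetector_cm L ι H T hT μ νinf hνinf))) (sock_S9_levelMatchingFrames_cm L H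
      (transpose_map_cmConjRingHom_eq_of_frame L ι H T hT) (isUnit_det_of_frame L ι H T hT)) (InnerFormSec146.htP_gammaSph_of_packetRigidity _ (TestG L)
      (TestH L) L ι H T hT μ νG (xiPacketFamilyOfRecordSCD L H (transpose_map_cmConjRingHom_eq_of_frame L ι H T hT) (isUnit_det_of_frame L ι H T hT) μω hμu
      μZ (F0P3XiPacketFamilyOfRecord.keysOfKeysCaseTwo L μω (F0P3KeysCaseTwoOfStubs.keysCaseTwo_of_stubs L (F0P2oLocalLettersHold.keysCaseTwoReducible_holds
      L) (F0P3U3SquareIntegrableExponentsHolds.u3SquareIntegrableExponents_holds (L := L))) μZ hquad) (hSCD_of_cmCharIdentityPackageTestSigned L H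
      (transpose_map_cmConjRingHom_eq_of_frame L ι H T hT) (isUnit_det_of_frame L ι H T hT) μω hμu (finExplicitCollection L H μω
      (finExplicitDelta_conj_left_all L H μω) (finExplicitDelta_conj_right_all L H μω)) mH mG νG νH μZ hQ)) 𝔩 (X_cm L ι H T hT μ (xiPacketFamilyOfRecordSCD
      L H (transpose_map_cmConjRingHom_eq_of_frame L ι H T hT) (isUnit_det_of_frame L ι H T hT) μω hμu μZ (F0P3XiPacketFamilyOfRecord.keysOfKeysCaseTwo L μω
      (F0P3KeysCaseTwoOfStubs.keysCaseTwo_of_stubs L (F0P2oLocalLettersHold.keysCaseTwoReducible_holds L)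
      (F0P3U3SquareIntegrableExponentsHolds.u3SquareIntegrableExponents_holds (L := L))) μZ hquad) (hSCD_of_cmCharIdentityPackageTestSigned L H
      (transpose_map_cmConjRingHom_eq_of_frame L ι H T hT) (isUnit_det_of_frame L ι H T hT) μω hμu (finExplicitCollection L H μω
      (finExplicitDelta_conj_left_all L H μω) (finExplicitDelta_conj_right_all L H μω)) mH mG νG νH μZ hQ)) 𝔩 (gOfRecord 𝔩 𝔞 𝔞H μqs μ₂ μ₁ archH Pk μω
      (J8.pairG_cm 𝔩 𝔞 𝔞H μqs μ₂ μ₁ archH Pk pairSome)) (fun Q => Q.1.fin) (fun f' => 𝔨.traceGp f') νinf νG (J8.trB 𝔩 𝔞 μqs Pk S₀ νGψ archTr) trH IsOneDim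
      (fun ρ => R90.S5.IsOneDimH ρ) (fun ρ h => h.choose) AllPkt ofDisc trAll IsL2At trPPrime psi' (MnNeZeroCohTriv_cm L μω (gOfRecord 𝔩 𝔞 𝔞H μqs μ₂ μ₁
      archH Pk μω (J8.pairG_cm 𝔩 𝔞 𝔞H μqs μ₂ μ₁ archH Pk pairSome)) (fun ρ => R90.S5.IsOneDimH ρ) (fun ρ h => h.choose) (fun _ _ => True)) LiftL2At PiRho'
      sgn' HasPinComponent) isHaar_νG (sock_S9_levelMatchingFrames_cm L H (transpose_map_cmConjRingHom_eq_of_frame L ι H T hT) (isUnit_det_of_frame L ι H T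
      hT)) hrigG) (aPacketsOfRecordDisjointAt_recordSCD_of_nonsplit L H (transpose_map_cmConjRingHom_eq_of_frame L ι H T hT) (isUnit_det_of_frame L ι H T
      hT) μω hμu μZ _ _ (sock_S9_aPacketsDisjointNonsplit_cm L ι H T hT hdef h2 μ μω hμu hμω ν νH νG νGi νqi νHi μZ isHaar_ν isInvInv_ν isHaar_νH
      isRightInv_νH isHaar_νG isRightInv_νG finCpt_νGi rightInv_νGi finCpt_νqi rightInv_νqi finCpt_νHi rightInv_νHi isHaar_μZ hquad hvol hvolH mH mG hcan 𝔨
      hpin htE hstf hΔk hmH hmG hQ hex7)) (gOfRecord_packetTrichotomy 𝔩 𝔞 𝔞H μqs μ₂ μ₁ archH Pk μω (J8.pairG_cm 𝔩 𝔞 𝔞H μqs μ₂ μ₁ archH Pk pairSome)) (fun P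
      h => h) (InnerFormSec146.hliftE_of_functional_of_tP _ (TestG L) (TestH L) L ι H T hT μ νG (xiPacketFamilyOfRecordSCD L H
      (transpose_map_cmConjRingHom_eq_of_frame L ι H T hT) (isUnit_det_of_frame L ι H T hT) μω hμu μZ (F0P3XiPacketFamilyOfRecord.keysOfKeysCaseTwo L μω
      (F0P3KeysCaseTwoOfStubs.keysCaseTwo_of_stubs L (F0P2oLocalLettersHold.keysCaseTwoReducible_holds L)
      (F0P3U3SquareIntegrableExponentsHolds.u3SquareIntegrableExponents_holds (L := L))) μZ hquad) (hSCD_of_cmCharIdentityPackageTestSigned L H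
      (transpose_map_cmConjRingHom_eq_of_frame L ι H T hT) (isUnit_det_of_frame L ι H T hT) μω hμu (finExplicitCollection L H μω
      (finExplicitDelta_conj_left_all L H μω) (finExplicitDelta_conj_right_all L H μω)) mH mG νG νH μZ hQ)) 𝔩 (X_cm L ι H T hT μ (xiPacketFamilyOfRecordSCD
      L H (transpose_map_cmConjRingHom_eq_of_frame L ι H T hT) (isUnit_det_of_frame L ι H T hT) μω hμu μZ (F0P3XiPacketFamilyOfRecord.keysOfKeysCaseTwo L μω
      (F0P3KeysCaseTwoOfStubs.keysCaseTwo_of_stubs L (F0P2oLocalLettersHold.keysCaseTwoReducible_holds L)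
      (F0P3U3SquareIntegrableExponentsHolds.u3SquareIntegrableExponents_holds (L := L))) μZ hquad) (hSCD_of_cmCharIdentityPackageTestSigned L H
      (transpose_map_cmConjRingHom_eq_of_frame L ι H T hT) (isUnit_det_of_frame L ι H T hT) μω hμu (finExplicitCollection L H μω
      (finExplicitDelta_conj_left_all L H μω) (finExplicitDelta_conj_right_all L H μω)) mH mG νG νH μZ hQ)) 𝔩 (gOfRecord 𝔩 𝔞 𝔞H μqs μ₂ μ₁ archH Pk μω
      (J8.pairG_cm 𝔩 𝔞 𝔞H μqs μ₂ μ₁ archH Pk pairSome)) (fun Q => Q.1.fin) (fun f' => 𝔨.traceGp f') νinf νG (J8.trB 𝔩 𝔞 μqs Pk S₀ νGψ archTr) trH IsOneDim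
      (fun ρ => R90.S5.IsOneDimH ρ) (fun ρ h => h.choose) AllPkt ofDisc trAll IsL2At trPPrime psi' (MnNeZeroCohTriv_cm L μω (gOfRecord 𝔩 𝔞 𝔞H μqs μ₂ μ₁
      archH Pk μω (J8.pairG_cm 𝔩 𝔞 𝔞H μqs μ₂ μ₁ archH Pk pairSome)) (fun ρ => R90.S5.IsOneDimH ρ) (fun ρ h => h.choose) (fun _ _ => True)) LiftL2At PiRho'
      sgn' HasPinComponent) (fun ρ P Q h h' => R90.S5.LiftsToOfRecord.packet_eq h h') (InnerFormSec146.htP_gammaSph_of_packetRigidity _ (TestG L) (TestH L)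
      L ι H T hT μ νG (xiPacketFamilyOfRecordSCD L H (transpose_map_cmConjRingHom_eq_of_frame L ι H T hT) (isUnit_det_of_frame L ι H T hT) μω hμu μZ
      (F0P3XiPacketFamilyOfRecord.keysOfKeysCaseTwo L μω (F0P3KeysCaseTwoOfStubs.keysCaseTwo_of_stubs L (F0P2oLocalLettersHold.keysCaseTwoReducible_holds L)
      (F0P3U3SquareIntegrableExponentsHolds.u3SquareIntegrableExponents_holds (L := L))) μZ hquad) (hSCD_of_cmCharIdentityPackageTestSigned L H
      (transpose_map_cmConjRingHom_eq_of_frame L ι H T hT) (isUnit_det_of_frame L ι H T hT) μω hμu (finExplicitCollection L H μω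
      (finExplicitDelta_conj_left_all L H μω) (finExplicitDelta_conj_right_all L H μω)) mH mG νG νH μZ hQ)) 𝔩 (X_cm L ι H T hT μ (xiPacketFamilyOfRecordSCD
      L H (transpose_map_cmConjRingHom_eq_of_frame L ι H T hT) (isUnit_det_of_frame L ι H T hT) μω hμu μZ (F0P3XiPacketFamilyOfRecord.keysOfKeysCaseTwo L μω
      (F0P3KeysCaseTwoOfStubs.keysCaseTwo_of_stubs L (F0P2oLocalLettersHold.keysCaseTwoReducible_holds L)
      (F0P3U3SquareIntegrableExponentsHolds.u3SquareIntegrableExponents_holds (L := L))) μZ hquad) (hSCD_of_cmCharIdentityPackageTestSigned L H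
      (transpose_map_cmConjRingHom_eq_of_frame L ι H T hT) (isUnit_det_of_frame L ι H T hT) μω hμu (finExplicitCollection L H μω
      (finExplicitDelta_conj_left_all L H μω) (finExplicitDelta_conj_right_all L H μω)) mH mG νG νH μZ hQ)) 𝔩 (gOfRecord 𝔩 𝔞 𝔞H μqs μ₂ μ₁ archH Pk μω
      (J8.pairG_cm 𝔩 𝔞 𝔞H μqs μ₂ μ₁ archH Pk pairSome)) (fun Q => Q.1.fin) (fun f' => 𝔨.traceGp f') νinf νG (J8.trB 𝔩 𝔞 μqs Pk S₀ νGψ archTr) trH IsOneDim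
      (fun ρ => R90.S5.IsOneDimH ρ) (fun ρ h => h.choose) AllPkt ofDisc trAll IsL2At trPPrime psi' (MnNeZeroCohTriv_cm L μω (gOfRecord 𝔩 𝔞 𝔞H μqs μ₂ μ₁
      archH Pk μω (J8.pairG_cm 𝔩 𝔞 𝔞H μqs μ₂ μ₁ archH Pk pairSome)) (fun ρ => R90.S5.IsOneDimH ρ) (fun ρ h => h.choose) (fun _ _ => True)) LiftL2At PiRho'
      sgn' HasPinComponent) isHaar_νG (sock_S9_levelMatchingFrames_cm L H (transpose_map_cmConjRingHom_eq_of_frame L ι H T hT) (isUnit_det_of_frame L ι H T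
      hT)) hrigG)) (fun ξ h1 => R90.S5.nHOfRecord_isThetaFin_of_not _ (R90.S5.not_isThetaFin_of_isOneDimH₀ hμu h1)) (hli_gammaSph_smooth L ι H T hT νinf νG
      hdef hanis hνinf isHaar_νG μ (TestG L) (TestH L) (xiPacketFamilyOfRecordSCD L H (transpose_map_cmConjRingHom_eq_of_frame L ι H T hT)
      (isUnit_det_of_frame L ι H T hT) μω hμu μZ (F0P3XiPacketFamilyOfRecord.keysOfKeysCaseTwo L μω (F0P3KeysCaseTwoOfStubs.keysCaseTwo_of_stubs L
      (F0P2oLocalLettersHold.keysCaseTwoReducible_holds L) (F0P3U3SquareIntegrableExponentsHolds.u3SquareIntegrableExponents_holds (L := L))) μZ hquad)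
      (hSCD_of_cmCharIdentityPackageTestSigned L H (transpose_map_cmConjRingHom_eq_of_frame L ι H T hT) (isUnit_det_of_frame L ι H T hT) μω hμu
      (finExplicitCollection L H μω (finExplicitDelta_conj_left_all L H μω) (finExplicitDelta_conj_right_all L H μω)) mH mG νG νH μZ hQ)) 𝔩
      (transpose_map_cmConjRingHom_eq_of_frame L ι H T hT) (isUnit_det_of_frame L ι H T hT) hvol (X_cm L ι H T hT μ (xiPacketFamilyOfRecordSCD L H
      (transpose_map_cmConjRingHom_eq_of_frame L ι H T hT) (isUnit_det_of_frame L ι H T hT) μω hμu μZ (F0P3XiPacketFamilyOfRecord.keysOfKeysCaseTwo L μω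
      (F0P3KeysCaseTwoOfStubs.keysCaseTwo_of_stubs L (F0P2oLocalLettersHold.keysCaseTwoReducible_holds L)
      (F0P3U3SquareIntegrableExponentsHolds.u3SquareIntegrableExponents_holds (L := L))) μZ hquad) (hSCD_of_cmCharIdentityPackageTestSigned L H
      (transpose_map_cmConjRingHom_eq_of_frame L ι H T hT) (isUnit_det_of_frame L ι H T hT) μω hμu (finExplicitCollection L H μω
      (finExplicitDelta_conj_left_all L H μω) (finExplicitDelta_conj_right_all L H μω)) mH mG νG νH μZ hQ)) 𝔩 (gOfRecord 𝔩 𝔞 𝔞H μqs μ₂ μ₁ archH Pk μω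
      (J8.pairG_cm 𝔩 𝔞 𝔞H μqs μ₂ μ₁ archH Pk pairSome)) (fun Q => Q.1.fin) (fun f' => 𝔨.traceGp f') νinf νG (J8.trB 𝔩 𝔞 μqs Pk S₀ νGψ archTr) trH IsOneDim
      (fun ρ => R90.S5.IsOneDimH ρ) (fun ρ h => h.choose) AllPkt ofDisc trAll IsL2At trPPrime psi' (MnNeZeroCohTriv_cm L μω (gOfRecord 𝔩 𝔞 𝔞H μqs μ₂ μ₁
      archH Pk μω (J8.pairG_cm 𝔩 𝔞 𝔞H μqs μ₂ μ₁ archH Pk pairSome)) (fun ρ => R90.S5.IsOneDimH ρ) (fun ρ h => h.choose) (fun _ _ => True)) LiftL2At PiRho'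
      sgn' HasPinComponent) (sock_S9_kcSphericalComponents_cm L ι H T hT μ) (sock_S9_archComponent_cm L ι H T hT μ) (fun π' φf _ => htrX_cm L ι H T hT μ
      (xiPacketFamilyOfRecordSCD L H (transpose_map_cmConjRingHom_eq_of_frame L ι H T hT) (isUnit_det_of_frame L ι H T hT) μω hμu μZ
      (F0P3XiPacketFamilyOfRecord.keysOfKeysCaseTwo L μω (F0P3KeysCaseTwoOfStubs.keysCaseTwo_of_stubs L (F0P2oLocalLettersHold.keysCaseTwoReducible_holds L)
      (F0P3U3SquareIntegrableExponentsHolds.u3SquareIntegrableExponents_holds (L := L))) μZ hquad) (hSCD_of_cmCharIdentityPackageTestSigned L H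
      (transpose_map_cmConjRingHom_eq_of_frame L ι H T hT) (isUnit_det_of_frame L ι H T hT) μω hμu (finExplicitCollection L H μω
      (finExplicitDelta_conj_left_all L H μω) (finExplicitDelta_conj_right_all L H μω)) mH mG νG νH μZ hQ)) 𝔩 (gOfRecord 𝔩 𝔞 𝔞H μqs μ₂ μ₁ archH Pk μω
      (J8.pairG_cm 𝔩 𝔞 𝔞H μqs μ₂ μ₁ archH Pk pairSome)) (fun Q => Q.1.fin) (fun f' => 𝔨.traceGp f') νinf νG (J8.trB 𝔩 𝔞 μqs Pk S₀ νGψ archTr) trH IsOneDim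
      (fun ρ => R90.S5.IsOneDimH ρ) (fun ρ h => h.choose) AllPkt ofDisc trAll IsL2At trPPrime psi' (MnNeZeroCohTriv_cm L μω (gOfRecord 𝔩 𝔞 𝔞H μqs μ₂ μ₁
      archH Pk μω (J8.pairG_cm 𝔩 𝔞 𝔞H μqs μ₂ μ₁ archH Pk pairSome)) (fun ρ => R90.S5.IsOneDimH ρ) (fun ρ h => h.choose) (fun _ _ => True)) LiftL2At PiRho'
      sgn' HasPinComponent π' φf)) (hex_of_transferPair_exists L ι H T hT 𝔨.Smooth 𝔨.Transfer 𝔨.TransferH (fun f' h => (hpin.2.2.2.1 f').2 h) htE)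
      (InnerFormSec146.hcover_gammaSph_of_partner (TestG L) (TestH L) L ι H T hT μ νG (xiPacketFamilyOfRecordSCD L H
      (transpose_map_cmConjRingHom_eq_of_frame L ι H T hT) (isUnit_det_of_frame L ι H T hT) μω hμu μZ (F0P3XiPacketFamilyOfRecord.keysOfKeysCaseTwo L μω
      (F0P3KeysCaseTwoOfStubs.keysCaseTwo_of_stubs L (F0P2oLocalLettersHold.keysCaseTwoReducible_holds L)
      (F0P3U3SquareIntegrableExponentsHolds.u3SquareIntegrableExponents_holds (L := L))) μZ hquad) (hSCD_of_cmCharIdentityPackageTestSigned L H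
      (transpose_map_cmConjRingHom_eq_of_frame L ι H T hT) (isUnit_det_of_frame L ι H T hT) μω hμu (finExplicitCollection L H μω
      (finExplicitDelta_conj_left_all L H μω) (finExplicitDelta_conj_right_all L H μω)) mH mG νG νH μZ hQ)) 𝔩 (X_cm L ι H T hT μ (xiPacketFamilyOfRecordSCD
      L H (transpose_map_cmConjRingHom_eq_of_frame L ι H T hT) (isUnit_det_of_frame L ι H T hT) μω hμu μZ (F0P3XiPacketFamilyOfRecord.keysOfKeysCaseTwo L μω
      (F0P3KeysCaseTwoOfStubs.keysCaseTwo_of_stubs L (F0P2oLocalLettersHold.keysCaseTwoReducible_holds L)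
      (F0P3U3SquareIntegrableExponentsHolds.u3SquareIntegrableExponents_holds (L := L))) μZ hquad) (hSCD_of_cmCharIdentityPackageTestSigned L H
      (transpose_map_cmConjRingHom_eq_of_frame L ι H T hT) (isUnit_det_of_frame L ι H T hT) μω hμu (finExplicitCollection L H μω
      (finExplicitDelta_conj_left_all L H μω) (finExplicitDelta_conj_right_all L H μω)) mH mG νG νH μZ hQ)) 𝔩 (gOfRecord 𝔩 𝔞 𝔞H μqs μ₂ μ₁ archH Pk μω
      (J8.pairG_cm 𝔩 𝔞 𝔞H μqs μ₂ μ₁ archH Pk pairSome)) (fun Q => Q.1.fin) (fun f' => 𝔨.traceGp f') νinf νG (J8.trB 𝔩 𝔞 μqs Pk S₀ νGψ archTr) trH IsOneDim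
      (fun ρ => R90.S5.IsOneDimH ρ) (fun ρ h => h.choose) AllPkt ofDisc trAll IsL2At trPPrime psi' (MnNeZeroCohTriv_cm L μω (gOfRecord 𝔩 𝔞 𝔞H μqs μ₂ μ₁
      archH Pk μω (J8.pairG_cm 𝔩 𝔞 𝔞H μqs μ₂ μ₁ archH Pk pairSome)) (fun ρ => R90.S5.IsOneDimH ρ) (fun ρ h => h.choose) (fun _ _ => True)) LiftL2At PiRho'
      sgn' HasPinComponent) hanis (sock_S9_levelMatchingFrames_cm L H (transpose_map_cmConjRingHom_eq_of_frame L ι H T hT) (isUnit_det_of_frame L ι H T hT))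
      _ (fun p hp => hp)) hcore (fun P' ξ' hA' _ hl' => J8.lifts_eq_singleton_of_preimageUnique 𝔩 𝔞 𝔞H μqs μ₂ μ₁ archH Pk μω (J8.pairG_cm 𝔩 𝔞 𝔞H μqs μ₂ μ₁
      archH Pk pairSome) hL1 P' ξ' hA' hl') (fun P' ξ' hA' _ hl' => J8.n_eq_half_of_preimageUnique 𝔩 𝔞 𝔞H μqs μ₂ μ₁ archH Pk μω (J8.pairG_cm 𝔩 𝔞 𝔞H μqs μ₂
      μ₁ archH Pk pairSome) hL1 P' ξ' hA' hl') hvan144G hvan144H hdef hquad (sock_S9_kcSphericalComponents_cm L ι H T hT μ) (sock_S9_archComponent_cm L ι H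
      T hT μ) p hp a₀ a₂ ha₀ ha₂ hane cpt hR₁ hR₂ hR₀G hR₀H Pξ hA hevpXi


end Summit.HodgeConjecture.HodgeConjecture.R90.S9

end
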